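import Literature.Probability.RandomPlanarGeometry.HexSAWSurfaceWallRenewalSlackTwoClassification
import HarnessLib

/-!
# Slack four, three down steps: the seven `D D D U U U` families and their count `(k − 1)(2k² + 3k − 4)/2`

Self-avoiding walk on the honeycomb lattice in its brick-wall frame (`Eight.adjE`: horizontal steps everywhere, a
vertical edge `(x, y)–(x, y+1)` iff `x + y` is even), in the half-plane `Y ≤ 0`.  An IRREDUCIBLE POSITIVE WALL BRIDGE
`ω ∈ ipwb n` with `v = visits n ω` surface visits has SLACK `n − 6v`; at slack four (`n = 6k + 4`, `v = k ≥ 2`) it has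
`2 ≤ #down ≤ 4` down steps (`…IteratedGap`), the two-down stratum is classified in `…SlackFourTwoDown` (`k + 3` blocks)
and the three-down stratum splits as `{vertical profile D D D U U U} ⊔ {the one D U D D U U block g3b k}`
(`…SlackFourThreeDown`).  This module constructs the `D D D U U U` part explicitly: SEVEN FAMILIES of blocks, each an
affine seven-piece table walk (`Tab.walk` of `…SlackTwoFamilies` §0: wall run, row `−1`, row `−2`, bottom row `−3`,
row `−2`, row `−1`, final wall run), proves that they are irreducible positive wall bridges of length `6k + 4` with `k`
visits, three down steps and three up steps, that they are pairwise distinct, and COUNTS them.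

Families (run words; `R`/`L` = right/left unit steps, `D`/`U` = down/up; parameters `≥ 0` unless stated):
* A2 `s3a k i u` : `R D R D R^{2i+1} D R^{2k−2−2i} U L^{2u+1} U L^{2k−3−2u} U R^{2k−1}`, `i + u + 2
    ≤ k` — `k(k−1)/2` blocks;
* A3 `s3b k a i u` : `R^{2a+1} D L^{2i+1} D L^{2a−1−2i} D R^{2k} U L^{2u+1} U L^{2k−3−2a−2u} U R^{2k−2a−1}`, `i + 1
    ≤ a`,
  `a + u + 2 ≤ k` — `k(k−1)(k−2)/6` blocks;
* A4 `s3c k i u` : `R^{2k−1} D L^{2i+1} D L^{2k−3−2i} D R^{2k−2−2u} U R^{2u+1} U R U R`, `u ≤ i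
    ≤ k − 2` — `k(k−1)/2` blocks;
* A5 `s3d k a i` : `R^{2a+1} D L^{2a−1} D R^{2i+1} D R^{2k−2−2i} U L^{2k−2a−1} U R U R^{2k−2a−1}`, `i + 1 ≤ a ≤ k − 1` —
  `k(k−1)/2` blocks;
* A6 `s3e k a i u` : `R^{2a+1} D L^{2a−1} D R^{2i+1} D R^{2k−2−2i−2u} U R^{2u+1} U L^{2k−2a−1} U R^{2k−2a−1}`, `1
    ≤ a ≤ k − 1`,
  `i + u + 2 ≤ k` — `(k−1)·k(k−1)/2` blocks;
* B2 `s3f k a i u` : `R^{2a+1} D L^{2a−1} D R^{2i+1} D R^{2k−2i} U L^{2u+1} U L^{2k−3−2a−2u} U R^{2k−2a−1}`, `1 ≤ a`,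
  `a + u + 2 ≤ k`, `i + u + 1 ≤ k` (span `2k + 4`) — `(k−2)(k−1)(2k+3)/6` blocks;
* B3 `s3g k i u g` : `R^{2k−1} D L^{2k−3} D R^{2i+1} D R^{2k−2−2i−2u−2g} U R^{2u+1} U R^{2g+1} U R`, `g ≤ 1`, `i
    + u + g + 2 ≤ k`
  (span `2k + 4`) — `(k−1)²` blocks.
(A2–A6 have span `X = 2k + 2`, B2 and B3 span `2k + 4`; the labels are those of the lane's family catalogue.)

Main statements (namespace `…SAW.HexBW.Wall`; `m = 6k + 4` symbolic throughout):
* per family `F ∈ {s3a, …, s3g}`: tables `FX`, `FY`, the walk `F`, `F_facts` (`Tab.Facts`), `F_mem_pwb`, `F_apply`,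
  `F_mem_ipwb` (irreducibility by explicit witnesses), `visits_F = k`, `stepsD_F = {d₁, d₂, d₃}` and
  `stepsU_F = {u₁, u₂, u₃}` (explicit affine times), and the piece-end columns `F_xend r` used below;
* §8 SEPARATION: `F_inj` (injectivity of each parametrisation) and `F_ne_G` for every pair of families (`21` lemmas) —
  two blocks with the same walk have the same down times, the same up times and the same columns at the piece ends,
  which forces the same family and parameters;
* §9 the index simplices `triIdx n = {(v,u) : v + u < n}`, `tetIdx n = {v + i + u < n}`, `dtrIdx n = {v + u < n, i
    + u < n}`
  with `2·#triIdx n = n(n+1)`, `6·#tetIdx n = n(n+1)(n+2)`, `6·#dtrIdx n = n(n+1)(2n+1)`;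
* §10 the ten images `a2Img … b3ImgHi` (B2 and B3 split by `i + u` resp. `g`), `card_…` of each,
    the union `dddBlocks k`,
  ★ `card_dddBlocks_eq`, ★★ `two_mul_card_dddBlocks : 2·#dddBlocks k = (k − 1)(2k² + 3k − 4)` (`= 2·5, 2·23, 2·60,
      2·122,
  2·215, 2·345, …`), ★ `dddBlocks_subset : dddBlocks k ⊆ {ω ∈ ipwb m : visits = k ∧ #stepsD = 3}` and the lower bound
  ★★ `le_two_mul_card_filter_visits_three_down : (k − 1)(2k² + 3k − 4) ≤ 2·#{ω ∈ ipwb m : visits = k ∧ #stepsD = 3}`.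

PROOFS.  Every family statement is linear arithmetic over the affine pieces of its tables (`F_cases`, by `split_ifs`):
adjacency through `Eight.adjE`, self-avoidance = same-row interval disjointness, irreducibility through
`mem_ipwb_of_facts_wit` (each interior visit of the initial wall run is followed by the body's leftmost column `≤ 2`,
each interior visit of the final wall run is preceded by the body's rightmost column), visits through
`visits_add_of_wall` / `visits_add_eq_left`, the vertical steps read off the tables.  Separation: equal walks have equal
`stepsD` / `stepsU` triples, hence termwise equal times (`triple_eq_of_lt`), and equal columns at the (now common)
piece ends; `omega` concludes.  Counting: the images are injective (`card_image_of_injOn`) and pairwise disjoint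
(`card_union_of_disjoint`); the simplices are counted by peeling the last coordinate (`triIdx_succ` etc.) and induction.

STATUS: lane theorem of the a-idea-1 bridge/renewal lineage (successor of cars 77 `…SlackFourTwoDown` and 79c
`…SlackFourThreeDown`); car 85 «slack four: three down families».  OURS (new in writing, modest): the seven explicit
families and the count `(k − 1)(2k² + 3k − 4)/2` of the `D D D U U U` blocks they form.  CHECKED against the lane's
complete enumeration of the irreducible positive wall bridges of length `6k + 4` with `k` visits for `k = 2, …, 15`
(`11, 33, 95, …, 88 645` blocks): the seven families are pairwise disjoint, injectively parametrised, and their union is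
EXACTLY the set of blocks with vertical profile `D D D U U U` (`5, 23, 60, 122, 215, 345, 518, 740, 1 017, 1 355, 1 760,
2 238, 2 795, 3 437` blocks; no duplicate, no omission), so that with `g3b k` the three-down stratum has
`(k − 1)(2k² + 3k − 4)/2 + 1` members — the classification (upper bound) is the business of a successor module.  The
printed sources carry the renewal / irreducible-bridge structure (Madras–Slade §4.2, Definition 4.2.1, (4.2.2);
Definition 1.2.4; Kesten), the brickwork frame of the honeycomb lattice (Enting–Jensen §7.4.2, Fig. 7.10) and the
surface-visit statistic (Beaton et al. §3.1) — none lists these families or counts.  No `set_option` line is used.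
-/

namespace Literature.Probability.RandomPlanarGeometry.SAW.HexBW.Wall

open Finset Filter Function
open Literature.Probability.LatticeModels Literature.Probability.Percolation SimpleGraph

variable {n : ℕ} {ω : ℕ → Site 2}

/-! ### §0  Private tools -/

/-- The Boolean adjacency test `Eight.adjE` read as a proposition. [folklore] -/
private theorem adjE_iff_tda {a b c d : ℤ} : Eight.adjE a b c d = true ↔
    ((c = a + 1 ∨ a = c + 1) ∧ d = b) ∨ (c = a ∧ ((d = b + 1 ∧ (a + b) % 2 = 0) ∨ (b = d + 1 ∧ (c + d) % 2 = 0))) := by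
  simp [Eight.adjE]

/-- Two three-element sets of naturals, each listed increasingly, are equal only termwise. [folklore] -/
private theorem triple_eq_of_lt {a b c a' b' c' : ℕ} (h : ({a, b, c} : Finset ℕ) = {a', b', c'}) (hab : a < b)
    (hbc : b < c) (hab' : a' < b') (hbc' : b' < c') : a = a' ∧ b = b' ∧ c = c' := by
  have h1 : a ∈ ({a', b', c'} : Finset ℕ) := by rw [← h]; simp
  have h2 : b ∈ ({a', b', c'} : Finset ℕ) := by rw [← h]; simp
  have h3 : c ∈ ({a', b', c'} : Finset ℕ) := by rw [← h]; simp
  have h4 : a' ∈ ({a, b, c} : Finset ℕ) := by rw [h]; simp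
  have h5 : b' ∈ ({a, b, c} : Finset ℕ) := by rw [h]; simp
  have h6 : c' ∈ ({a, b, c} : Finset ℕ) := by rw [h]; simp
  simp only [mem_insert, mem_singleton] at h1 h2 h3 h4 h5 h6
  omega

/-! ### §1  Family A2 (`k(k−1)/2` blocks; dive at column `1`,
    excess `0`): `R D R D R^{2i+1} D R^{2k−2−2i} U L^{2u+1} U L^{2k−3−2u} U R^{2k−1}` (`i + u + 2 ≤ k`) -/

/-- Column table of the s3a blocks (length `6k + 4`), seven affine pieces: wall run, row `−1`, row `−2`,
    bottom row `−3`, row `−2`, row `−1`, final wall run (values `(t : ℤ)`, `(t : ℤ) - 1`, `(t : ℤ) - 2`,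
    `(t : ℤ) - 3`, `-(t : ℤ) + 4 * k + 6`, `-(t : ℤ) + 4 * k + 7`,
    `(t : ℤ) - 4 * k - 2` on the successive pieces). [cite: EntingJensen2009, §7.4.2,
    Fig. 7.10 (brickwork form of the honeycomb lattice)] -/
def s3aX (k i u t : ℕ) : ℤ :=
  if t ≤ 1 then (t : ℤ)
  else if t ≤ 3 then (t : ℤ) - 1
  else if t ≤ 2 * i + 5 then (t : ℤ) - 2
  else if t ≤ 2 * k + 4 then (t : ℤ) - 3
  else if t ≤ 2 * k + 2 * u + 6 then -(t : ℤ) + 4 * k + 6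
  else if t ≤ 4 * k + 4 then -(t : ℤ) + 4 * k + 7
  else (t : ℤ) - 4 * k - 2

/-- Height table of the s3a blocks: `0, −1, −2, −3, −2, −1, 0` on the seven pieces. [cite: EntingJensen2009, §7.4.2,
    Fig. 7.10] -/
def s3aY (k i u t : ℕ) : ℤ :=
  if t ≤ 1 then 0
  else if t ≤ 3 then -1
  else if t ≤ 2 * i + 5 then -2
  else if t ≤ 2 * k + 4 then -3
  else if t ≤ 2 * k + 2 * u + 6 then -2
  else if t ≤ 4 * k + 4 then -1
  else 0

/-- **The A2 block**
    `(0,0)→(1,0)↓(1,−1)→(2,−1)↓(2,−2)→…→(2i+3,−2)↓(2i+3,−3)→…→(2k+1,−3)↑(2k+1,−2)←…←(2k−2u,−2)↑(2k−2u,−1)←…←(3,−1)↑(3,0)→…→(2k+2,0)`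
of length `6k+4` (`i + u + 2 ≤ k`; lane file PROOF-slack4-FAMILIES, family A2). [cite: EntingJensen2009, §7.4.2,
    Fig. 7.10] -/
def s3a (k i u : ℕ) : ℕ → Site 2 := Tab.walk (6 * k + 4) (s3aX k i u) (s3aY k i u)

/-- The affine pieces of the tables of `s3a`, with their values. [cite: EntingJensen2009, §7.4.2, Fig. 7.10] -/
private theorem s3a_cases (k i u t : ℕ) :
    (t ≤ 1 ∧ s3aX k i u t = (t : ℤ) ∧ s3aY k i u t = 0) ∨
      (2 ≤ t ∧ t ≤ 3 ∧ s3aX k i u t = (t : ℤ) - 1 ∧ s3aY k i u t = -1) ∨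
      (4 ≤ t ∧ t ≤ 2 * i + 5 ∧ s3aX k i u t = (t : ℤ) - 2 ∧ s3aY k i u t = -2) ∨
      (2 * i + 6 ≤ t ∧ t ≤ 2 * k + 4 ∧ s3aX k i u t = (t : ℤ) - 3 ∧ s3aY k i u t = -3) ∨
      (2 * k + 5 ≤ t ∧ t ≤ 2 * k + 2 * u + 6 ∧ s3aX k i u t = -(t : ℤ) + 4 * k + 6 ∧ s3aY k i u t = -2) ∨
      (2 * k + 2 * u + 7 ≤ t ∧ t ≤ 4 * k + 4 ∧ s3aX k i u t = -(t : ℤ) + 4 * k + 7 ∧ s3aY k i u t = -1) ∨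
      (4 * k + 5 ≤ t ∧ s3aX k i u t = (t : ℤ) - 4 * k - 2 ∧ s3aY k i u t = 0) := by
  simp only [s3aX, s3aY]
  split_ifs
  · exact Or.inl ⟨by omega, by omega, by omega⟩
  · exact Or.inr (Or.inl ⟨by omega, by omega, by omega, by omega⟩)
  · exact Or.inr (Or.inr (Or.inl ⟨by omega, by omega, by omega, by omega⟩))
  · exact Or.inr (Or.inr (Or.inr (Or.inl ⟨by omega, by omega, by omega, by omega⟩)))
  · exact Or.inr (Or.inr (Or.inr (Or.inr (Or.inl ⟨by omega, by omega, by omega, by omega⟩))))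
  · exact Or.inr (Or.inr (Or.inr (Or.inr (Or.inr (Or.inl ⟨by omega, by omega, by omega, by omega⟩)))))
  · exact Or.inr (Or.inr (Or.inr (Or.inr (Or.inr (Or.inr (⟨by omega, by omega, by omega⟩))))))

/-- **Coordinate facts of `s3a`** (`i + u + 2 ≤ k`): brick-wall steps, self-avoidance, lower half-plane, columns in
`[0, X_L]` and `≥ 1` after time `0`, start and end on the wall, even length. [cite: EntingJensen2009, §7.4.2, Fig. 7.10]
[cite: MadrasSlade1993, §1.2, Definition 1.2.4 (bridges, p. 11)] -/
theorem s3a_facts {k i u : ℕ} (hiu : i + u + 2 ≤ k) : Tab.Facts (6 * k + 4) (s3aX k i u) (s3aY k i u) := by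
  refine ⟨fun t ht => ?_, fun t ht s hs hx hy => ?_, fun t ht => ?_, fun t ht => ?_, ?_, ?_, ?_, by omega,
      fun t ht h1 => ?_⟩
  · rw [adjE_iff_tda]
    rcases s3a_cases k i u t with ⟨h, x, y⟩ | ⟨l, h, x, y⟩ | ⟨l, h, x, y⟩ | ⟨l, h, x, y⟩ | ⟨l, h, x, y⟩ | ⟨l, h, x,
        y⟩ | ⟨l, x, y⟩ <;>
      rcases s3a_cases k i u (t + 1) with ⟨h', x', y'⟩ | ⟨l', h', x', y'⟩ | ⟨l', h', x', y'⟩ | ⟨l', h', x',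
          y'⟩ | ⟨l', h', x', y'⟩ | ⟨l', h', x', y'⟩ | ⟨l', x', y'⟩ <;>
        omega
  · rcases s3a_cases k i u t with ⟨h, x, y⟩ | ⟨l, h, x, y⟩ | ⟨l, h, x, y⟩ | ⟨l, h, x, y⟩ | ⟨l, h, x, y⟩ | ⟨l, h, x,
      y⟩ | ⟨l, x, y⟩ <;>
      rcases s3a_cases k i u s with ⟨h', x', y'⟩ | ⟨l', h', x', y'⟩ | ⟨l', h', x', y'⟩ | ⟨l', h', x', y'⟩ | ⟨l', h',
          x', y'⟩ | ⟨l', h', x', y'⟩ | ⟨l', x', y'⟩ <;>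
        omega
  · rcases s3a_cases k i u t with ⟨h, x, y⟩ | ⟨l, h, x, y⟩ | ⟨l, h, x, y⟩ | ⟨l, h, x, y⟩ | ⟨l, h, x, y⟩ | ⟨l, h, x,
      y⟩ | ⟨l, x, y⟩ <;> omega
  · have h0 := s3a_cases k i u 0
    have hL := s3a_cases k i u (6 * k + 4)
    rcases s3a_cases k i u t with ⟨h, x, y⟩ | ⟨l, h, x, y⟩ | ⟨l, h, x, y⟩ | ⟨l, h, x, y⟩ | ⟨l, h, x, y⟩ | ⟨l, h, x,
        y⟩ | ⟨l, x, y⟩ <;> omega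
  · have h0 := s3a_cases k i u 0; omega
  · have h0 := s3a_cases k i u 0; omega
  · have hL := s3a_cases k i u (6 * k + 4); omega
  · rcases s3a_cases k i u t with ⟨h, x, y⟩ | ⟨l, h, x, y⟩ | ⟨l, h, x, y⟩ | ⟨l, h, x, y⟩ | ⟨l, h, x, y⟩ | ⟨l, h, x,
      y⟩ | ⟨l, x, y⟩ <;> omega

/-- `s3a` is a positive wall bridge of length `m = 6k + 4` (length symbolic). [cite: MadrasSlade1993, §1.2,
    Definition 1.2.4 (p. 11)]
[cite: EntingJensen2009, §7.4.2, Fig. 7.10] -/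
theorem s3a_mem_pwb {k i u m : ℕ} (hiu : i + u + 2 ≤ k) (hm : m = 6 * k + 4) : s3a k i u ∈ pwb m :=
  mem_pwb_of_facts rfl (s3a_facts hiu) hm

/-- Coordinates of `s3a` up to its length. [cite: EntingJensen2009, §7.4.2, Fig. 7.10] -/
theorem s3a_apply {k i u t : ℕ} (ht : t ≤ 6 * k + 4) : s3a k i u t 0 = s3aX k i u t ∧ s3a k i u t 1 = s3aY k i u t :=
  tab_walk_apply ht

/-- **`s3a` is irreducible**: its only interior visits lie on the final wall run (columns `≤ 2k`),
    after the bottom run reached column `2k+1`. [cite: MadrasSlade1993, §4.2, Definition 4.2.1 (p. 90)]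
[cite: Kesten1963SAW, §4] [cite: EntingJensen2009, §7.4.2, Fig. 7.10] -/
theorem s3a_mem_ipwb {k i u m : ℕ} (hiu : i + u + 2 ≤ k) (hm : m = 6 * k + 4) : s3a k i u ∈ ipwb m := by
  refine mem_ipwb_of_facts_wit rfl (s3a_facts hiu) hm (by omega) fun t ht1 ht2 hte hY => ?_
  rcases s3a_cases k i u t with ⟨h, x, y⟩ | ⟨l, h, x, y⟩ | ⟨l, h, x, y⟩ | ⟨l, h, x, y⟩ | ⟨l, h, x, y⟩ | ⟨l, h, x,
      y⟩ | ⟨l, x, y⟩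
  · omega
  · omega
  · omega
  · omega
  · omega
  · omega
  · refine Or.inr ⟨2 * k + 4, by omega, by omega, ?_⟩
    rcases s3a_cases k i u (2 * k + 4) with ⟨h', x', y'⟩ | ⟨l', h', x', y'⟩ | ⟨l', h', x', y'⟩ | ⟨l', h', x',
        y'⟩ | ⟨l', h', x', y'⟩ | ⟨l', h', x', y'⟩ | ⟨l', x', y'⟩ <;>
      omega

/-- **`s3a` has `k` visits** (all on the final wall run).
[cite: BeatonBousquetMelouDeGierDuminilCopinGuttmann2014, §3.1 (arXiv v5 p. 8)] [cite: EntingJensen2009, §7.4.2,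
    Fig. 7.10] -/
theorem visits_s3a {k i u m : ℕ} (hiu : i + u + 2 ≤ k) (hm : m = 6 * k + 4) : visits m (s3a k i u) = k := by
  have hY : ∀ t, t ≤ 6 * k + 4 → s3a k i u t 1 = s3aY k i u t := fun t ht => (s3a_apply ht).2
  have h1 : visits (0 + (1)) (s3a k i u) = visits 0 (s3a k i u) + ((0 + (1)) / 2 - 0 / 2) :=
    visits_add_of_wall fun q _ hq => by
      rw [hY _ (by omega)]
      rcases s3a_cases k i u (0 + q) with ⟨h', x', y'⟩ | ⟨l', h', x', y'⟩ | ⟨l', h', x', y'⟩ | ⟨l', h', x',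
          y'⟩ | ⟨l', h', x', y'⟩ | ⟨l', h', x', y'⟩ | ⟨l', x', y'⟩ <;> omega
  have h2 : visits (1 + (4 * k + 3)) (s3a k i u) = visits (1) (s3a k i u) :=
    visits_add_eq_left fun q hq1 hq2 h => by
      obtain ⟨-, h0⟩ := h
      rw [hY _ (by omega)] at h0
      rcases s3a_cases k i u (1 + q) with ⟨h', x', y'⟩ | ⟨l', h', x', y'⟩ | ⟨l', h', x', y'⟩ | ⟨l', h', x',
          y'⟩ | ⟨l', h', x', y'⟩ | ⟨l', h', x', y'⟩ | ⟨l', x', y'⟩ <;> omega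
  have h3 : visits (4 * k + 4 + (2 * k)) (s3a k i u) = visits (4 * k + 4) (s3a k i u) + ((4 * k + 4
      + (2 * k)) / 2 - (4 * k + 4) / 2) :=
    visits_add_of_wall fun q _ hq => by
      rw [hY _ (by omega)]
      rcases s3a_cases k i u (4 * k + 4 + q) with ⟨h', x', y'⟩ | ⟨l', h', x', y'⟩ | ⟨l', h', x', y'⟩ | ⟨l', h', x',
          y'⟩ | ⟨l', h', x', y'⟩ | ⟨l', h', x', y'⟩ | ⟨l', x', y'⟩ <;>
        omega
  rw [zero_add, visits_zero, zero_add] at h1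
  rw [show 1 + (4 * k + 3) = 4 * k + 4 by omega, h1] at h2
  rw [show 4 * k + 4 + (2 * k) = 6 * k + 4 by omega, h2] at h3
  subst hm
  rw [h3]
  omega

/-- **`s3a` has three down steps**, at the times `1`, `3`, `2 * i + 5`. [cite: EntingJensen2009, §7.4.2, Fig. 7.10] -/
theorem stepsD_s3a {k i u m : ℕ} (hiu : i + u + 2 ≤ k) (hm : m = 6 * k + 4) :
    stepsD m (s3a k i u) = {1, 3, 2 * i + 5} := by
  subst hm
  ext t
  simp only [stepsD, mem_filter, mem_range, mem_insert, mem_singleton]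
  constructor
  · rintro ⟨ht, hx, hy⟩
    rw [(s3a_apply (t := t + 1) (by omega)).1, (s3a_apply (t := t) (by omega)).1] at hx
    rw [(s3a_apply (t := t + 1) (by omega)).2, (s3a_apply (t := t) (by omega)).2] at hy
    rcases s3a_cases k i u t with ⟨h, x, y⟩ | ⟨l, h, x, y⟩ | ⟨l, h, x, y⟩ | ⟨l, h, x, y⟩ | ⟨l, h, x, y⟩ | ⟨l, h, x,
        y⟩ | ⟨l, x, y⟩ <;>
      rcases s3a_cases k i u (t + 1) with ⟨h', x', y'⟩ | ⟨l', h', x', y'⟩ | ⟨l', h', x', y'⟩ | ⟨l', h', x',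
          y'⟩ | ⟨l', h', x', y'⟩ | ⟨l', h', x', y'⟩ | ⟨l', x', y'⟩ <;>
        omega
  · intro ht
    have ht4 : t + 1 ≤ 6 * k + 4 := by omega
    refine ⟨by omega, ?_, ?_⟩
    · rw [(s3a_apply ht4).1, (s3a_apply (t := t) (by omega)).1]
      rcases s3a_cases k i u t with ⟨h, x, y⟩ | ⟨l, h, x, y⟩ | ⟨l, h, x, y⟩ | ⟨l, h, x, y⟩ | ⟨l, h, x, y⟩ | ⟨l, h, x,
          y⟩ | ⟨l, x, y⟩ <;>
        rcases s3a_cases k i u (t + 1) with ⟨h', x', y'⟩ | ⟨l', h', x', y'⟩ | ⟨l', h', x', y'⟩ | ⟨l', h', x',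
            y'⟩ | ⟨l', h', x', y'⟩ | ⟨l', h', x', y'⟩ | ⟨l', x', y'⟩ <;>
          omega
    · rw [(s3a_apply ht4).2, (s3a_apply (t := t) (by omega)).2]
      rcases s3a_cases k i u t with ⟨h, x, y⟩ | ⟨l, h, x, y⟩ | ⟨l, h, x, y⟩ | ⟨l, h, x, y⟩ | ⟨l, h, x, y⟩ | ⟨l, h, x,
          y⟩ | ⟨l, x, y⟩ <;>
        rcases s3a_cases k i u (t + 1) with ⟨h', x', y'⟩ | ⟨l', h', x', y'⟩ | ⟨l', h', x', y'⟩ | ⟨l', h', x',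
            y'⟩ | ⟨l', h', x', y'⟩ | ⟨l', h', x', y'⟩ | ⟨l', x', y'⟩ <;>
          omega

/-- **`s3a` has three up steps**, at the times `2 * k + 4`, `2 * k + 2 * u + 6`, `4 * k
    + 4`. [cite: EntingJensen2009, §7.4.2, Fig. 7.10] -/
theorem stepsU_s3a {k i u m : ℕ} (hiu : i + u + 2 ≤ k) (hm : m = 6 * k + 4) :
    stepsU m (s3a k i u) = {2 * k + 4, 2 * k + 2 * u + 6, 4 * k + 4} := by
  subst hm
  ext t
  simp only [stepsU, mem_filter, mem_range, mem_insert, mem_singleton]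
  constructor
  · rintro ⟨ht, hx, hy⟩
    rw [(s3a_apply (t := t + 1) (by omega)).1, (s3a_apply (t := t) (by omega)).1] at hx
    rw [(s3a_apply (t := t + 1) (by omega)).2, (s3a_apply (t := t) (by omega)).2] at hy
    rcases s3a_cases k i u t with ⟨h, x, y⟩ | ⟨l, h, x, y⟩ | ⟨l, h, x, y⟩ | ⟨l, h, x, y⟩ | ⟨l, h, x, y⟩ | ⟨l, h, x,
        y⟩ | ⟨l, x, y⟩ <;>
      rcases s3a_cases k i u (t + 1) with ⟨h', x', y'⟩ | ⟨l', h', x', y'⟩ | ⟨l', h', x', y'⟩ | ⟨l', h', x',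
          y'⟩ | ⟨l', h', x', y'⟩ | ⟨l', h', x', y'⟩ | ⟨l', x', y'⟩ <;>
        omega
  · intro ht
    have ht4 : t + 1 ≤ 6 * k + 4 := by omega
    refine ⟨by omega, ?_, ?_⟩
    · rw [(s3a_apply ht4).1, (s3a_apply (t := t) (by omega)).1]
      rcases s3a_cases k i u t with ⟨h, x, y⟩ | ⟨l, h, x, y⟩ | ⟨l, h, x, y⟩ | ⟨l, h, x, y⟩ | ⟨l, h, x, y⟩ | ⟨l, h, x,
          y⟩ | ⟨l, x, y⟩ <;>
        rcases s3a_cases k i u (t + 1) with ⟨h', x', y'⟩ | ⟨l', h', x', y'⟩ | ⟨l', h', x', y'⟩ | ⟨l', h', x',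
            y'⟩ | ⟨l', h', x', y'⟩ | ⟨l', h', x', y'⟩ | ⟨l', x', y'⟩ <;>
          omega
    · rw [(s3a_apply ht4).2, (s3a_apply (t := t) (by omega)).2]
      rcases s3a_cases k i u t with ⟨h, x, y⟩ | ⟨l, h, x, y⟩ | ⟨l, h, x, y⟩ | ⟨l, h, x, y⟩ | ⟨l, h, x, y⟩ | ⟨l, h, x,
          y⟩ | ⟨l, x, y⟩ <;>
        rcases s3a_cases k i u (t + 1) with ⟨h', x', y'⟩ | ⟨l', h', x', y'⟩ | ⟨l', h', x', y'⟩ | ⟨l', h', x',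
            y'⟩ | ⟨l', h', x', y'⟩ | ⟨l', h', x', y'⟩ | ⟨l', x', y'⟩ <;>
          omega

/-! ### §2  Family A3 (`k(k−1)(k−2)/6` blocks; excess `0`,
    the body dives in two left runs to column `1`): `R^{2a+1} D L^{2i+1} D L^{2a−1−2i} D R^{2k} U L^{2u+1} U
    L^{2k−3−2a−2u} U R^{2k−2a−1}` (`i + 1 ≤ a`, `a + u + 2 ≤ k`) -/

/-- Column table of the s3b blocks (length `6k + 4`), seven affine pieces: wall run, row `−1`, row `−2`,
    bottom row `−3`, row `−2`, row `−1`, final wall run (values `(t : ℤ)`, `-(t : ℤ) + 4 * a + 3`, `-(t : ℤ)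
    + 4 * a + 4`, `(t : ℤ) - 4 * a - 3`, `-(t : ℤ) + 4 * k + 4 * a + 6`, `-(t : ℤ) + 4 * k + 4 * a + 7`,
    `(t : ℤ) - 4 * k - 2` on the successive pieces). [cite: EntingJensen2009, §7.4.2,
    Fig. 7.10 (brickwork form of the honeycomb lattice)] -/
def s3bX (k a i u t : ℕ) : ℤ :=
  if t ≤ 2 * a + 1 then (t : ℤ)
  else if t ≤ 2 * a + 2 * i + 3 then -(t : ℤ) + 4 * a + 3
  else if t ≤ 4 * a + 3 then -(t : ℤ) + 4 * a + 4
  else if t ≤ 2 * k + 4 * a + 4 then (t : ℤ) - 4 * a - 3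
  else if t ≤ 2 * k + 4 * a + 2 * u + 6 then -(t : ℤ) + 4 * k + 4 * a + 6
  else if t ≤ 4 * k + 2 * a + 4 then -(t : ℤ) + 4 * k + 4 * a + 7
  else (t : ℤ) - 4 * k - 2

/-- Height table of the s3b blocks: `0, −1, −2, −3, −2, −1, 0` on the seven pieces. [cite: EntingJensen2009, §7.4.2,
    Fig. 7.10] -/
def s3bY (k a i u t : ℕ) : ℤ :=
  if t ≤ 2 * a + 1 then 0
  else if t ≤ 2 * a + 2 * i + 3 then -1
  else if t ≤ 4 * a + 3 then -2
  else if t ≤ 2 * k + 4 * a + 4 then -3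
  else if t ≤ 2 * k + 4 * a + 2 * u + 6 then -2
  else if t ≤ 4 * k + 2 * a + 4 then -1
  else 0

/-- **The A3 block**
    `(0,0)→…→(2a+1,0)↓←…←(2a−2i,−1)↓←…←(1,−2)↓(1,−3)→…→(2k+1,−3)↑←…←(2k−2u,−2)↑←…←(2a+3,−1)↑(2a+3,0)→…→(2k+2,0)` of
    length `6k+4`
(`i + 1 ≤ a`, `a + u + 2 ≤ k`; family A3). [cite: EntingJensen2009, §7.4.2, Fig. 7.10] -/
def s3b (k a i u : ℕ) : ℕ → Site 2 := Tab.walk (6 * k + 4) (s3bX k a i u) (s3bY k a i u)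

/-- The affine pieces of the tables of `s3b`, with their values. [cite: EntingJensen2009, §7.4.2, Fig. 7.10] -/
private theorem s3b_cases (k a i u t : ℕ) :
    (t ≤ 2 * a + 1 ∧ s3bX k a i u t = (t : ℤ) ∧ s3bY k a i u t = 0) ∨
      (2 * a + 2 ≤ t ∧ t ≤ 2 * a + 2 * i + 3 ∧ s3bX k a i u t = -(t : ℤ) + 4 * a + 3 ∧ s3bY k a i u t = -1) ∨
      (2 * a + 2 * i + 4 ≤ t ∧ t ≤ 4 * a + 3 ∧ s3bX k a i u t = -(t : ℤ) + 4 * a + 4 ∧ s3bY k a i u t = -2) ∨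
      (4 * a + 4 ≤ t ∧ t ≤ 2 * k + 4 * a + 4 ∧ s3bX k a i u t = (t : ℤ) - 4 * a - 3 ∧ s3bY k a i u t = -3) ∨
      (2 * k + 4 * a + 5 ≤ t ∧ t ≤ 2 * k + 4 * a + 2 * u + 6 ∧ s3bX k a i u t = -(t : ℤ) + 4 * k + 4 * a + 6
          ∧ s3bY k a i u t = -2) ∨
      (2 * k + 4 * a + 2 * u + 7 ≤ t ∧ t ≤ 4 * k + 2 * a + 4 ∧ s3bX k a i u t = -(t : ℤ) + 4 * k + 4 * a + 7
          ∧ s3bY k a i u t = -1) ∨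
      (4 * k + 2 * a + 5 ≤ t ∧ s3bX k a i u t = (t : ℤ) - 4 * k - 2 ∧ s3bY k a i u t = 0) := by
  simp only [s3bX, s3bY]
  split_ifs
  · exact Or.inl ⟨by omega, by omega, by omega⟩
  · exact Or.inr (Or.inl ⟨by omega, by omega, by omega, by omega⟩)
  · exact Or.inr (Or.inr (Or.inl ⟨by omega, by omega, by omega, by omega⟩))
  · exact Or.inr (Or.inr (Or.inr (Or.inl ⟨by omega, by omega, by omega, by omega⟩)))
  · exact Or.inr (Or.inr (Or.inr (Or.inr (Or.inl ⟨by omega, by omega, by omega, by omega⟩))))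
  · exact Or.inr (Or.inr (Or.inr (Or.inr (Or.inr (Or.inl ⟨by omega, by omega, by omega, by omega⟩)))))
  · exact Or.inr (Or.inr (Or.inr (Or.inr (Or.inr (Or.inr (⟨by omega, by omega, by omega⟩))))))

/-- **Coordinate facts of `s3b`** (`i + 1 ≤ a`, `a + u + 2 ≤ k`): brick-wall steps, self-avoidance, lower half-plane,
    columns in
`[0, X_L]` and `≥ 1` after time `0`, start and end on the wall, even length. [cite: EntingJensen2009, §7.4.2, Fig. 7.10]
[cite: MadrasSlade1993, §1.2, Definition 1.2.4 (bridges, p. 11)] -/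
theorem s3b_facts {k a i u : ℕ} (hia : i + 1 ≤ a) (hau : a + u + 2 ≤ k) : Tab.Facts (6 * k
    + 4) (s3bX k a i u) (s3bY k a i u) := by
  refine ⟨fun t ht => ?_, fun t ht s hs hx hy => ?_, fun t ht => ?_, fun t ht => ?_, ?_, ?_, ?_, by omega,
      fun t ht h1 => ?_⟩
  · rw [adjE_iff_tda]
    rcases s3b_cases k a i u t with ⟨h, x, y⟩ | ⟨l, h, x, y⟩ | ⟨l, h, x, y⟩ | ⟨l, h, x, y⟩ | ⟨l, h, x, y⟩ | ⟨l, h, x,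
        y⟩ | ⟨l, x, y⟩ <;>
      rcases s3b_cases k a i u (t + 1) with ⟨h', x', y'⟩ | ⟨l', h', x', y'⟩ | ⟨l', h', x', y'⟩ | ⟨l', h', x',
          y'⟩ | ⟨l', h', x', y'⟩ | ⟨l', h', x', y'⟩ | ⟨l', x', y'⟩ <;>
        omega
  · rcases s3b_cases k a i u t with ⟨h, x, y⟩ | ⟨l, h, x, y⟩ | ⟨l, h, x, y⟩ | ⟨l, h, x, y⟩ | ⟨l, h, x, y⟩ | ⟨l, h, x,
      y⟩ | ⟨l, x, y⟩ <;>
      rcases s3b_cases k a i u s with ⟨h', x', y'⟩ | ⟨l', h', x', y'⟩ | ⟨l', h', x', y'⟩ | ⟨l', h', x', y'⟩ | ⟨l',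
          h', x', y'⟩ | ⟨l', h', x', y'⟩ | ⟨l', x', y'⟩ <;>
        omega
  · rcases s3b_cases k a i u t with ⟨h, x, y⟩ | ⟨l, h, x, y⟩ | ⟨l, h, x, y⟩ | ⟨l, h, x, y⟩ | ⟨l, h, x, y⟩ | ⟨l, h, x,
      y⟩ | ⟨l, x, y⟩ <;> omega
  · have h0 := s3b_cases k a i u 0
    have hL := s3b_cases k a i u (6 * k + 4)
    rcases s3b_cases k a i u t with ⟨h, x, y⟩ | ⟨l, h, x, y⟩ | ⟨l, h, x, y⟩ | ⟨l, h, x, y⟩ | ⟨l, h, x, y⟩ | ⟨l, h, x,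
        y⟩ | ⟨l, x, y⟩ <;> omega
  · have h0 := s3b_cases k a i u 0; omega
  · have h0 := s3b_cases k a i u 0; omega
  · have hL := s3b_cases k a i u (6 * k + 4); omega
  · rcases s3b_cases k a i u t with ⟨h, x, y⟩ | ⟨l, h, x, y⟩ | ⟨l, h, x, y⟩ | ⟨l, h, x, y⟩ | ⟨l, h, x, y⟩ | ⟨l, h, x,
      y⟩ | ⟨l, x, y⟩ <;> omega

/-- `s3b` is a positive wall bridge of length `m = 6k + 4` (length symbolic). [cite: MadrasSlade1993, §1.2,
    Definition 1.2.4 (p. 11)]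
[cite: EntingJensen2009, §7.4.2, Fig. 7.10] -/
theorem s3b_mem_pwb {k a i u m : ℕ} (hia : i + 1 ≤ a) (hau : a + u + 2 ≤ k) (hm : m = 6 * k
    + 4) : s3b k a i u ∈ pwb m :=
  mem_pwb_of_facts rfl (s3b_facts hia hau) hm

/-- Coordinates of `s3b` up to its length. [cite: EntingJensen2009, §7.4.2, Fig. 7.10] -/
theorem s3b_apply {k a i u t : ℕ} (ht : t ≤ 6 * k + 4) : s3b k a i u t 0 = s3bX k a i u t ∧ s3b k a i u t 1
    = s3bY k a i u t :=
  tab_walk_apply ht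

/-- **`s3b` is irreducible**: the interior visits of the initial wall run are followed by the body's leftmost column
    `1`, those of the final wall run (columns `≤ 2k`)
are preceded by the bottom run's far end `2k+1`. [cite: MadrasSlade1993, §4.2, Definition 4.2.1 (p. 90)]
[cite: Kesten1963SAW, §4] [cite: EntingJensen2009, §7.4.2, Fig. 7.10] -/
theorem s3b_mem_ipwb {k a i u m : ℕ} (hia : i + 1 ≤ a) (hau : a + u + 2 ≤ k) (hm : m = 6 * k
    + 4) : s3b k a i u ∈ ipwb m := by
  refine mem_ipwb_of_facts_wit rfl (s3b_facts hia hau) hm (by omega) fun t ht1 ht2 hte hY => ?_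
  rcases s3b_cases k a i u t with ⟨h, x, y⟩ | ⟨l, h, x, y⟩ | ⟨l, h, x, y⟩ | ⟨l, h, x, y⟩ | ⟨l, h, x, y⟩ | ⟨l, h, x,
      y⟩ | ⟨l, x, y⟩
  · refine Or.inl ⟨4 * a + 3, by omega, by omega, ?_⟩
    rcases s3b_cases k a i u (4 * a + 3) with ⟨h', x', y'⟩ | ⟨l', h', x', y'⟩ | ⟨l', h', x', y'⟩ | ⟨l', h', x',
        y'⟩ | ⟨l', h', x', y'⟩ | ⟨l', h', x', y'⟩ | ⟨l', x', y'⟩ <;>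
      omega
  · omega
  · omega
  · omega
  · omega
  · omega
  · refine Or.inr ⟨2 * k + 4 * a + 4, by omega, by omega, ?_⟩
    rcases s3b_cases k a i u (2 * k + 4 * a + 4) with ⟨h', x', y'⟩ | ⟨l', h', x', y'⟩ | ⟨l', h', x', y'⟩ | ⟨l', h',
        x', y'⟩ | ⟨l', h', x', y'⟩ | ⟨l', h', x', y'⟩ | ⟨l', x', y'⟩ <;>
      omega

/-- **`s3b` has `k` visits** (`a` on the initial wall run, `k − a` on the final one).
[cite: BeatonBousquetMelouDeGierDuminilCopinGuttmann2014, §3.1 (arXiv v5 p. 8)] [cite: EntingJensen2009, §7.4.2,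
    Fig. 7.10] -/
theorem visits_s3b {k a i u m : ℕ} (hia : i + 1 ≤ a) (hau : a + u + 2 ≤ k) (hm : m = 6 * k
    + 4) : visits m (s3b k a i u) = k := by
  have hY : ∀ t, t ≤ 6 * k + 4 → s3b k a i u t 1 = s3bY k a i u t := fun t ht => (s3b_apply ht).2
  have h1 : visits (0 + (2 * a + 1)) (s3b k a i u) = visits 0 (s3b k a i u) + ((0 + (2 * a + 1)) / 2 - 0 / 2) :=
    visits_add_of_wall fun q _ hq => by
      rw [hY _ (by omega)]
      rcases s3b_cases k a i u (0 + q) with ⟨h', x', y'⟩ | ⟨l', h', x', y'⟩ | ⟨l', h', x', y'⟩ | ⟨l', h', x',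
          y'⟩ | ⟨l', h', x', y'⟩ | ⟨l', h', x', y'⟩ | ⟨l', x', y'⟩ <;> omega
  have h2 : visits (2 * a + 1 + (4 * k + 3)) (s3b k a i u) = visits (2 * a + 1) (s3b k a i u) :=
    visits_add_eq_left fun q hq1 hq2 h => by
      obtain ⟨-, h0⟩ := h
      rw [hY _ (by omega)] at h0
      rcases s3b_cases k a i u (2 * a + 1 + q) with ⟨h', x', y'⟩ | ⟨l', h', x', y'⟩ | ⟨l', h', x', y'⟩ | ⟨l', h', x',
          y'⟩ | ⟨l', h', x', y'⟩ | ⟨l', h', x', y'⟩ | ⟨l', x', y'⟩ <;> omega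
  have h3 : visits (4 * k + 2 * a + 4 + (2 * k - 2 * a)) (s3b k a i u) = visits (4 * k + 2 * a + 4) (s3b k a i u)
      + ((4 * k + 2 * a + 4 + (2 * k - 2 * a)) / 2 - (4 * k + 2 * a + 4) / 2) :=
    visits_add_of_wall fun q _ hq => by
      rw [hY _ (by omega)]
      rcases s3b_cases k a i u (4 * k + 2 * a + 4 + q) with ⟨h', x', y'⟩ | ⟨l', h', x', y'⟩ | ⟨l', h', x', y'⟩ | ⟨l',
          h', x', y'⟩ | ⟨l', h', x', y'⟩ | ⟨l', h', x', y'⟩ | ⟨l', x', y'⟩ <;>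
        omega
  rw [zero_add, visits_zero, zero_add] at h1
  rw [show 2 * a + 1 + (4 * k + 3) = 4 * k + 2 * a + 4 by omega, h1] at h2
  rw [show 4 * k + 2 * a + 4 + (2 * k - 2 * a) = 6 * k + 4 by omega, h2] at h3
  subst hm
  rw [h3]
  omega

/-- **`s3b` has three down steps**, at the times `2 * a + 1`, `2 * a + 2 * i + 3`, `4 * a
    + 3`. [cite: EntingJensen2009, §7.4.2, Fig. 7.10] -/
theorem stepsD_s3b {k a i u m : ℕ} (hia : i + 1 ≤ a) (hau : a + u + 2 ≤ k) (hm : m = 6 * k + 4) :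
    stepsD m (s3b k a i u) = {2 * a + 1, 2 * a + 2 * i + 3, 4 * a + 3} := by
  subst hm
  ext t
  simp only [stepsD, mem_filter, mem_range, mem_insert, mem_singleton]
  constructor
  · rintro ⟨ht, hx, hy⟩
    rw [(s3b_apply (t := t + 1) (by omega)).1, (s3b_apply (t := t) (by omega)).1] at hx
    rw [(s3b_apply (t := t + 1) (by omega)).2, (s3b_apply (t := t) (by omega)).2] at hy
    rcases s3b_cases k a i u t with ⟨h, x, y⟩ | ⟨l, h, x, y⟩ | ⟨l, h, x, y⟩ | ⟨l, h, x, y⟩ | ⟨l, h, x, y⟩ | ⟨l, h, x,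
        y⟩ | ⟨l, x, y⟩ <;>
      rcases s3b_cases k a i u (t + 1) with ⟨h', x', y'⟩ | ⟨l', h', x', y'⟩ | ⟨l', h', x', y'⟩ | ⟨l', h', x',
          y'⟩ | ⟨l', h', x', y'⟩ | ⟨l', h', x', y'⟩ | ⟨l', x', y'⟩ <;>
        omega
  · intro ht
    have ht4 : t + 1 ≤ 6 * k + 4 := by omega
    refine ⟨by omega, ?_, ?_⟩
    · rw [(s3b_apply ht4).1, (s3b_apply (t := t) (by omega)).1]
      rcases s3b_cases k a i u t with ⟨h, x, y⟩ | ⟨l, h, x, y⟩ | ⟨l, h, x, y⟩ | ⟨l, h, x, y⟩ | ⟨l, h, x, y⟩ | ⟨l, h,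
          x, y⟩ | ⟨l, x, y⟩ <;>
        rcases s3b_cases k a i u (t + 1) with ⟨h', x', y'⟩ | ⟨l', h', x', y'⟩ | ⟨l', h', x', y'⟩ | ⟨l', h', x',
            y'⟩ | ⟨l', h', x', y'⟩ | ⟨l', h', x', y'⟩ | ⟨l', x', y'⟩ <;>
          omega
    · rw [(s3b_apply ht4).2, (s3b_apply (t := t) (by omega)).2]
      rcases s3b_cases k a i u t with ⟨h, x, y⟩ | ⟨l, h, x, y⟩ | ⟨l, h, x, y⟩ | ⟨l, h, x, y⟩ | ⟨l, h, x, y⟩ | ⟨l, h,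
          x, y⟩ | ⟨l, x, y⟩ <;>
        rcases s3b_cases k a i u (t + 1) with ⟨h', x', y'⟩ | ⟨l', h', x', y'⟩ | ⟨l', h', x', y'⟩ | ⟨l', h', x',
            y'⟩ | ⟨l', h', x', y'⟩ | ⟨l', h', x', y'⟩ | ⟨l', x', y'⟩ <;>
          omega

/-- **`s3b` has three up steps**, at the times `2 * k + 4 * a + 4`, `2 * k + 4 * a + 2 * u + 6`, `4 * k + 2 * a
    + 4`. [cite: EntingJensen2009, §7.4.2, Fig. 7.10] -/
theorem stepsU_s3b {k a i u m : ℕ} (hia : i + 1 ≤ a) (hau : a + u + 2 ≤ k) (hm : m = 6 * k + 4) :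
    stepsU m (s3b k a i u) = {2 * k + 4 * a + 4, 2 * k + 4 * a + 2 * u + 6, 4 * k + 2 * a + 4} := by
  subst hm
  ext t
  simp only [stepsU, mem_filter, mem_range, mem_insert, mem_singleton]
  constructor
  · rintro ⟨ht, hx, hy⟩
    rw [(s3b_apply (t := t + 1) (by omega)).1, (s3b_apply (t := t) (by omega)).1] at hx
    rw [(s3b_apply (t := t + 1) (by omega)).2, (s3b_apply (t := t) (by omega)).2] at hy
    rcases s3b_cases k a i u t with ⟨h, x, y⟩ | ⟨l, h, x, y⟩ | ⟨l, h, x, y⟩ | ⟨l, h, x, y⟩ | ⟨l, h, x, y⟩ | ⟨l, h, x,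
        y⟩ | ⟨l, x, y⟩ <;>
      rcases s3b_cases k a i u (t + 1) with ⟨h', x', y'⟩ | ⟨l', h', x', y'⟩ | ⟨l', h', x', y'⟩ | ⟨l', h', x',
          y'⟩ | ⟨l', h', x', y'⟩ | ⟨l', h', x', y'⟩ | ⟨l', x', y'⟩ <;>
        omega
  · intro ht
    have ht4 : t + 1 ≤ 6 * k + 4 := by omega
    refine ⟨by omega, ?_, ?_⟩
    · rw [(s3b_apply ht4).1, (s3b_apply (t := t) (by omega)).1]
      rcases s3b_cases k a i u t with ⟨h, x, y⟩ | ⟨l, h, x, y⟩ | ⟨l, h, x, y⟩ | ⟨l, h, x, y⟩ | ⟨l, h, x, y⟩ | ⟨l, h,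
          x, y⟩ | ⟨l, x, y⟩ <;>
        rcases s3b_cases k a i u (t + 1) with ⟨h', x', y'⟩ | ⟨l', h', x', y'⟩ | ⟨l', h', x', y'⟩ | ⟨l', h', x',
            y'⟩ | ⟨l', h', x', y'⟩ | ⟨l', h', x', y'⟩ | ⟨l', x', y'⟩ <;>
          omega
    · rw [(s3b_apply ht4).2, (s3b_apply (t := t) (by omega)).2]
      rcases s3b_cases k a i u t with ⟨h, x, y⟩ | ⟨l, h, x, y⟩ | ⟨l, h, x, y⟩ | ⟨l, h, x, y⟩ | ⟨l, h, x, y⟩ | ⟨l, h,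
          x, y⟩ | ⟨l, x, y⟩ <;>
        rcases s3b_cases k a i u (t + 1) with ⟨h', x', y'⟩ | ⟨l', h', x', y'⟩ | ⟨l', h', x', y'⟩ | ⟨l', h', x',
            y'⟩ | ⟨l', h', x', y'⟩ | ⟨l', h', x', y'⟩ | ⟨l', x', y'⟩ <;>
          omega

/-- The column of `s3b` at the end of its piece `2` (time `4 * a + 3`). [cite: EntingJensen2009, §7.4.2, Fig. 7.10] -/
theorem s3b_xend2 {k a i u t : ℕ} (_ : i + 1 ≤ a) (_ : a + u + 2 ≤ k) (ht : t = 4 * a + 3) : s3bX k a i u t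
    = (1 : ℤ) := by
  subst ht
  simp only [s3bX]
  split_ifs <;> omega

/-! ### §3  Family A4 (`k(k−1)/2` blocks; excess `0`, wall run of length `2k−1`,
    staircase exit): `R^{2k−1} D L^{2i+1} D L^{2k−3−2i} D R^{2k−2−2u} U R^{2u+1} U R U R` (`u ≤ i`, `i + 2 ≤ k`) -/

/-- Column table of the s3c blocks (length `6k + 4`), seven affine pieces: wall run, row `−1`, row `−2`,
    bottom row `−3`, row `−2`, row `−1`, final wall run (values `(t : ℤ)`, `-(t : ℤ) + 4 * k - 1`, `-(t : ℤ)
    + 4 * k`, `(t : ℤ) - 4 * k + 1`, `(t : ℤ) - 4 * k`, `(t : ℤ) - 4 * k - 1`,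
    `(t : ℤ) - 4 * k - 2` on the successive pieces). [cite: EntingJensen2009, §7.4.2,
    Fig. 7.10 (brickwork form of the honeycomb lattice)] -/
def s3cX (k i u t : ℕ) : ℤ :=
  if t + 1 ≤ 2 * k then (t : ℤ)
  else if t ≤ 2 * k + 2 * i + 1 then -(t : ℤ) + 4 * k - 1
  else if t + 1 ≤ 4 * k then -(t : ℤ) + 4 * k
  else if t + 2 * u + 2 ≤ 6 * k then (t : ℤ) - 4 * k + 1
  else if t ≤ 6 * k then (t : ℤ) - 4 * k
  else if t ≤ 6 * k + 2 then (t : ℤ) - 4 * k - 1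
  else (t : ℤ) - 4 * k - 2

/-- Height table of the s3c blocks: `0, −1, −2, −3, −2, −1, 0` on the seven pieces. [cite: EntingJensen2009, §7.4.2,
    Fig. 7.10] -/
def s3cY (k i u t : ℕ) : ℤ :=
  if t + 1 ≤ 2 * k then 0
  else if t ≤ 2 * k + 2 * i + 1 then -1
  else if t + 1 ≤ 4 * k then -2
  else if t + 2 * u + 2 ≤ 6 * k then -3
  else if t ≤ 6 * k then -2
  else if t ≤ 6 * k + 2 then -1
  else 0

/-- **The A4 block**
    `(0,0)→…→(2k−1,0)↓←…←(2k−2−2i,−1)↓←…←(1,−2)↓(1,−3)→…→(2k−1−2u,−3)↑→…→(2k,−2)↑(2k,−1)→(2k+1,−1)↑(2k+1,0)→(2k+2,0)`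
    of length `6k+4`
(`u ≤ i ≤ k−2`; family A4). [cite: EntingJensen2009, §7.4.2, Fig. 7.10] -/
def s3c (k i u : ℕ) : ℕ → Site 2 := Tab.walk (6 * k + 4) (s3cX k i u) (s3cY k i u)

/-- The affine pieces of the tables of `s3c`, with their values. [cite: EntingJensen2009, §7.4.2, Fig. 7.10] -/
private theorem s3c_cases (k i u t : ℕ) :
    (t + 1 ≤ 2 * k ∧ s3cX k i u t = (t : ℤ) ∧ s3cY k i u t = 0) ∨
      (2 * k ≤ t ∧ t ≤ 2 * k + 2 * i + 1 ∧ s3cX k i u t = -(t : ℤ) + 4 * k - 1 ∧ s3cY k i u t = -1) ∨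
      (2 * k + 2 * i + 2 ≤ t ∧ t + 1 ≤ 4 * k ∧ s3cX k i u t = -(t : ℤ) + 4 * k ∧ s3cY k i u t = -2) ∨
      (4 * k ≤ t ∧ t + 2 * u + 2 ≤ 6 * k ∧ s3cX k i u t = (t : ℤ) - 4 * k + 1 ∧ s3cY k i u t = -3) ∨
      (6 * k ≤ t + 2 * u + 1 ∧ t ≤ 6 * k ∧ s3cX k i u t = (t : ℤ) - 4 * k ∧ s3cY k i u t = -2) ∨
      (6 * k + 1 ≤ t ∧ t ≤ 6 * k + 2 ∧ s3cX k i u t = (t : ℤ) - 4 * k - 1 ∧ s3cY k i u t = -1) ∨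
      (6 * k + 3 ≤ t ∧ s3cX k i u t = (t : ℤ) - 4 * k - 2 ∧ s3cY k i u t = 0) := by
  simp only [s3cX, s3cY]
  split_ifs
  · exact Or.inl ⟨by omega, by omega, by omega⟩
  · exact Or.inr (Or.inl ⟨by omega, by omega, by omega, by omega⟩)
  · exact Or.inr (Or.inr (Or.inl ⟨by omega, by omega, by omega, by omega⟩))
  · exact Or.inr (Or.inr (Or.inr (Or.inl ⟨by omega, by omega, by omega, by omega⟩)))
  · exact Or.inr (Or.inr (Or.inr (Or.inr (Or.inl ⟨by omega, by omega, by omega, by omega⟩))))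
  · exact Or.inr (Or.inr (Or.inr (Or.inr (Or.inr (Or.inl ⟨by omega, by omega, by omega, by omega⟩)))))
  · exact Or.inr (Or.inr (Or.inr (Or.inr (Or.inr (Or.inr (⟨by omega, by omega, by omega⟩))))))

/-- **Coordinate facts of `s3c`** (`u ≤ i`, `i + 2 ≤ k`): brick-wall steps, self-avoidance, lower half-plane, columns in
`[0, X_L]` and `≥ 1` after time `0`, start and end on the wall, even length. [cite: EntingJensen2009, §7.4.2, Fig. 7.10]
[cite: MadrasSlade1993, §1.2, Definition 1.2.4 (bridges, p. 11)] -/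
theorem s3c_facts {k i u : ℕ} (hui : u ≤ i) (hik : i + 2 ≤ k) : Tab.Facts (6 * k + 4) (s3cX k i u) (s3cY k i u) := by
  refine ⟨fun t ht => ?_, fun t ht s hs hx hy => ?_, fun t ht => ?_, fun t ht => ?_, ?_, ?_, ?_, by omega,
      fun t ht h1 => ?_⟩
  · rw [adjE_iff_tda]
    rcases s3c_cases k i u t with ⟨h, x, y⟩ | ⟨l, h, x, y⟩ | ⟨l, h, x, y⟩ | ⟨l, h, x, y⟩ | ⟨l, h, x, y⟩ | ⟨l, h, x,
        y⟩ | ⟨l, x, y⟩ <;>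
      rcases s3c_cases k i u (t + 1) with ⟨h', x', y'⟩ | ⟨l', h', x', y'⟩ | ⟨l', h', x', y'⟩ | ⟨l', h', x',
          y'⟩ | ⟨l', h', x', y'⟩ | ⟨l', h', x', y'⟩ | ⟨l', x', y'⟩ <;>
        omega
  · rcases s3c_cases k i u t with ⟨h, x, y⟩ | ⟨l, h, x, y⟩ | ⟨l, h, x, y⟩ | ⟨l, h, x, y⟩ | ⟨l, h, x, y⟩ | ⟨l, h, x,
      y⟩ | ⟨l, x, y⟩ <;>
      rcases s3c_cases k i u s with ⟨h', x', y'⟩ | ⟨l', h', x', y'⟩ | ⟨l', h', x', y'⟩ | ⟨l', h', x', y'⟩ | ⟨l', h',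
          x', y'⟩ | ⟨l', h', x', y'⟩ | ⟨l', x', y'⟩ <;>
        omega
  · rcases s3c_cases k i u t with ⟨h, x, y⟩ | ⟨l, h, x, y⟩ | ⟨l, h, x, y⟩ | ⟨l, h, x, y⟩ | ⟨l, h, x, y⟩ | ⟨l, h, x,
      y⟩ | ⟨l, x, y⟩ <;> omega
  · have h0 := s3c_cases k i u 0
    have hL := s3c_cases k i u (6 * k + 4)
    rcases s3c_cases k i u t with ⟨h, x, y⟩ | ⟨l, h, x, y⟩ | ⟨l, h, x, y⟩ | ⟨l, h, x, y⟩ | ⟨l, h, x, y⟩ | ⟨l, h, x,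
        y⟩ | ⟨l, x, y⟩ <;> omega
  · have h0 := s3c_cases k i u 0; omega
  · have h0 := s3c_cases k i u 0; omega
  · have hL := s3c_cases k i u (6 * k + 4); omega
  · rcases s3c_cases k i u t with ⟨h, x, y⟩ | ⟨l, h, x, y⟩ | ⟨l, h, x, y⟩ | ⟨l, h, x, y⟩ | ⟨l, h, x, y⟩ | ⟨l, h, x,
      y⟩ | ⟨l, x, y⟩ <;> omega

/-- `s3c` is a positive wall bridge of length `m = 6k + 4` (length symbolic). [cite: MadrasSlade1993, §1.2,
    Definition 1.2.4 (p. 11)]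
[cite: EntingJensen2009, §7.4.2, Fig. 7.10] -/
theorem s3c_mem_pwb {k i u m : ℕ} (hui : u ≤ i) (hik : i + 2 ≤ k) (hm : m = 6 * k + 4) : s3c k i u ∈ pwb m :=
  mem_pwb_of_facts rfl (s3c_facts hui hik) hm

/-- Coordinates of `s3c` up to its length. [cite: EntingJensen2009, §7.4.2, Fig. 7.10] -/
theorem s3c_apply {k i u t : ℕ} (ht : t ≤ 6 * k + 4) : s3c k i u t 0 = s3cX k i u t ∧ s3c k i u t 1 = s3cY k i u t :=
  tab_walk_apply ht

/-- **`s3c` is irreducible**: the interior visits (all on the initial wall run) are followed by the body's leftmost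
    column `1`; the final wall run is a single step. [cite: MadrasSlade1993, §4.2, Definition 4.2.1 (p. 90)]
[cite: Kesten1963SAW, §4] [cite: EntingJensen2009, §7.4.2, Fig. 7.10] -/
theorem s3c_mem_ipwb {k i u m : ℕ} (hui : u ≤ i) (hik : i + 2 ≤ k) (hm : m = 6 * k + 4) : s3c k i u ∈ ipwb m := by
  refine mem_ipwb_of_facts_wit rfl (s3c_facts hui hik) hm (by omega) fun t ht1 ht2 hte hY => ?_
  rcases s3c_cases k i u t with ⟨h, x, y⟩ | ⟨l, h, x, y⟩ | ⟨l, h, x, y⟩ | ⟨l, h, x, y⟩ | ⟨l, h, x, y⟩ | ⟨l, h, x,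
      y⟩ | ⟨l, x, y⟩
  · refine Or.inl ⟨4 * k - 1, by omega, by omega, ?_⟩
    rcases s3c_cases k i u (4 * k - 1) with ⟨h', x', y'⟩ | ⟨l', h', x', y'⟩ | ⟨l', h', x', y'⟩ | ⟨l', h', x',
        y'⟩ | ⟨l', h', x', y'⟩ | ⟨l', h', x', y'⟩ | ⟨l', x', y'⟩ <;>
      omega
  · omega
  · omega
  · omega
  · omega
  · omega
  · omega

/-- **`s3c` has `k` visits** (`k − 1` on the initial wall run and the endpoint).
[cite: BeatonBousquetMelouDeGierDuminilCopinGuttmann2014, §3.1 (arXiv v5 p. 8)] [cite: EntingJensen2009, §7.4.2,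
    Fig. 7.10] -/
theorem visits_s3c {k i u m : ℕ} (hui : u ≤ i) (hik : i + 2 ≤ k) (hm : m = 6 * k + 4) : visits m (s3c k i u) = k := by
  have hY : ∀ t, t ≤ 6 * k + 4 → s3c k i u t 1 = s3cY k i u t := fun t ht => (s3c_apply ht).2
  have h1 : visits (0 + (2 * k - 1)) (s3c k i u) = visits 0 (s3c k i u) + ((0 + (2 * k - 1)) / 2 - 0 / 2) :=
    visits_add_of_wall fun q _ hq => by
      rw [hY _ (by omega)]
      rcases s3c_cases k i u (0 + q) with ⟨h', x', y'⟩ | ⟨l', h', x', y'⟩ | ⟨l', h', x', y'⟩ | ⟨l', h', x',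
          y'⟩ | ⟨l', h', x', y'⟩ | ⟨l', h', x', y'⟩ | ⟨l', x', y'⟩ <;> omega
  have h2 : visits (2 * k - 1 + (4 * k + 3)) (s3c k i u) = visits (2 * k - 1) (s3c k i u) :=
    visits_add_eq_left fun q hq1 hq2 h => by
      obtain ⟨-, h0⟩ := h
      rw [hY _ (by omega)] at h0
      rcases s3c_cases k i u (2 * k - 1 + q) with ⟨h', x', y'⟩ | ⟨l', h', x', y'⟩ | ⟨l', h', x', y'⟩ | ⟨l', h', x',
          y'⟩ | ⟨l', h', x', y'⟩ | ⟨l', h', x', y'⟩ | ⟨l', x', y'⟩ <;> omega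
  have h3 : visits (6 * k + 2 + (2)) (s3c k i u) = visits (6 * k + 2) (s3c k i u) + ((6 * k + 2 + (2)) / 2 - (6 * k
      + 2) / 2) :=
    visits_add_of_wall fun q _ hq => by
      rw [hY _ (by omega)]
      rcases s3c_cases k i u (6 * k + 2 + q) with ⟨h', x', y'⟩ | ⟨l', h', x', y'⟩ | ⟨l', h', x', y'⟩ | ⟨l', h', x',
          y'⟩ | ⟨l', h', x', y'⟩ | ⟨l', h', x', y'⟩ | ⟨l', x', y'⟩ <;>
        omega
  rw [zero_add, visits_zero, zero_add] at h1
  rw [show 2 * k - 1 + (4 * k + 3) = 6 * k + 2 by omega, h1] at h2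
  rw [show 6 * k + 2 + (2) = 6 * k + 4 by omega, h2] at h3
  subst hm
  rw [h3]
  omega

/-- **`s3c` has three down steps**, at the times `2 * k - 1`, `2 * k + 2 * i + 1`,
    `4 * k - 1`. [cite: EntingJensen2009, §7.4.2, Fig. 7.10] -/
theorem stepsD_s3c {k i u m : ℕ} (hui : u ≤ i) (hik : i + 2 ≤ k) (hm : m = 6 * k + 4) :
    stepsD m (s3c k i u) = {2 * k - 1, 2 * k + 2 * i + 1, 4 * k - 1} := by
  subst hm
  ext t
  simp only [stepsD, mem_filter, mem_range, mem_insert, mem_singleton]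
  constructor
  · rintro ⟨ht, hx, hy⟩
    rw [(s3c_apply (t := t + 1) (by omega)).1, (s3c_apply (t := t) (by omega)).1] at hx
    rw [(s3c_apply (t := t + 1) (by omega)).2, (s3c_apply (t := t) (by omega)).2] at hy
    rcases s3c_cases k i u t with ⟨h, x, y⟩ | ⟨l, h, x, y⟩ | ⟨l, h, x, y⟩ | ⟨l, h, x, y⟩ | ⟨l, h, x, y⟩ | ⟨l, h, x,
        y⟩ | ⟨l, x, y⟩ <;>
      rcases s3c_cases k i u (t + 1) with ⟨h', x', y'⟩ | ⟨l', h', x', y'⟩ | ⟨l', h', x', y'⟩ | ⟨l', h', x',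
          y'⟩ | ⟨l', h', x', y'⟩ | ⟨l', h', x', y'⟩ | ⟨l', x', y'⟩ <;>
        omega
  · intro ht
    have ht4 : t + 1 ≤ 6 * k + 4 := by omega
    refine ⟨by omega, ?_, ?_⟩
    · rw [(s3c_apply ht4).1, (s3c_apply (t := t) (by omega)).1]
      rcases s3c_cases k i u t with ⟨h, x, y⟩ | ⟨l, h, x, y⟩ | ⟨l, h, x, y⟩ | ⟨l, h, x, y⟩ | ⟨l, h, x, y⟩ | ⟨l, h, x,
          y⟩ | ⟨l, x, y⟩ <;>
        rcases s3c_cases k i u (t + 1) with ⟨h', x', y'⟩ | ⟨l', h', x', y'⟩ | ⟨l', h', x', y'⟩ | ⟨l', h', x',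
            y'⟩ | ⟨l', h', x', y'⟩ | ⟨l', h', x', y'⟩ | ⟨l', x', y'⟩ <;>
          omega
    · rw [(s3c_apply ht4).2, (s3c_apply (t := t) (by omega)).2]
      rcases s3c_cases k i u t with ⟨h, x, y⟩ | ⟨l, h, x, y⟩ | ⟨l, h, x, y⟩ | ⟨l, h, x, y⟩ | ⟨l, h, x, y⟩ | ⟨l, h, x,
          y⟩ | ⟨l, x, y⟩ <;>
        rcases s3c_cases k i u (t + 1) with ⟨h', x', y'⟩ | ⟨l', h', x', y'⟩ | ⟨l', h', x', y'⟩ | ⟨l', h', x',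
            y'⟩ | ⟨l', h', x', y'⟩ | ⟨l', h', x', y'⟩ | ⟨l', x', y'⟩ <;>
          omega

/-- **`s3c` has three up steps**, at the times `6 * k - 2 * u - 2`, `6 * k`, `6 * k + 2`. [cite: EntingJensen2009,
    §7.4.2, Fig. 7.10] -/
theorem stepsU_s3c {k i u m : ℕ} (hui : u ≤ i) (hik : i + 2 ≤ k) (hm : m = 6 * k + 4) :
    stepsU m (s3c k i u) = {6 * k - 2 * u - 2, 6 * k, 6 * k + 2} := by
  subst hm
  ext t
  simp only [stepsU, mem_filter, mem_range, mem_insert, mem_singleton]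
  constructor
  · rintro ⟨ht, hx, hy⟩
    rw [(s3c_apply (t := t + 1) (by omega)).1, (s3c_apply (t := t) (by omega)).1] at hx
    rw [(s3c_apply (t := t + 1) (by omega)).2, (s3c_apply (t := t) (by omega)).2] at hy
    rcases s3c_cases k i u t with ⟨h, x, y⟩ | ⟨l, h, x, y⟩ | ⟨l, h, x, y⟩ | ⟨l, h, x, y⟩ | ⟨l, h, x, y⟩ | ⟨l, h, x,
        y⟩ | ⟨l, x, y⟩ <;>
      rcases s3c_cases k i u (t + 1) with ⟨h', x', y'⟩ | ⟨l', h', x', y'⟩ | ⟨l', h', x', y'⟩ | ⟨l', h', x',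
          y'⟩ | ⟨l', h', x', y'⟩ | ⟨l', h', x', y'⟩ | ⟨l', x', y'⟩ <;>
        omega
  · intro ht
    have ht4 : t + 1 ≤ 6 * k + 4 := by omega
    refine ⟨by omega, ?_, ?_⟩
    · rw [(s3c_apply ht4).1, (s3c_apply (t := t) (by omega)).1]
      rcases s3c_cases k i u t with ⟨h, x, y⟩ | ⟨l, h, x, y⟩ | ⟨l, h, x, y⟩ | ⟨l, h, x, y⟩ | ⟨l, h, x, y⟩ | ⟨l, h, x,
          y⟩ | ⟨l, x, y⟩ <;>
        rcases s3c_cases k i u (t + 1) with ⟨h', x', y'⟩ | ⟨l', h', x', y'⟩ | ⟨l', h', x', y'⟩ | ⟨l', h', x',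
            y'⟩ | ⟨l', h', x', y'⟩ | ⟨l', h', x', y'⟩ | ⟨l', x', y'⟩ <;>
          omega
    · rw [(s3c_apply ht4).2, (s3c_apply (t := t) (by omega)).2]
      rcases s3c_cases k i u t with ⟨h, x, y⟩ | ⟨l, h, x, y⟩ | ⟨l, h, x, y⟩ | ⟨l, h, x, y⟩ | ⟨l, h, x, y⟩ | ⟨l, h, x,
          y⟩ | ⟨l, x, y⟩ <;>
        rcases s3c_cases k i u (t + 1) with ⟨h', x', y'⟩ | ⟨l', h', x', y'⟩ | ⟨l', h', x', y'⟩ | ⟨l', h', x',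
            y'⟩ | ⟨l', h', x', y'⟩ | ⟨l', h', x', y'⟩ | ⟨l', x', y'⟩ <;>
          omega

/-- The column of `s3c` at the end of its piece `2` (time `4 * k - 1`). [cite: EntingJensen2009, §7.4.2, Fig. 7.10] -/
theorem s3c_xend2 {k i u t : ℕ} (_ : u ≤ i) (_ : i + 2 ≤ k) (ht : t = 4 * k - 1) : s3cX k i u t = (1 : ℤ) := by
  subst ht
  simp only [s3cX]
  split_ifs <;> omega

/-! ### §4  Family A5 (`k(k−1)/2` blocks; excess `0`, hairpin opening,
    exit `U L U R U`): `R^{2a+1} D L^{2a−1} D R^{2i+1} D R^{2k−2−2i} U L^{2k−2a−1} U R U R^{2k−2a−1}` (`i + 1 ≤ a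
    ≤ k−1`, `i + 2 ≤ k`) -/

/-- Column table of the s3d blocks (length `6k + 4`), seven affine pieces: wall run, row `−1`, row `−2`,
    bottom row `−3`, row `−2`, row `−1`, final wall run (values `(t : ℤ)`, `-(t : ℤ) + 4 * a + 3`, `(t : ℤ) - 4 * a`,
    `(t : ℤ) - 4 * a - 1`, `-(t : ℤ) + 4 * k + 4 * a + 4`, `(t : ℤ) - 4 * k - 1`,
    `(t : ℤ) - 4 * k - 2` on the successive pieces). [cite: EntingJensen2009, §7.4.2,
    Fig. 7.10 (brickwork form of the honeycomb lattice)] -/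
def s3dX (k a i t : ℕ) : ℤ :=
  if t ≤ 2 * a + 1 then (t : ℤ)
  else if t ≤ 4 * a + 1 then -(t : ℤ) + 4 * a + 3
  else if t ≤ 4 * a + 2 * i + 3 then (t : ℤ) - 4 * a
  else if t ≤ 2 * k + 4 * a + 2 then (t : ℤ) - 4 * a - 1
  else if t ≤ 4 * k + 2 * a + 2 then -(t : ℤ) + 4 * k + 4 * a + 4
  else if t ≤ 4 * k + 2 * a + 4 then (t : ℤ) - 4 * k - 1
  else (t : ℤ) - 4 * k - 2

/-- Height table of the s3d blocks: `0, −1, −2, −3, −2, −1, 0` on the seven pieces. [cite: EntingJensen2009, §7.4.2,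
    Fig. 7.10] -/
def s3dY (k a i t : ℕ) : ℤ :=
  if t ≤ 2 * a + 1 then 0
  else if t ≤ 4 * a + 1 then -1
  else if t ≤ 4 * a + 2 * i + 3 then -2
  else if t ≤ 2 * k + 4 * a + 2 then -3
  else if t ≤ 4 * k + 2 * a + 2 then -2
  else if t ≤ 4 * k + 2 * a + 4 then -1
  else 0

/-- **The A5 block**
    `(0,0)→…→(2a+1,0)↓←…←(2,−1)↓(2,−2)→…→(2i+3,−2)↓(2i+3,−3)→…→(2k+1,−3)↑←…←(2a+2,−2)↑(2a+2,−1)→(2a+3,−1)↑(2a+3,0)→…→(2k+2,0)`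
of length `6k+4` (family A5). [cite: EntingJensen2009, §7.4.2, Fig. 7.10] -/
def s3d (k a i : ℕ) : ℕ → Site 2 := Tab.walk (6 * k + 4) (s3dX k a i) (s3dY k a i)

/-- The affine pieces of the tables of `s3d`, with their values. [cite: EntingJensen2009, §7.4.2, Fig. 7.10] -/
private theorem s3d_cases (k a i t : ℕ) :
    (t ≤ 2 * a + 1 ∧ s3dX k a i t = (t : ℤ) ∧ s3dY k a i t = 0) ∨
      (2 * a + 2 ≤ t ∧ t ≤ 4 * a + 1 ∧ s3dX k a i t = -(t : ℤ) + 4 * a + 3 ∧ s3dY k a i t = -1) ∨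
      (4 * a + 2 ≤ t ∧ t ≤ 4 * a + 2 * i + 3 ∧ s3dX k a i t = (t : ℤ) - 4 * a ∧ s3dY k a i t = -2) ∨
      (4 * a + 2 * i + 4 ≤ t ∧ t ≤ 2 * k + 4 * a + 2 ∧ s3dX k a i t = (t : ℤ) - 4 * a - 1 ∧ s3dY k a i t = -3) ∨
      (2 * k + 4 * a + 3 ≤ t ∧ t ≤ 4 * k + 2 * a + 2 ∧ s3dX k a i t = -(t : ℤ) + 4 * k + 4 * a + 4 ∧ s3dY k a i t
          = -2) ∨
      (4 * k + 2 * a + 3 ≤ t ∧ t ≤ 4 * k + 2 * a + 4 ∧ s3dX k a i t = (t : ℤ) - 4 * k - 1 ∧ s3dY k a i t = -1) ∨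
      (4 * k + 2 * a + 5 ≤ t ∧ s3dX k a i t = (t : ℤ) - 4 * k - 2 ∧ s3dY k a i t = 0) := by
  simp only [s3dX, s3dY]
  split_ifs
  · exact Or.inl ⟨by omega, by omega, by omega⟩
  · exact Or.inr (Or.inl ⟨by omega, by omega, by omega, by omega⟩)
  · exact Or.inr (Or.inr (Or.inl ⟨by omega, by omega, by omega, by omega⟩))
  · exact Or.inr (Or.inr (Or.inr (Or.inl ⟨by omega, by omega, by omega, by omega⟩)))
  · exact Or.inr (Or.inr (Or.inr (Or.inr (Or.inl ⟨by omega, by omega, by omega, by omega⟩))))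
  · exact Or.inr (Or.inr (Or.inr (Or.inr (Or.inr (Or.inl ⟨by omega, by omega, by omega, by omega⟩)))))
  · exact Or.inr (Or.inr (Or.inr (Or.inr (Or.inr (Or.inr (⟨by omega, by omega, by omega⟩))))))

/-- **Coordinate facts of `s3d`** (`i + 1 ≤ a ≤ k − 1`, `i + 2 ≤ k`): brick-wall steps, self-avoidance,
    lower half-plane, columns in
`[0, X_L]` and `≥ 1` after time `0`, start and end on the wall, even length. [cite: EntingJensen2009, §7.4.2, Fig. 7.10]
[cite: MadrasSlade1993, §1.2, Definition 1.2.4 (bridges, p. 11)] -/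
theorem s3d_facts {k a i : ℕ} (hia : i + 1 ≤ a) (hak : a + 1 ≤ k) (hik : i + 2 ≤ k) : Tab.Facts (6 * k
    + 4) (s3dX k a i) (s3dY k a i) := by
  refine ⟨fun t ht => ?_, fun t ht s hs hx hy => ?_, fun t ht => ?_, fun t ht => ?_, ?_, ?_, ?_, by omega,
      fun t ht h1 => ?_⟩
  · rw [adjE_iff_tda]
    rcases s3d_cases k a i t with ⟨h, x, y⟩ | ⟨l, h, x, y⟩ | ⟨l, h, x, y⟩ | ⟨l, h, x, y⟩ | ⟨l, h, x, y⟩ | ⟨l, h, x,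
        y⟩ | ⟨l, x, y⟩ <;>
      rcases s3d_cases k a i (t + 1) with ⟨h', x', y'⟩ | ⟨l', h', x', y'⟩ | ⟨l', h', x', y'⟩ | ⟨l', h', x',
          y'⟩ | ⟨l', h', x', y'⟩ | ⟨l', h', x', y'⟩ | ⟨l', x', y'⟩ <;>
        omega
  · rcases s3d_cases k a i t with ⟨h, x, y⟩ | ⟨l, h, x, y⟩ | ⟨l, h, x, y⟩ | ⟨l, h, x, y⟩ | ⟨l, h, x, y⟩ | ⟨l, h, x,
      y⟩ | ⟨l, x, y⟩ <;>
      rcases s3d_cases k a i s with ⟨h', x', y'⟩ | ⟨l', h', x', y'⟩ | ⟨l', h', x', y'⟩ | ⟨l', h', x', y'⟩ | ⟨l', h',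
          x', y'⟩ | ⟨l', h', x', y'⟩ | ⟨l', x', y'⟩ <;>
        omega
  · rcases s3d_cases k a i t with ⟨h, x, y⟩ | ⟨l, h, x, y⟩ | ⟨l, h, x, y⟩ | ⟨l, h, x, y⟩ | ⟨l, h, x, y⟩ | ⟨l, h, x,
      y⟩ | ⟨l, x, y⟩ <;> omega
  · have h0 := s3d_cases k a i 0
    have hL := s3d_cases k a i (6 * k + 4)
    rcases s3d_cases k a i t with ⟨h, x, y⟩ | ⟨l, h, x, y⟩ | ⟨l, h, x, y⟩ | ⟨l, h, x, y⟩ | ⟨l, h, x, y⟩ | ⟨l, h, x,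
        y⟩ | ⟨l, x, y⟩ <;> omega
  · have h0 := s3d_cases k a i 0; omega
  · have h0 := s3d_cases k a i 0; omega
  · have hL := s3d_cases k a i (6 * k + 4); omega
  · rcases s3d_cases k a i t with ⟨h, x, y⟩ | ⟨l, h, x, y⟩ | ⟨l, h, x, y⟩ | ⟨l, h, x, y⟩ | ⟨l, h, x, y⟩ | ⟨l, h, x,
      y⟩ | ⟨l, x, y⟩ <;> omega

/-- `s3d` is a positive wall bridge of length `m = 6k + 4` (length symbolic). [cite: MadrasSlade1993, §1.2,
    Definition 1.2.4 (p. 11)]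
[cite: EntingJensen2009, §7.4.2, Fig. 7.10] -/
theorem s3d_mem_pwb {k a i m : ℕ} (hia : i + 1 ≤ a) (hak : a + 1 ≤ k) (hik : i + 2 ≤ k) (hm : m = 6 * k
    + 4) : s3d k a i ∈ pwb m :=
  mem_pwb_of_facts rfl (s3d_facts hia hak hik) hm

/-- Coordinates of `s3d` up to its length. [cite: EntingJensen2009, §7.4.2, Fig. 7.10] -/
theorem s3d_apply {k a i t : ℕ} (ht : t ≤ 6 * k + 4) : s3d k a i t 0 = s3dX k a i t ∧ s3d k a i t 1 = s3dY k a i t :=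
  tab_walk_apply ht

/-- **`s3d` is irreducible**: the interior visits of the initial wall run are followed by the return to column `2`,
    those of the final wall run (columns `≤ 2k`) are
preceded by the bottom run's far end `2k+1`. [cite: MadrasSlade1993, §4.2, Definition 4.2.1 (p. 90)]
[cite: Kesten1963SAW, §4] [cite: EntingJensen2009, §7.4.2, Fig. 7.10] -/
theorem s3d_mem_ipwb {k a i m : ℕ} (hia : i + 1 ≤ a) (hak : a + 1 ≤ k) (hik : i + 2 ≤ k) (hm : m = 6 * k
    + 4) : s3d k a i ∈ ipwb m := by
  refine mem_ipwb_of_facts_wit rfl (s3d_facts hia hak hik) hm (by omega) fun t ht1 ht2 hte hY => ?_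
  rcases s3d_cases k a i t with ⟨h, x, y⟩ | ⟨l, h, x, y⟩ | ⟨l, h, x, y⟩ | ⟨l, h, x, y⟩ | ⟨l, h, x, y⟩ | ⟨l, h, x,
      y⟩ | ⟨l, x, y⟩
  · refine Or.inl ⟨4 * a + 1, by omega, by omega, ?_⟩
    rcases s3d_cases k a i (4 * a + 1) with ⟨h', x', y'⟩ | ⟨l', h', x', y'⟩ | ⟨l', h', x', y'⟩ | ⟨l', h', x',
        y'⟩ | ⟨l', h', x', y'⟩ | ⟨l', h', x', y'⟩ | ⟨l', x', y'⟩ <;>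
      omega
  · omega
  · omega
  · omega
  · omega
  · omega
  · refine Or.inr ⟨2 * k + 4 * a + 2, by omega, by omega, ?_⟩
    rcases s3d_cases k a i (2 * k + 4 * a + 2) with ⟨h', x', y'⟩ | ⟨l', h', x', y'⟩ | ⟨l', h', x', y'⟩ | ⟨l', h', x',
        y'⟩ | ⟨l', h', x', y'⟩ | ⟨l', h', x', y'⟩ | ⟨l', x', y'⟩ <;>
      omega

/-- **`s3d` has `k` visits** (`a` on the initial wall run, `k − a` on the final one).
[cite: BeatonBousquetMelouDeGierDuminilCopinGuttmann2014, §3.1 (arXiv v5 p. 8)] [cite: EntingJensen2009, §7.4.2,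
    Fig. 7.10] -/
theorem visits_s3d {k a i m : ℕ} (hia : i + 1 ≤ a) (hak : a + 1 ≤ k) (hik : i + 2 ≤ k) (hm : m = 6 * k
    + 4) : visits m (s3d k a i) = k := by
  have hY : ∀ t, t ≤ 6 * k + 4 → s3d k a i t 1 = s3dY k a i t := fun t ht => (s3d_apply ht).2
  have h1 : visits (0 + (2 * a + 1)) (s3d k a i) = visits 0 (s3d k a i) + ((0 + (2 * a + 1)) / 2 - 0 / 2) :=
    visits_add_of_wall fun q _ hq => by
      rw [hY _ (by omega)]
      rcases s3d_cases k a i (0 + q) with ⟨h', x', y'⟩ | ⟨l', h', x', y'⟩ | ⟨l', h', x', y'⟩ | ⟨l', h', x',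
          y'⟩ | ⟨l', h', x', y'⟩ | ⟨l', h', x', y'⟩ | ⟨l', x', y'⟩ <;> omega
  have h2 : visits (2 * a + 1 + (4 * k + 3)) (s3d k a i) = visits (2 * a + 1) (s3d k a i) :=
    visits_add_eq_left fun q hq1 hq2 h => by
      obtain ⟨-, h0⟩ := h
      rw [hY _ (by omega)] at h0
      rcases s3d_cases k a i (2 * a + 1 + q) with ⟨h', x', y'⟩ | ⟨l', h', x', y'⟩ | ⟨l', h', x', y'⟩ | ⟨l', h', x',
          y'⟩ | ⟨l', h', x', y'⟩ | ⟨l', h', x', y'⟩ | ⟨l', x', y'⟩ <;> omega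
  have h3 : visits (4 * k + 2 * a + 4 + (2 * k - 2 * a)) (s3d k a i) = visits (4 * k + 2 * a + 4) (s3d k a i)
      + ((4 * k + 2 * a + 4 + (2 * k - 2 * a)) / 2 - (4 * k + 2 * a + 4) / 2) :=
    visits_add_of_wall fun q _ hq => by
      rw [hY _ (by omega)]
      rcases s3d_cases k a i (4 * k + 2 * a + 4 + q) with ⟨h', x', y'⟩ | ⟨l', h', x', y'⟩ | ⟨l', h', x', y'⟩ | ⟨l',
          h', x', y'⟩ | ⟨l', h', x', y'⟩ | ⟨l', h', x', y'⟩ | ⟨l', x', y'⟩ <;>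
        omega
  rw [zero_add, visits_zero, zero_add] at h1
  rw [show 2 * a + 1 + (4 * k + 3) = 4 * k + 2 * a + 4 by omega, h1] at h2
  rw [show 4 * k + 2 * a + 4 + (2 * k - 2 * a) = 6 * k + 4 by omega, h2] at h3
  subst hm
  rw [h3]
  omega

/-- **`s3d` has three down steps**, at the times `2 * a + 1`, `4 * a + 1`, `4 * a + 2 * i
    + 3`. [cite: EntingJensen2009, §7.4.2, Fig. 7.10] -/
theorem stepsD_s3d {k a i m : ℕ} (hia : i + 1 ≤ a) (hak : a + 1 ≤ k) (hik : i + 2 ≤ k) (hm : m = 6 * k + 4) :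
    stepsD m (s3d k a i) = {2 * a + 1, 4 * a + 1, 4 * a + 2 * i + 3} := by
  subst hm
  ext t
  simp only [stepsD, mem_filter, mem_range, mem_insert, mem_singleton]
  constructor
  · rintro ⟨ht, hx, hy⟩
    rw [(s3d_apply (t := t + 1) (by omega)).1, (s3d_apply (t := t) (by omega)).1] at hx
    rw [(s3d_apply (t := t + 1) (by omega)).2, (s3d_apply (t := t) (by omega)).2] at hy
    rcases s3d_cases k a i t with ⟨h, x, y⟩ | ⟨l, h, x, y⟩ | ⟨l, h, x, y⟩ | ⟨l, h, x, y⟩ | ⟨l, h, x, y⟩ | ⟨l, h, x,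
        y⟩ | ⟨l, x, y⟩ <;>
      rcases s3d_cases k a i (t + 1) with ⟨h', x', y'⟩ | ⟨l', h', x', y'⟩ | ⟨l', h', x', y'⟩ | ⟨l', h', x',
          y'⟩ | ⟨l', h', x', y'⟩ | ⟨l', h', x', y'⟩ | ⟨l', x', y'⟩ <;>
        omega
  · intro ht
    have ht4 : t + 1 ≤ 6 * k + 4 := by omega
    refine ⟨by omega, ?_, ?_⟩
    · rw [(s3d_apply ht4).1, (s3d_apply (t := t) (by omega)).1]
      rcases s3d_cases k a i t with ⟨h, x, y⟩ | ⟨l, h, x, y⟩ | ⟨l, h, x, y⟩ | ⟨l, h, x, y⟩ | ⟨l, h, x, y⟩ | ⟨l, h, x,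
          y⟩ | ⟨l, x, y⟩ <;>
        rcases s3d_cases k a i (t + 1) with ⟨h', x', y'⟩ | ⟨l', h', x', y'⟩ | ⟨l', h', x', y'⟩ | ⟨l', h', x',
            y'⟩ | ⟨l', h', x', y'⟩ | ⟨l', h', x', y'⟩ | ⟨l', x', y'⟩ <;>
          omega
    · rw [(s3d_apply ht4).2, (s3d_apply (t := t) (by omega)).2]
      rcases s3d_cases k a i t with ⟨h, x, y⟩ | ⟨l, h, x, y⟩ | ⟨l, h, x, y⟩ | ⟨l, h, x, y⟩ | ⟨l, h, x, y⟩ | ⟨l, h, x,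
          y⟩ | ⟨l, x, y⟩ <;>
        rcases s3d_cases k a i (t + 1) with ⟨h', x', y'⟩ | ⟨l', h', x', y'⟩ | ⟨l', h', x', y'⟩ | ⟨l', h', x',
            y'⟩ | ⟨l', h', x', y'⟩ | ⟨l', h', x', y'⟩ | ⟨l', x', y'⟩ <;>
          omega

/-- **`s3d` has three up steps**, at the times `2 * k + 4 * a + 2`, `4 * k + 2 * a + 2`, `4 * k + 2 * a
    + 4`. [cite: EntingJensen2009, §7.4.2, Fig. 7.10] -/
theorem stepsU_s3d {k a i m : ℕ} (hia : i + 1 ≤ a) (hak : a + 1 ≤ k) (hik : i + 2 ≤ k) (hm : m = 6 * k + 4) :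
    stepsU m (s3d k a i) = {2 * k + 4 * a + 2, 4 * k + 2 * a + 2, 4 * k + 2 * a + 4} := by
  subst hm
  ext t
  simp only [stepsU, mem_filter, mem_range, mem_insert, mem_singleton]
  constructor
  · rintro ⟨ht, hx, hy⟩
    rw [(s3d_apply (t := t + 1) (by omega)).1, (s3d_apply (t := t) (by omega)).1] at hx
    rw [(s3d_apply (t := t + 1) (by omega)).2, (s3d_apply (t := t) (by omega)).2] at hy
    rcases s3d_cases k a i t with ⟨h, x, y⟩ | ⟨l, h, x, y⟩ | ⟨l, h, x, y⟩ | ⟨l, h, x, y⟩ | ⟨l, h, x, y⟩ | ⟨l, h, x,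
        y⟩ | ⟨l, x, y⟩ <;>
      rcases s3d_cases k a i (t + 1) with ⟨h', x', y'⟩ | ⟨l', h', x', y'⟩ | ⟨l', h', x', y'⟩ | ⟨l', h', x',
          y'⟩ | ⟨l', h', x', y'⟩ | ⟨l', h', x', y'⟩ | ⟨l', x', y'⟩ <;>
        omega
  · intro ht
    have ht4 : t + 1 ≤ 6 * k + 4 := by omega
    refine ⟨by omega, ?_, ?_⟩
    · rw [(s3d_apply ht4).1, (s3d_apply (t := t) (by omega)).1]
      rcases s3d_cases k a i t with ⟨h, x, y⟩ | ⟨l, h, x, y⟩ | ⟨l, h, x, y⟩ | ⟨l, h, x, y⟩ | ⟨l, h, x, y⟩ | ⟨l, h, x,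
          y⟩ | ⟨l, x, y⟩ <;>
        rcases s3d_cases k a i (t + 1) with ⟨h', x', y'⟩ | ⟨l', h', x', y'⟩ | ⟨l', h', x', y'⟩ | ⟨l', h', x',
            y'⟩ | ⟨l', h', x', y'⟩ | ⟨l', h', x', y'⟩ | ⟨l', x', y'⟩ <;>
          omega
    · rw [(s3d_apply ht4).2, (s3d_apply (t := t) (by omega)).2]
      rcases s3d_cases k a i t with ⟨h, x, y⟩ | ⟨l, h, x, y⟩ | ⟨l, h, x, y⟩ | ⟨l, h, x, y⟩ | ⟨l, h, x, y⟩ | ⟨l, h, x,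
          y⟩ | ⟨l, x, y⟩ <;>
        rcases s3d_cases k a i (t + 1) with ⟨h', x', y'⟩ | ⟨l', h', x', y'⟩ | ⟨l', h', x', y'⟩ | ⟨l', h', x',
            y'⟩ | ⟨l', h', x', y'⟩ | ⟨l', h', x', y'⟩ | ⟨l', x', y'⟩ <;>
          omega

/-- The column of `s3d` at the end of its piece `2` (time `4 * a + 2 * i + 3`). [cite: EntingJensen2009, §7.4.2,
    Fig. 7.10] -/
theorem s3d_xend2 {k a i t : ℕ} (_ : i + 1 ≤ a) (_ : a + 1 ≤ k) (_ : i + 2 ≤ k) (ht : t = 4 * a + 2 * i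
    + 3) : s3dX k a i t = 2 * (i : ℤ) + 3 := by
  subst ht
  simp only [s3dX]
  split_ifs <;> omega

/-- The column of `s3d` at the end of its piece `4` (time `4 * k + 2 * a + 2`). [cite: EntingJensen2009, §7.4.2,
    Fig. 7.10] -/
theorem s3d_xend4 {k a i t : ℕ} (_ : i + 1 ≤ a) (_ : a + 1 ≤ k) (_ : i + 2 ≤ k) (ht : t = 4 * k + 2 * a
    + 2) : s3dX k a i t = 2 * (a : ℤ) + 2 := by
  subst ht
  simp only [s3dX]
  split_ifs <;> omega

/-! ### §5  Family A6 (`(k−1)·k(k−1)/2` blocks; excess `0`, hairpin opening,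
    exit `U R U L U`): `R^{2a+1} D L^{2a−1} D R^{2i+1} D R^{2k−2−2i−2u} U R^{2u+1} U L^{2k−2a−1} U R^{2k−2a−1}` (`1
    ≤ a ≤ k−1`, `i + u + 2 ≤ k`) -/

/-- Column table of the s3e blocks (length `6k + 4`), seven affine pieces: wall run, row `−1`, row `−2`,
    bottom row `−3`, row `−2`, row `−1`, final wall run (values `(t : ℤ)`, `-(t : ℤ) + 4 * a + 3`, `(t : ℤ) - 4 * a`,
    `(t : ℤ) - 4 * a - 1`, `(t : ℤ) - 4 * a - 2`, `-(t : ℤ) + 4 * k + 4 * a + 7`,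
    `(t : ℤ) - 4 * k - 2` on the successive pieces). [cite: EntingJensen2009, §7.4.2,
    Fig. 7.10 (brickwork form of the honeycomb lattice)] -/
def s3eX (k a i u t : ℕ) : ℤ :=
  if t ≤ 2 * a + 1 then (t : ℤ)
  else if t ≤ 4 * a + 1 then -(t : ℤ) + 4 * a + 3
  else if t ≤ 4 * a + 2 * i + 3 then (t : ℤ) - 4 * a
  else if t + 2 * u ≤ 2 * k + 4 * a + 2 then (t : ℤ) - 4 * a - 1
  else if t ≤ 2 * k + 4 * a + 4 then (t : ℤ) - 4 * a - 2
  else if t ≤ 4 * k + 2 * a + 4 then -(t : ℤ) + 4 * k + 4 * a + 7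
  else (t : ℤ) - 4 * k - 2

/-- Height table of the s3e blocks: `0, −1, −2, −3, −2, −1, 0` on the seven pieces. [cite: EntingJensen2009, §7.4.2,
    Fig. 7.10] -/
def s3eY (k a i u t : ℕ) : ℤ :=
  if t ≤ 2 * a + 1 then 0
  else if t ≤ 4 * a + 1 then -1
  else if t ≤ 4 * a + 2 * i + 3 then -2
  else if t + 2 * u ≤ 2 * k + 4 * a + 2 then -3
  else if t ≤ 2 * k + 4 * a + 4 then -2
  else if t ≤ 4 * k + 2 * a + 4 then -1
  else 0

/-- **The A6 block**
    `(0,0)→…→(2a+1,0)↓←…←(2,−1)↓(2,−2)→…→(2i+3,−2)↓(2i+3,−3)→…→(2k+1−2u,−3)↑→…→(2k+2,−2)↑(2k+2,−1)←…←(2a+3,−1)↑(2a+3,0)→…→(2k+2,0)`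
of length `6k+4` (family A6). [cite: EntingJensen2009, §7.4.2, Fig. 7.10] -/
def s3e (k a i u : ℕ) : ℕ → Site 2 := Tab.walk (6 * k + 4) (s3eX k a i u) (s3eY k a i u)

/-- The affine pieces of the tables of `s3e`, with their values. [cite: EntingJensen2009, §7.4.2, Fig. 7.10] -/
private theorem s3e_cases (k a i u t : ℕ) :
    (t ≤ 2 * a + 1 ∧ s3eX k a i u t = (t : ℤ) ∧ s3eY k a i u t = 0) ∨
      (2 * a + 2 ≤ t ∧ t ≤ 4 * a + 1 ∧ s3eX k a i u t = -(t : ℤ) + 4 * a + 3 ∧ s3eY k a i u t = -1) ∨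
      (4 * a + 2 ≤ t ∧ t ≤ 4 * a + 2 * i + 3 ∧ s3eX k a i u t = (t : ℤ) - 4 * a ∧ s3eY k a i u t = -2) ∨
      (4 * a + 2 * i + 4 ≤ t ∧ t + 2 * u ≤ 2 * k + 4 * a + 2 ∧ s3eX k a i u t = (t : ℤ) - 4 * a - 1
          ∧ s3eY k a i u t = -3) ∨
      (2 * k + 4 * a + 3 ≤ t + 2 * u ∧ t ≤ 2 * k + 4 * a + 4 ∧ s3eX k a i u t = (t : ℤ) - 4 * a - 2
          ∧ s3eY k a i u t = -2) ∨
      (2 * k + 4 * a + 5 ≤ t ∧ t ≤ 4 * k + 2 * a + 4 ∧ s3eX k a i u t = -(t : ℤ) + 4 * k + 4 * a + 7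
          ∧ s3eY k a i u t = -1) ∨
      (4 * k + 2 * a + 5 ≤ t ∧ s3eX k a i u t = (t : ℤ) - 4 * k - 2 ∧ s3eY k a i u t = 0) := by
  simp only [s3eX, s3eY]
  split_ifs
  · exact Or.inl ⟨by omega, by omega, by omega⟩
  · exact Or.inr (Or.inl ⟨by omega, by omega, by omega, by omega⟩)
  · exact Or.inr (Or.inr (Or.inl ⟨by omega, by omega, by omega, by omega⟩))
  · exact Or.inr (Or.inr (Or.inr (Or.inl ⟨by omega, by omega, by omega, by omega⟩)))
  · exact Or.inr (Or.inr (Or.inr (Or.inr (Or.inl ⟨by omega, by omega, by omega, by omega⟩))))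
  · exact Or.inr (Or.inr (Or.inr (Or.inr (Or.inr (Or.inl ⟨by omega, by omega, by omega, by omega⟩)))))
  · exact Or.inr (Or.inr (Or.inr (Or.inr (Or.inr (Or.inr (⟨by omega, by omega, by omega⟩))))))

/-- **Coordinate facts of `s3e`** (`1 ≤ a ≤ k − 1`, `i + u + 2 ≤ k`): brick-wall steps, self-avoidance,
    lower half-plane, columns in
`[0, X_L]` and `≥ 1` after time `0`, start and end on the wall, even length. [cite: EntingJensen2009, §7.4.2, Fig. 7.10]
[cite: MadrasSlade1993, §1.2, Definition 1.2.4 (bridges, p. 11)] -/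
theorem s3e_facts {k a i u : ℕ} (ha : 1 ≤ a) (hak : a + 1 ≤ k) (hiu : i + u + 2 ≤ k) : Tab.Facts (6 * k
    + 4) (s3eX k a i u) (s3eY k a i u) := by
  refine ⟨fun t ht => ?_, fun t ht s hs hx hy => ?_, fun t ht => ?_, fun t ht => ?_, ?_, ?_, ?_, by omega,
      fun t ht h1 => ?_⟩
  · rw [adjE_iff_tda]
    rcases s3e_cases k a i u t with ⟨h, x, y⟩ | ⟨l, h, x, y⟩ | ⟨l, h, x, y⟩ | ⟨l, h, x, y⟩ | ⟨l, h, x, y⟩ | ⟨l, h, x,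
        y⟩ | ⟨l, x, y⟩ <;>
      rcases s3e_cases k a i u (t + 1) with ⟨h', x', y'⟩ | ⟨l', h', x', y'⟩ | ⟨l', h', x', y'⟩ | ⟨l', h', x',
          y'⟩ | ⟨l', h', x', y'⟩ | ⟨l', h', x', y'⟩ | ⟨l', x', y'⟩ <;>
        omega
  · rcases s3e_cases k a i u t with ⟨h, x, y⟩ | ⟨l, h, x, y⟩ | ⟨l, h, x, y⟩ | ⟨l, h, x, y⟩ | ⟨l, h, x, y⟩ | ⟨l, h, x,
      y⟩ | ⟨l, x, y⟩ <;>
      rcases s3e_cases k a i u s with ⟨h', x', y'⟩ | ⟨l', h', x', y'⟩ | ⟨l', h', x', y'⟩ | ⟨l', h', x', y'⟩ | ⟨l',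
          h', x', y'⟩ | ⟨l', h', x', y'⟩ | ⟨l', x', y'⟩ <;>
        omega
  · rcases s3e_cases k a i u t with ⟨h, x, y⟩ | ⟨l, h, x, y⟩ | ⟨l, h, x, y⟩ | ⟨l, h, x, y⟩ | ⟨l, h, x, y⟩ | ⟨l, h, x,
      y⟩ | ⟨l, x, y⟩ <;> omega
  · have h0 := s3e_cases k a i u 0
    have hL := s3e_cases k a i u (6 * k + 4)
    rcases s3e_cases k a i u t with ⟨h, x, y⟩ | ⟨l, h, x, y⟩ | ⟨l, h, x, y⟩ | ⟨l, h, x, y⟩ | ⟨l, h, x, y⟩ | ⟨l, h, x,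
        y⟩ | ⟨l, x, y⟩ <;> omega
  · have h0 := s3e_cases k a i u 0; omega
  · have h0 := s3e_cases k a i u 0; omega
  · have hL := s3e_cases k a i u (6 * k + 4); omega
  · rcases s3e_cases k a i u t with ⟨h, x, y⟩ | ⟨l, h, x, y⟩ | ⟨l, h, x, y⟩ | ⟨l, h, x, y⟩ | ⟨l, h, x, y⟩ | ⟨l, h, x,
      y⟩ | ⟨l, x, y⟩ <;> omega

/-- `s3e` is a positive wall bridge of length `m = 6k + 4` (length symbolic). [cite: MadrasSlade1993, §1.2,
    Definition 1.2.4 (p. 11)]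
[cite: EntingJensen2009, §7.4.2, Fig. 7.10] -/
theorem s3e_mem_pwb {k a i u m : ℕ} (ha : 1 ≤ a) (hak : a + 1 ≤ k) (hiu : i + u + 2 ≤ k) (hm : m = 6 * k
    + 4) : s3e k a i u ∈ pwb m :=
  mem_pwb_of_facts rfl (s3e_facts ha hak hiu) hm

/-- Coordinates of `s3e` up to its length. [cite: EntingJensen2009, §7.4.2, Fig. 7.10] -/
theorem s3e_apply {k a i u t : ℕ} (ht : t ≤ 6 * k + 4) : s3e k a i u t 0 = s3eX k a i u t ∧ s3e k a i u t 1
    = s3eY k a i u t :=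
  tab_walk_apply ht

/-- **`s3e` is irreducible**: the interior visits of the initial wall run are followed by the return to column `2`,
    those of the final wall run (columns `≤ 2k`) are
preceded by the body's far end `2k+2` on row `−2`. [cite: MadrasSlade1993, §4.2, Definition 4.2.1 (p. 90)]
[cite: Kesten1963SAW, §4] [cite: EntingJensen2009, §7.4.2, Fig. 7.10] -/
theorem s3e_mem_ipwb {k a i u m : ℕ} (ha : 1 ≤ a) (hak : a + 1 ≤ k) (hiu : i + u + 2 ≤ k) (hm : m = 6 * k
    + 4) : s3e k a i u ∈ ipwb m := by
  refine mem_ipwb_of_facts_wit rfl (s3e_facts ha hak hiu) hm (by omega) fun t ht1 ht2 hte hY => ?_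
  rcases s3e_cases k a i u t with ⟨h, x, y⟩ | ⟨l, h, x, y⟩ | ⟨l, h, x, y⟩ | ⟨l, h, x, y⟩ | ⟨l, h, x, y⟩ | ⟨l, h, x,
      y⟩ | ⟨l, x, y⟩
  · refine Or.inl ⟨4 * a + 1, by omega, by omega, ?_⟩
    rcases s3e_cases k a i u (4 * a + 1) with ⟨h', x', y'⟩ | ⟨l', h', x', y'⟩ | ⟨l', h', x', y'⟩ | ⟨l', h', x',
        y'⟩ | ⟨l', h', x', y'⟩ | ⟨l', h', x', y'⟩ | ⟨l', x', y'⟩ <;>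
      omega
  · omega
  · omega
  · omega
  · omega
  · omega
  · refine Or.inr ⟨2 * k + 4 * a + 4, by omega, by omega, ?_⟩
    rcases s3e_cases k a i u (2 * k + 4 * a + 4) with ⟨h', x', y'⟩ | ⟨l', h', x', y'⟩ | ⟨l', h', x', y'⟩ | ⟨l', h',
        x', y'⟩ | ⟨l', h', x', y'⟩ | ⟨l', h', x', y'⟩ | ⟨l', x', y'⟩ <;>
      omega

/-- **`s3e` has `k` visits** (`a` on the initial wall run, `k − a` on the final one).
[cite: BeatonBousquetMelouDeGierDuminilCopinGuttmann2014, §3.1 (arXiv v5 p. 8)] [cite: EntingJensen2009, §7.4.2,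
    Fig. 7.10] -/
theorem visits_s3e {k a i u m : ℕ} (ha : 1 ≤ a) (hak : a + 1 ≤ k) (hiu : i + u + 2 ≤ k) (hm : m = 6 * k
    + 4) : visits m (s3e k a i u) = k := by
  have hY : ∀ t, t ≤ 6 * k + 4 → s3e k a i u t 1 = s3eY k a i u t := fun t ht => (s3e_apply ht).2
  have h1 : visits (0 + (2 * a + 1)) (s3e k a i u) = visits 0 (s3e k a i u) + ((0 + (2 * a + 1)) / 2 - 0 / 2) :=
    visits_add_of_wall fun q _ hq => by
      rw [hY _ (by omega)]
      rcases s3e_cases k a i u (0 + q) with ⟨h', x', y'⟩ | ⟨l', h', x', y'⟩ | ⟨l', h', x', y'⟩ | ⟨l', h', x',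
          y'⟩ | ⟨l', h', x', y'⟩ | ⟨l', h', x', y'⟩ | ⟨l', x', y'⟩ <;> omega
  have h2 : visits (2 * a + 1 + (4 * k + 3)) (s3e k a i u) = visits (2 * a + 1) (s3e k a i u) :=
    visits_add_eq_left fun q hq1 hq2 h => by
      obtain ⟨-, h0⟩ := h
      rw [hY _ (by omega)] at h0
      rcases s3e_cases k a i u (2 * a + 1 + q) with ⟨h', x', y'⟩ | ⟨l', h', x', y'⟩ | ⟨l', h', x', y'⟩ | ⟨l', h', x',
          y'⟩ | ⟨l', h', x', y'⟩ | ⟨l', h', x', y'⟩ | ⟨l', x', y'⟩ <;> omega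
  have h3 : visits (4 * k + 2 * a + 4 + (2 * k - 2 * a)) (s3e k a i u) = visits (4 * k + 2 * a + 4) (s3e k a i u)
      + ((4 * k + 2 * a + 4 + (2 * k - 2 * a)) / 2 - (4 * k + 2 * a + 4) / 2) :=
    visits_add_of_wall fun q _ hq => by
      rw [hY _ (by omega)]
      rcases s3e_cases k a i u (4 * k + 2 * a + 4 + q) with ⟨h', x', y'⟩ | ⟨l', h', x', y'⟩ | ⟨l', h', x', y'⟩ | ⟨l',
          h', x', y'⟩ | ⟨l', h', x', y'⟩ | ⟨l', h', x', y'⟩ | ⟨l', x', y'⟩ <;>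
        omega
  rw [zero_add, visits_zero, zero_add] at h1
  rw [show 2 * a + 1 + (4 * k + 3) = 4 * k + 2 * a + 4 by omega, h1] at h2
  rw [show 4 * k + 2 * a + 4 + (2 * k - 2 * a) = 6 * k + 4 by omega, h2] at h3
  subst hm
  rw [h3]
  omega

/-- **`s3e` has three down steps**, at the times `2 * a + 1`, `4 * a + 1`, `4 * a + 2 * i
    + 3`. [cite: EntingJensen2009, §7.4.2, Fig. 7.10] -/
theorem stepsD_s3e {k a i u m : ℕ} (ha : 1 ≤ a) (hak : a + 1 ≤ k) (hiu : i + u + 2 ≤ k) (hm : m = 6 * k + 4) :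
    stepsD m (s3e k a i u) = {2 * a + 1, 4 * a + 1, 4 * a + 2 * i + 3} := by
  subst hm
  ext t
  simp only [stepsD, mem_filter, mem_range, mem_insert, mem_singleton]
  constructor
  · rintro ⟨ht, hx, hy⟩
    rw [(s3e_apply (t := t + 1) (by omega)).1, (s3e_apply (t := t) (by omega)).1] at hx
    rw [(s3e_apply (t := t + 1) (by omega)).2, (s3e_apply (t := t) (by omega)).2] at hy
    rcases s3e_cases k a i u t with ⟨h, x, y⟩ | ⟨l, h, x, y⟩ | ⟨l, h, x, y⟩ | ⟨l, h, x, y⟩ | ⟨l, h, x, y⟩ | ⟨l, h, x,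
        y⟩ | ⟨l, x, y⟩ <;>
      rcases s3e_cases k a i u (t + 1) with ⟨h', x', y'⟩ | ⟨l', h', x', y'⟩ | ⟨l', h', x', y'⟩ | ⟨l', h', x',
          y'⟩ | ⟨l', h', x', y'⟩ | ⟨l', h', x', y'⟩ | ⟨l', x', y'⟩ <;>
        omega
  · intro ht
    have ht4 : t + 1 ≤ 6 * k + 4 := by omega
    refine ⟨by omega, ?_, ?_⟩
    · rw [(s3e_apply ht4).1, (s3e_apply (t := t) (by omega)).1]
      rcases s3e_cases k a i u t with ⟨h, x, y⟩ | ⟨l, h, x, y⟩ | ⟨l, h, x, y⟩ | ⟨l, h, x, y⟩ | ⟨l, h, x, y⟩ | ⟨l, h,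
          x, y⟩ | ⟨l, x, y⟩ <;>
        rcases s3e_cases k a i u (t + 1) with ⟨h', x', y'⟩ | ⟨l', h', x', y'⟩ | ⟨l', h', x', y'⟩ | ⟨l', h', x',
            y'⟩ | ⟨l', h', x', y'⟩ | ⟨l', h', x', y'⟩ | ⟨l', x', y'⟩ <;>
          omega
    · rw [(s3e_apply ht4).2, (s3e_apply (t := t) (by omega)).2]
      rcases s3e_cases k a i u t with ⟨h, x, y⟩ | ⟨l, h, x, y⟩ | ⟨l, h, x, y⟩ | ⟨l, h, x, y⟩ | ⟨l, h, x, y⟩ | ⟨l, h,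
          x, y⟩ | ⟨l, x, y⟩ <;>
        rcases s3e_cases k a i u (t + 1) with ⟨h', x', y'⟩ | ⟨l', h', x', y'⟩ | ⟨l', h', x', y'⟩ | ⟨l', h', x',
            y'⟩ | ⟨l', h', x', y'⟩ | ⟨l', h', x', y'⟩ | ⟨l', x', y'⟩ <;>
          omega

/-- **`s3e` has three up steps**, at the times `2 * k + 4 * a + 2 - 2 * u`, `2 * k + 4 * a + 4`, `4 * k + 2 * a
    + 4`. [cite: EntingJensen2009, §7.4.2, Fig. 7.10] -/
theorem stepsU_s3e {k a i u m : ℕ} (ha : 1 ≤ a) (hak : a + 1 ≤ k) (hiu : i + u + 2 ≤ k) (hm : m = 6 * k + 4) :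
    stepsU m (s3e k a i u) = {2 * k + 4 * a + 2 - 2 * u, 2 * k + 4 * a + 4, 4 * k + 2 * a + 4} := by
  subst hm
  ext t
  simp only [stepsU, mem_filter, mem_range, mem_insert, mem_singleton]
  constructor
  · rintro ⟨ht, hx, hy⟩
    rw [(s3e_apply (t := t + 1) (by omega)).1, (s3e_apply (t := t) (by omega)).1] at hx
    rw [(s3e_apply (t := t + 1) (by omega)).2, (s3e_apply (t := t) (by omega)).2] at hy
    rcases s3e_cases k a i u t with ⟨h, x, y⟩ | ⟨l, h, x, y⟩ | ⟨l, h, x, y⟩ | ⟨l, h, x, y⟩ | ⟨l, h, x, y⟩ | ⟨l, h, x,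
        y⟩ | ⟨l, x, y⟩ <;>
      rcases s3e_cases k a i u (t + 1) with ⟨h', x', y'⟩ | ⟨l', h', x', y'⟩ | ⟨l', h', x', y'⟩ | ⟨l', h', x',
          y'⟩ | ⟨l', h', x', y'⟩ | ⟨l', h', x', y'⟩ | ⟨l', x', y'⟩ <;>
        omega
  · intro ht
    have ht4 : t + 1 ≤ 6 * k + 4 := by omega
    refine ⟨by omega, ?_, ?_⟩
    · rw [(s3e_apply ht4).1, (s3e_apply (t := t) (by omega)).1]
      rcases s3e_cases k a i u t with ⟨h, x, y⟩ | ⟨l, h, x, y⟩ | ⟨l, h, x, y⟩ | ⟨l, h, x, y⟩ | ⟨l, h, x, y⟩ | ⟨l, h,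
          x, y⟩ | ⟨l, x, y⟩ <;>
        rcases s3e_cases k a i u (t + 1) with ⟨h', x', y'⟩ | ⟨l', h', x', y'⟩ | ⟨l', h', x', y'⟩ | ⟨l', h', x',
            y'⟩ | ⟨l', h', x', y'⟩ | ⟨l', h', x', y'⟩ | ⟨l', x', y'⟩ <;>
          omega
    · rw [(s3e_apply ht4).2, (s3e_apply (t := t) (by omega)).2]
      rcases s3e_cases k a i u t with ⟨h, x, y⟩ | ⟨l, h, x, y⟩ | ⟨l, h, x, y⟩ | ⟨l, h, x, y⟩ | ⟨l, h, x, y⟩ | ⟨l, h,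
          x, y⟩ | ⟨l, x, y⟩ <;>
        rcases s3e_cases k a i u (t + 1) with ⟨h', x', y'⟩ | ⟨l', h', x', y'⟩ | ⟨l', h', x', y'⟩ | ⟨l', h', x',
            y'⟩ | ⟨l', h', x', y'⟩ | ⟨l', h', x', y'⟩ | ⟨l', x', y'⟩ <;>
          omega

/-- The column of `s3e` at the end of its piece `2` (time `4 * a + 2 * i + 3`). [cite: EntingJensen2009, §7.4.2,
    Fig. 7.10] -/
theorem s3e_xend2 {k a i u t : ℕ} (_ : 1 ≤ a) (_ : a + 1 ≤ k) (_ : i + u + 2 ≤ k) (ht : t = 4 * a + 2 * i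
    + 3) : s3eX k a i u t = 2 * (i : ℤ) + 3 := by
  subst ht
  simp only [s3eX]
  split_ifs <;> omega

/-- The column of `s3e` at the end of its piece `4` (time `2 * k + 4 * a + 4`). [cite: EntingJensen2009, §7.4.2,
    Fig. 7.10] -/
theorem s3e_xend4 {k a i u t : ℕ} (_ : 1 ≤ a) (_ : a + 1 ≤ k) (_ : i + u + 2 ≤ k) (ht : t = 2 * k + 4 * a
    + 4) : s3eX k a i u t = 2 * (k : ℤ) + 2 := by
  subst ht
  simp only [s3eX]
  split_ifs <;> omega

/-- The column of `s3e` at the end of its piece `5` (time `4 * k + 2 * a + 4`). [cite: EntingJensen2009, §7.4.2,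
    Fig. 7.10] -/
theorem s3e_xend5 {k a i u t : ℕ} (_ : 1 ≤ a) (_ : a + 1 ≤ k) (_ : i + u + 2 ≤ k) (ht : t = 4 * k + 2 * a
    + 4) : s3eX k a i u t = 2 * (a : ℤ) + 3 := by
  subst ht
  simp only [s3eX]
  split_ifs <;> omega

/-! ### §6  Family B2 (`(k−2)(k−1)(2k+3)/6` blocks; excess `2`, hairpin opening,
    exit `U L U L U`): `R^{2a+1} D L^{2a−1} D R^{2i+1} D R^{2k−2i} U L^{2u+1} U L^{2k−3−2a−2u} U R^{2k−2a−1}` (`1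
    ≤ a`, `a + u + 2 ≤ k`, `i + u + 1 ≤ k`) -/

/-- Column table of the s3f blocks (length `6k + 4`), seven affine pieces: wall run, row `−1`, row `−2`,
    bottom row `−3`, row `−2`, row `−1`, final wall run (values `(t : ℤ)`, `-(t : ℤ) + 4 * a + 3`, `(t : ℤ) - 4 * a`,
    `(t : ℤ) - 4 * a - 1`, `-(t : ℤ) + 4 * k + 4 * a + 8`, `-(t : ℤ) + 4 * k + 4 * a + 9`,
    `(t : ℤ) - 4 * k` on the successive pieces). [cite: EntingJensen2009, §7.4.2,
    Fig. 7.10 (brickwork form of the honeycomb lattice)] -/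
def s3fX (k a i u t : ℕ) : ℤ :=
  if t ≤ 2 * a + 1 then (t : ℤ)
  else if t ≤ 4 * a + 1 then -(t : ℤ) + 4 * a + 3
  else if t ≤ 4 * a + 2 * i + 3 then (t : ℤ) - 4 * a
  else if t ≤ 2 * k + 4 * a + 4 then (t : ℤ) - 4 * a - 1
  else if t ≤ 2 * k + 4 * a + 2 * u + 6 then -(t : ℤ) + 4 * k + 4 * a + 8
  else if t ≤ 4 * k + 2 * a + 4 then -(t : ℤ) + 4 * k + 4 * a + 9
  else (t : ℤ) - 4 * k

/-- Height table of the s3f blocks: `0, −1, −2, −3, −2, −1, 0` on the seven pieces. [cite: EntingJensen2009, §7.4.2,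
    Fig. 7.10] -/
def s3fY (k a i u t : ℕ) : ℤ :=
  if t ≤ 2 * a + 1 then 0
  else if t ≤ 4 * a + 1 then -1
  else if t ≤ 4 * a + 2 * i + 3 then -2
  else if t ≤ 2 * k + 4 * a + 4 then -3
  else if t ≤ 2 * k + 4 * a + 2 * u + 6 then -2
  else if t ≤ 4 * k + 2 * a + 4 then -1
  else 0

/-- **The B2 block**
    `(0,0)→…→(2a+1,0)↓←…←(2,−1)↓(2,−2)→…→(2i+3,−2)↓(2i+3,−3)→…→(2k+3,−3)↑←…←(2k+2−2u,−2)↑←…←(2a+5,−1)↑(2a+5,0)→…→(2k+4,0)`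
of length `6k+4` and span `2k+4` (family B2). [cite: EntingJensen2009, §7.4.2, Fig. 7.10] -/
def s3f (k a i u : ℕ) : ℕ → Site 2 := Tab.walk (6 * k + 4) (s3fX k a i u) (s3fY k a i u)

/-- The affine pieces of the tables of `s3f`, with their values. [cite: EntingJensen2009, §7.4.2, Fig. 7.10] -/
private theorem s3f_cases (k a i u t : ℕ) :
    (t ≤ 2 * a + 1 ∧ s3fX k a i u t = (t : ℤ) ∧ s3fY k a i u t = 0) ∨
      (2 * a + 2 ≤ t ∧ t ≤ 4 * a + 1 ∧ s3fX k a i u t = -(t : ℤ) + 4 * a + 3 ∧ s3fY k a i u t = -1) ∨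
      (4 * a + 2 ≤ t ∧ t ≤ 4 * a + 2 * i + 3 ∧ s3fX k a i u t = (t : ℤ) - 4 * a ∧ s3fY k a i u t = -2) ∨
      (4 * a + 2 * i + 4 ≤ t ∧ t ≤ 2 * k + 4 * a + 4 ∧ s3fX k a i u t = (t : ℤ) - 4 * a - 1 ∧ s3fY k a i u t = -3) ∨
      (2 * k + 4 * a + 5 ≤ t ∧ t ≤ 2 * k + 4 * a + 2 * u + 6 ∧ s3fX k a i u t = -(t : ℤ) + 4 * k + 4 * a + 8
          ∧ s3fY k a i u t = -2) ∨
      (2 * k + 4 * a + 2 * u + 7 ≤ t ∧ t ≤ 4 * k + 2 * a + 4 ∧ s3fX k a i u t = -(t : ℤ) + 4 * k + 4 * a + 9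
          ∧ s3fY k a i u t = -1) ∨
      (4 * k + 2 * a + 5 ≤ t ∧ s3fX k a i u t = (t : ℤ) - 4 * k ∧ s3fY k a i u t = 0) := by
  simp only [s3fX, s3fY]
  split_ifs
  · exact Or.inl ⟨by omega, by omega, by omega⟩
  · exact Or.inr (Or.inl ⟨by omega, by omega, by omega, by omega⟩)
  · exact Or.inr (Or.inr (Or.inl ⟨by omega, by omega, by omega, by omega⟩))
  · exact Or.inr (Or.inr (Or.inr (Or.inl ⟨by omega, by omega, by omega, by omega⟩)))
  · exact Or.inr (Or.inr (Or.inr (Or.inr (Or.inl ⟨by omega, by omega, by omega, by omega⟩))))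
  · exact Or.inr (Or.inr (Or.inr (Or.inr (Or.inr (Or.inl ⟨by omega, by omega, by omega, by omega⟩)))))
  · exact Or.inr (Or.inr (Or.inr (Or.inr (Or.inr (Or.inr (⟨by omega, by omega, by omega⟩))))))

/-- **Coordinate facts of `s3f`** (`1 ≤ a`, `a + u + 2 ≤ k`, `i + u + 1 ≤ k`): brick-wall steps, self-avoidance,
    lower half-plane, columns in
`[0, X_L]` and `≥ 1` after time `0`, start and end on the wall, even length. [cite: EntingJensen2009, §7.4.2, Fig. 7.10]
[cite: MadrasSlade1993, §1.2, Definition 1.2.4 (bridges, p. 11)] -/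
theorem s3f_facts {k a i u : ℕ} (ha : 1 ≤ a) (hau : a + u + 2 ≤ k) (hiu : i + u + 1 ≤ k) : Tab.Facts (6 * k
    + 4) (s3fX k a i u) (s3fY k a i u) := by
  refine ⟨fun t ht => ?_, fun t ht s hs hx hy => ?_, fun t ht => ?_, fun t ht => ?_, ?_, ?_, ?_, by omega,
      fun t ht h1 => ?_⟩
  · rw [adjE_iff_tda]
    rcases s3f_cases k a i u t with ⟨h, x, y⟩ | ⟨l, h, x, y⟩ | ⟨l, h, x, y⟩ | ⟨l, h, x, y⟩ | ⟨l, h, x, y⟩ | ⟨l, h, x,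
        y⟩ | ⟨l, x, y⟩ <;>
      rcases s3f_cases k a i u (t + 1) with ⟨h', x', y'⟩ | ⟨l', h', x', y'⟩ | ⟨l', h', x', y'⟩ | ⟨l', h', x',
          y'⟩ | ⟨l', h', x', y'⟩ | ⟨l', h', x', y'⟩ | ⟨l', x', y'⟩ <;>
        omega
  · rcases s3f_cases k a i u t with ⟨h, x, y⟩ | ⟨l, h, x, y⟩ | ⟨l, h, x, y⟩ | ⟨l, h, x, y⟩ | ⟨l, h, x, y⟩ | ⟨l, h, x,
      y⟩ | ⟨l, x, y⟩ <;>
      rcases s3f_cases k a i u s with ⟨h', x', y'⟩ | ⟨l', h', x', y'⟩ | ⟨l', h', x', y'⟩ | ⟨l', h', x', y'⟩ | ⟨l',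
          h', x', y'⟩ | ⟨l', h', x', y'⟩ | ⟨l', x', y'⟩ <;>
        omega
  · rcases s3f_cases k a i u t with ⟨h, x, y⟩ | ⟨l, h, x, y⟩ | ⟨l, h, x, y⟩ | ⟨l, h, x, y⟩ | ⟨l, h, x, y⟩ | ⟨l, h, x,
      y⟩ | ⟨l, x, y⟩ <;> omega
  · have h0 := s3f_cases k a i u 0
    have hL := s3f_cases k a i u (6 * k + 4)
    rcases s3f_cases k a i u t with ⟨h, x, y⟩ | ⟨l, h, x, y⟩ | ⟨l, h, x, y⟩ | ⟨l, h, x, y⟩ | ⟨l, h, x, y⟩ | ⟨l, h, x,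
        y⟩ | ⟨l, x, y⟩ <;> omega
  · have h0 := s3f_cases k a i u 0; omega
  · have h0 := s3f_cases k a i u 0; omega
  · have hL := s3f_cases k a i u (6 * k + 4); omega
  · rcases s3f_cases k a i u t with ⟨h, x, y⟩ | ⟨l, h, x, y⟩ | ⟨l, h, x, y⟩ | ⟨l, h, x, y⟩ | ⟨l, h, x, y⟩ | ⟨l, h, x,
      y⟩ | ⟨l, x, y⟩ <;> omega

/-- `s3f` is a positive wall bridge of length `m = 6k + 4` (length symbolic). [cite: MadrasSlade1993, §1.2,
    Definition 1.2.4 (p. 11)]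
[cite: EntingJensen2009, §7.4.2, Fig. 7.10] -/
theorem s3f_mem_pwb {k a i u m : ℕ} (ha : 1 ≤ a) (hau : a + u + 2 ≤ k) (hiu : i + u + 1 ≤ k) (hm : m = 6 * k
    + 4) : s3f k a i u ∈ pwb m :=
  mem_pwb_of_facts rfl (s3f_facts ha hau hiu) hm

/-- Coordinates of `s3f` up to its length. [cite: EntingJensen2009, §7.4.2, Fig. 7.10] -/
theorem s3f_apply {k a i u t : ℕ} (ht : t ≤ 6 * k + 4) : s3f k a i u t 0 = s3fX k a i u t ∧ s3f k a i u t 1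
    = s3fY k a i u t :=
  tab_walk_apply ht

/-- **`s3f` is irreducible**: the interior visits of the initial wall run are followed by the return to column `2`,
    those of the final wall run (columns `≤ 2k+2`) are
preceded by the bottom run's far end `2k+3`. [cite: MadrasSlade1993, §4.2, Definition 4.2.1 (p. 90)]
[cite: Kesten1963SAW, §4] [cite: EntingJensen2009, §7.4.2, Fig. 7.10] -/
theorem s3f_mem_ipwb {k a i u m : ℕ} (ha : 1 ≤ a) (hau : a + u + 2 ≤ k) (hiu : i + u + 1 ≤ k) (hm : m = 6 * k
    + 4) : s3f k a i u ∈ ipwb m := by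
  refine mem_ipwb_of_facts_wit rfl (s3f_facts ha hau hiu) hm (by omega) fun t ht1 ht2 hte hY => ?_
  rcases s3f_cases k a i u t with ⟨h, x, y⟩ | ⟨l, h, x, y⟩ | ⟨l, h, x, y⟩ | ⟨l, h, x, y⟩ | ⟨l, h, x, y⟩ | ⟨l, h, x,
      y⟩ | ⟨l, x, y⟩
  · refine Or.inl ⟨4 * a + 1, by omega, by omega, ?_⟩
    rcases s3f_cases k a i u (4 * a + 1) with ⟨h', x', y'⟩ | ⟨l', h', x', y'⟩ | ⟨l', h', x', y'⟩ | ⟨l', h', x',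
        y'⟩ | ⟨l', h', x', y'⟩ | ⟨l', h', x', y'⟩ | ⟨l', x', y'⟩ <;>
      omega
  · omega
  · omega
  · omega
  · omega
  · omega
  · refine Or.inr ⟨2 * k + 4 * a + 4, by omega, by omega, ?_⟩
    rcases s3f_cases k a i u (2 * k + 4 * a + 4) with ⟨h', x', y'⟩ | ⟨l', h', x', y'⟩ | ⟨l', h', x', y'⟩ | ⟨l', h',
        x', y'⟩ | ⟨l', h', x', y'⟩ | ⟨l', h', x', y'⟩ | ⟨l', x', y'⟩ <;>
      omega

/-- **`s3f` has `k` visits** (`a` on the initial wall run, `k − a` on the final one).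
[cite: BeatonBousquetMelouDeGierDuminilCopinGuttmann2014, §3.1 (arXiv v5 p. 8)] [cite: EntingJensen2009, §7.4.2,
    Fig. 7.10] -/
theorem visits_s3f {k a i u m : ℕ} (ha : 1 ≤ a) (hau : a + u + 2 ≤ k) (hiu : i + u + 1 ≤ k) (hm : m = 6 * k
    + 4) : visits m (s3f k a i u) = k := by
  have hY : ∀ t, t ≤ 6 * k + 4 → s3f k a i u t 1 = s3fY k a i u t := fun t ht => (s3f_apply ht).2
  have h1 : visits (0 + (2 * a + 1)) (s3f k a i u) = visits 0 (s3f k a i u) + ((0 + (2 * a + 1)) / 2 - 0 / 2) :=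
    visits_add_of_wall fun q _ hq => by
      rw [hY _ (by omega)]
      rcases s3f_cases k a i u (0 + q) with ⟨h', x', y'⟩ | ⟨l', h', x', y'⟩ | ⟨l', h', x', y'⟩ | ⟨l', h', x',
          y'⟩ | ⟨l', h', x', y'⟩ | ⟨l', h', x', y'⟩ | ⟨l', x', y'⟩ <;> omega
  have h2 : visits (2 * a + 1 + (4 * k + 3)) (s3f k a i u) = visits (2 * a + 1) (s3f k a i u) :=
    visits_add_eq_left fun q hq1 hq2 h => by
      obtain ⟨-, h0⟩ := h
      rw [hY _ (by omega)] at h0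
      rcases s3f_cases k a i u (2 * a + 1 + q) with ⟨h', x', y'⟩ | ⟨l', h', x', y'⟩ | ⟨l', h', x', y'⟩ | ⟨l', h', x',
          y'⟩ | ⟨l', h', x', y'⟩ | ⟨l', h', x', y'⟩ | ⟨l', x', y'⟩ <;> omega
  have h3 : visits (4 * k + 2 * a + 4 + (2 * k - 2 * a)) (s3f k a i u) = visits (4 * k + 2 * a + 4) (s3f k a i u)
      + ((4 * k + 2 * a + 4 + (2 * k - 2 * a)) / 2 - (4 * k + 2 * a + 4) / 2) :=
    visits_add_of_wall fun q _ hq => by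
      rw [hY _ (by omega)]
      rcases s3f_cases k a i u (4 * k + 2 * a + 4 + q) with ⟨h', x', y'⟩ | ⟨l', h', x', y'⟩ | ⟨l', h', x', y'⟩ | ⟨l',
          h', x', y'⟩ | ⟨l', h', x', y'⟩ | ⟨l', h', x', y'⟩ | ⟨l', x', y'⟩ <;>
        omega
  rw [zero_add, visits_zero, zero_add] at h1
  rw [show 2 * a + 1 + (4 * k + 3) = 4 * k + 2 * a + 4 by omega, h1] at h2
  rw [show 4 * k + 2 * a + 4 + (2 * k - 2 * a) = 6 * k + 4 by omega, h2] at h3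
  subst hm
  rw [h3]
  omega

/-- **`s3f` has three down steps**, at the times `2 * a + 1`, `4 * a + 1`, `4 * a + 2 * i
    + 3`. [cite: EntingJensen2009, §7.4.2, Fig. 7.10] -/
theorem stepsD_s3f {k a i u m : ℕ} (ha : 1 ≤ a) (hau : a + u + 2 ≤ k) (hiu : i + u + 1 ≤ k) (hm : m = 6 * k + 4) :
    stepsD m (s3f k a i u) = {2 * a + 1, 4 * a + 1, 4 * a + 2 * i + 3} := by
  subst hm
  ext t
  simp only [stepsD, mem_filter, mem_range, mem_insert, mem_singleton]
  constructor
  · rintro ⟨ht, hx, hy⟩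
    rw [(s3f_apply (t := t + 1) (by omega)).1, (s3f_apply (t := t) (by omega)).1] at hx
    rw [(s3f_apply (t := t + 1) (by omega)).2, (s3f_apply (t := t) (by omega)).2] at hy
    rcases s3f_cases k a i u t with ⟨h, x, y⟩ | ⟨l, h, x, y⟩ | ⟨l, h, x, y⟩ | ⟨l, h, x, y⟩ | ⟨l, h, x, y⟩ | ⟨l, h, x,
        y⟩ | ⟨l, x, y⟩ <;>
      rcases s3f_cases k a i u (t + 1) with ⟨h', x', y'⟩ | ⟨l', h', x', y'⟩ | ⟨l', h', x', y'⟩ | ⟨l', h', x',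
          y'⟩ | ⟨l', h', x', y'⟩ | ⟨l', h', x', y'⟩ | ⟨l', x', y'⟩ <;>
        omega
  · intro ht
    have ht4 : t + 1 ≤ 6 * k + 4 := by omega
    refine ⟨by omega, ?_, ?_⟩
    · rw [(s3f_apply ht4).1, (s3f_apply (t := t) (by omega)).1]
      rcases s3f_cases k a i u t with ⟨h, x, y⟩ | ⟨l, h, x, y⟩ | ⟨l, h, x, y⟩ | ⟨l, h, x, y⟩ | ⟨l, h, x, y⟩ | ⟨l, h,
          x, y⟩ | ⟨l, x, y⟩ <;>
        rcases s3f_cases k a i u (t + 1) with ⟨h', x', y'⟩ | ⟨l', h', x', y'⟩ | ⟨l', h', x', y'⟩ | ⟨l', h', x',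
            y'⟩ | ⟨l', h', x', y'⟩ | ⟨l', h', x', y'⟩ | ⟨l', x', y'⟩ <;>
          omega
    · rw [(s3f_apply ht4).2, (s3f_apply (t := t) (by omega)).2]
      rcases s3f_cases k a i u t with ⟨h, x, y⟩ | ⟨l, h, x, y⟩ | ⟨l, h, x, y⟩ | ⟨l, h, x, y⟩ | ⟨l, h, x, y⟩ | ⟨l, h,
          x, y⟩ | ⟨l, x, y⟩ <;>
        rcases s3f_cases k a i u (t + 1) with ⟨h', x', y'⟩ | ⟨l', h', x', y'⟩ | ⟨l', h', x', y'⟩ | ⟨l', h', x',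
            y'⟩ | ⟨l', h', x', y'⟩ | ⟨l', h', x', y'⟩ | ⟨l', x', y'⟩ <;>
          omega

/-- **`s3f` has three up steps**, at the times `2 * k + 4 * a + 4`, `2 * k + 4 * a + 2 * u + 6`, `4 * k + 2 * a
    + 4`. [cite: EntingJensen2009, §7.4.2, Fig. 7.10] -/
theorem stepsU_s3f {k a i u m : ℕ} (ha : 1 ≤ a) (hau : a + u + 2 ≤ k) (hiu : i + u + 1 ≤ k) (hm : m = 6 * k + 4) :
    stepsU m (s3f k a i u) = {2 * k + 4 * a + 4, 2 * k + 4 * a + 2 * u + 6, 4 * k + 2 * a + 4} := by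
  subst hm
  ext t
  simp only [stepsU, mem_filter, mem_range, mem_insert, mem_singleton]
  constructor
  · rintro ⟨ht, hx, hy⟩
    rw [(s3f_apply (t := t + 1) (by omega)).1, (s3f_apply (t := t) (by omega)).1] at hx
    rw [(s3f_apply (t := t + 1) (by omega)).2, (s3f_apply (t := t) (by omega)).2] at hy
    rcases s3f_cases k a i u t with ⟨h, x, y⟩ | ⟨l, h, x, y⟩ | ⟨l, h, x, y⟩ | ⟨l, h, x, y⟩ | ⟨l, h, x, y⟩ | ⟨l, h, x,
        y⟩ | ⟨l, x, y⟩ <;>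
      rcases s3f_cases k a i u (t + 1) with ⟨h', x', y'⟩ | ⟨l', h', x', y'⟩ | ⟨l', h', x', y'⟩ | ⟨l', h', x',
          y'⟩ | ⟨l', h', x', y'⟩ | ⟨l', h', x', y'⟩ | ⟨l', x', y'⟩ <;>
        omega
  · intro ht
    have ht4 : t + 1 ≤ 6 * k + 4 := by omega
    refine ⟨by omega, ?_, ?_⟩
    · rw [(s3f_apply ht4).1, (s3f_apply (t := t) (by omega)).1]
      rcases s3f_cases k a i u t with ⟨h, x, y⟩ | ⟨l, h, x, y⟩ | ⟨l, h, x, y⟩ | ⟨l, h, x, y⟩ | ⟨l, h, x, y⟩ | ⟨l, h,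
          x, y⟩ | ⟨l, x, y⟩ <;>
        rcases s3f_cases k a i u (t + 1) with ⟨h', x', y'⟩ | ⟨l', h', x', y'⟩ | ⟨l', h', x', y'⟩ | ⟨l', h', x',
            y'⟩ | ⟨l', h', x', y'⟩ | ⟨l', h', x', y'⟩ | ⟨l', x', y'⟩ <;>
          omega
    · rw [(s3f_apply ht4).2, (s3f_apply (t := t) (by omega)).2]
      rcases s3f_cases k a i u t with ⟨h, x, y⟩ | ⟨l, h, x, y⟩ | ⟨l, h, x, y⟩ | ⟨l, h, x, y⟩ | ⟨l, h, x, y⟩ | ⟨l, h,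
          x, y⟩ | ⟨l, x, y⟩ <;>
        rcases s3f_cases k a i u (t + 1) with ⟨h', x', y'⟩ | ⟨l', h', x', y'⟩ | ⟨l', h', x', y'⟩ | ⟨l', h', x',
            y'⟩ | ⟨l', h', x', y'⟩ | ⟨l', h', x', y'⟩ | ⟨l', x', y'⟩ <;>
          omega

/-- The column of `s3f` at the end of its piece `2` (time `4 * a + 2 * i + 3`). [cite: EntingJensen2009, §7.4.2,
    Fig. 7.10] -/
theorem s3f_xend2 {k a i u t : ℕ} (_ : 1 ≤ a) (_ : a + u + 2 ≤ k) (_ : i + u + 1 ≤ k) (ht : t = 4 * a + 2 * i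
    + 3) : s3fX k a i u t = 2 * (i : ℤ) + 3 := by
  subst ht
  simp only [s3fX]
  split_ifs <;> omega

/-! ### §7  Family B3 (`(k−1)²` blocks; excess `2`, wall run of length `2k−1`,
    staircase exit): `R^{2k−1} D L^{2k−3} D R^{2i+1} D R^{2k−2−2i−2u−2g} U R^{2u+1} U R^{2g+1} U R` (`g ≤ 1`, `i
    + u + g + 2 ≤ k`) -/

/-- Column table of the s3g blocks (length `6k + 4`), seven affine pieces: wall run, row `−1`, row `−2`,
    bottom row `−3`, row `−2`, row `−1`, final wall run (values `(t : ℤ)`, `-(t : ℤ) + 4 * k - 1`, `(t : ℤ) - 4 * k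
    + 4`, `(t : ℤ) - 4 * k + 3`, `(t : ℤ) - 4 * k + 2`, `(t : ℤ) - 4 * k + 1`,
    `(t : ℤ) - 4 * k` on the successive pieces). [cite: EntingJensen2009, §7.4.2,
    Fig. 7.10 (brickwork form of the honeycomb lattice)] -/
def s3gX (k i u g t : ℕ) : ℤ :=
  if t + 1 ≤ 2 * k then (t : ℤ)
  else if t + 3 ≤ 4 * k then -(t : ℤ) + 4 * k - 1
  else if t + 1 ≤ 4 * k + 2 * i then (t : ℤ) - 4 * k + 4
  else if t + 2 * u + 2 * g + 2 ≤ 6 * k then (t : ℤ) - 4 * k + 3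
  else if t + 2 * g ≤ 6 * k then (t : ℤ) - 4 * k + 2
  else if t ≤ 6 * k + 2 then (t : ℤ) - 4 * k + 1
  else (t : ℤ) - 4 * k

/-- Height table of the s3g blocks: `0, −1, −2, −3, −2, −1, 0` on the seven pieces. [cite: EntingJensen2009, §7.4.2,
    Fig. 7.10] -/
def s3gY (k i u g t : ℕ) : ℤ :=
  if t + 1 ≤ 2 * k then 0
  else if t + 3 ≤ 4 * k then -1
  else if t + 1 ≤ 4 * k + 2 * i then -2
  else if t + 2 * u + 2 * g + 2 ≤ 6 * k then -3
  else if t + 2 * g ≤ 6 * k then -2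
  else if t ≤ 6 * k + 2 then -1
  else 0

/-- **The B3 block**
    `(0,0)→…→(2k−1,0)↓←…←(2,−1)↓(2,−2)→…→(2i+3,−2)↓(2i+3,−3)→…→(2k+2−2u−2g,−3)↑→…→(2k+3−2g,−2)↑→…→(2k+3,−1)↑(2k+3,0)→(2k+4,0)`
of length `6k+4` and span `2k+4` (family B3; `g = 0, 1` are the lane's `g ∈ {1, 3}`). [cite: EntingJensen2009,
    §7.4.2, Fig. 7.10] -/
def s3g (k i u g : ℕ) : ℕ → Site 2 := Tab.walk (6 * k + 4) (s3gX k i u g) (s3gY k i u g)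

/-- The affine pieces of the tables of `s3g`, with their values. [cite: EntingJensen2009, §7.4.2, Fig. 7.10] -/
private theorem s3g_cases (k i u g t : ℕ) :
    (t + 1 ≤ 2 * k ∧ s3gX k i u g t = (t : ℤ) ∧ s3gY k i u g t = 0) ∨
      (2 * k ≤ t ∧ t + 3 ≤ 4 * k ∧ s3gX k i u g t = -(t : ℤ) + 4 * k - 1 ∧ s3gY k i u g t = -1) ∨
      (4 * k ≤ t + 2 ∧ t + 1 ≤ 4 * k + 2 * i ∧ s3gX k i u g t = (t : ℤ) - 4 * k + 4 ∧ s3gY k i u g t = -2) ∨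
      (4 * k + 2 * i ≤ t ∧ t + 2 * u + 2 * g + 2 ≤ 6 * k ∧ s3gX k i u g t = (t : ℤ) - 4 * k + 3 ∧ s3gY k i u g t = -3) ∨
      (6 * k ≤ t + 2 * u + 2 * g + 1 ∧ t + 2 * g ≤ 6 * k ∧ s3gX k i u g t = (t : ℤ) - 4 * k + 2 ∧ s3gY k i u g t = -2) ∨
      (6 * k + 1 ≤ t + 2 * g ∧ t ≤ 6 * k + 2 ∧ s3gX k i u g t = (t : ℤ) - 4 * k + 1 ∧ s3gY k i u g t = -1) ∨
      (6 * k + 3 ≤ t ∧ s3gX k i u g t = (t : ℤ) - 4 * k ∧ s3gY k i u g t = 0) := by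
  simp only [s3gX, s3gY]
  split_ifs
  · exact Or.inl ⟨by omega, by omega, by omega⟩
  · exact Or.inr (Or.inl ⟨by omega, by omega, by omega, by omega⟩)
  · exact Or.inr (Or.inr (Or.inl ⟨by omega, by omega, by omega, by omega⟩))
  · exact Or.inr (Or.inr (Or.inr (Or.inl ⟨by omega, by omega, by omega, by omega⟩)))
  · exact Or.inr (Or.inr (Or.inr (Or.inr (Or.inl ⟨by omega, by omega, by omega, by omega⟩))))
  · exact Or.inr (Or.inr (Or.inr (Or.inr (Or.inr (Or.inl ⟨by omega, by omega, by omega, by omega⟩)))))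
  · exact Or.inr (Or.inr (Or.inr (Or.inr (Or.inr (Or.inr (⟨by omega, by omega, by omega⟩))))))

/-- **Coordinate facts of `s3g`** (`g ≤ 1`, `i + u + g + 2 ≤ k`): brick-wall steps, self-avoidance, lower half-plane,
    columns in
`[0, X_L]` and `≥ 1` after time `0`, start and end on the wall, even length. [cite: EntingJensen2009, §7.4.2, Fig. 7.10]
[cite: MadrasSlade1993, §1.2, Definition 1.2.4 (bridges, p. 11)] -/
theorem s3g_facts {k i u g : ℕ} (hg : g ≤ 1) (hiug : i + u + g + 2 ≤ k) : Tab.Facts (6 * k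
    + 4) (s3gX k i u g) (s3gY k i u g) := by
  refine ⟨fun t ht => ?_, fun t ht s hs hx hy => ?_, fun t ht => ?_, fun t ht => ?_, ?_, ?_, ?_, by omega,
      fun t ht h1 => ?_⟩
  · rw [adjE_iff_tda]
    rcases s3g_cases k i u g t with ⟨h, x, y⟩ | ⟨l, h, x, y⟩ | ⟨l, h, x, y⟩ | ⟨l, h, x, y⟩ | ⟨l, h, x, y⟩ | ⟨l, h, x,
        y⟩ | ⟨l, x, y⟩ <;>
      rcases s3g_cases k i u g (t + 1) with ⟨h', x', y'⟩ | ⟨l', h', x', y'⟩ | ⟨l', h', x', y'⟩ | ⟨l', h', x',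
          y'⟩ | ⟨l', h', x', y'⟩ | ⟨l', h', x', y'⟩ | ⟨l', x', y'⟩ <;>
        omega
  · rcases s3g_cases k i u g t with ⟨h, x, y⟩ | ⟨l, h, x, y⟩ | ⟨l, h, x, y⟩ | ⟨l, h, x, y⟩ | ⟨l, h, x, y⟩ | ⟨l, h, x,
      y⟩ | ⟨l, x, y⟩ <;>
      rcases s3g_cases k i u g s with ⟨h', x', y'⟩ | ⟨l', h', x', y'⟩ | ⟨l', h', x', y'⟩ | ⟨l', h', x', y'⟩ | ⟨l',
          h', x', y'⟩ | ⟨l', h', x', y'⟩ | ⟨l', x', y'⟩ <;>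
        omega
  · rcases s3g_cases k i u g t with ⟨h, x, y⟩ | ⟨l, h, x, y⟩ | ⟨l, h, x, y⟩ | ⟨l, h, x, y⟩ | ⟨l, h, x, y⟩ | ⟨l, h, x,
      y⟩ | ⟨l, x, y⟩ <;> omega
  · have h0 := s3g_cases k i u g 0
    have hL := s3g_cases k i u g (6 * k + 4)
    rcases s3g_cases k i u g t with ⟨h, x, y⟩ | ⟨l, h, x, y⟩ | ⟨l, h, x, y⟩ | ⟨l, h, x, y⟩ | ⟨l, h, x, y⟩ | ⟨l, h, x,
        y⟩ | ⟨l, x, y⟩ <;> omega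
  · have h0 := s3g_cases k i u g 0; omega
  · have h0 := s3g_cases k i u g 0; omega
  · have hL := s3g_cases k i u g (6 * k + 4); omega
  · rcases s3g_cases k i u g t with ⟨h, x, y⟩ | ⟨l, h, x, y⟩ | ⟨l, h, x, y⟩ | ⟨l, h, x, y⟩ | ⟨l, h, x, y⟩ | ⟨l, h, x,
      y⟩ | ⟨l, x, y⟩ <;> omega

/-- `s3g` is a positive wall bridge of length `m = 6k + 4` (length symbolic). [cite: MadrasSlade1993, §1.2,
    Definition 1.2.4 (p. 11)]
[cite: EntingJensen2009, §7.4.2, Fig. 7.10] -/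
theorem s3g_mem_pwb {k i u g m : ℕ} (hg : g ≤ 1) (hiug : i + u + g + 2 ≤ k) (hm : m = 6 * k
    + 4) : s3g k i u g ∈ pwb m :=
  mem_pwb_of_facts rfl (s3g_facts hg hiug) hm

/-- Coordinates of `s3g` up to its length. [cite: EntingJensen2009, §7.4.2, Fig. 7.10] -/
theorem s3g_apply {k i u g t : ℕ} (ht : t ≤ 6 * k + 4) : s3g k i u g t 0 = s3gX k i u g t ∧ s3g k i u g t 1
    = s3gY k i u g t :=
  tab_walk_apply ht

/-- **`s3g` is irreducible**: the interior visits (all on the initial wall run) are followed by the return to column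
    `2`; the final wall run is a single step. [cite: MadrasSlade1993, §4.2, Definition 4.2.1 (p. 90)]
[cite: Kesten1963SAW, §4] [cite: EntingJensen2009, §7.4.2, Fig. 7.10] -/
theorem s3g_mem_ipwb {k i u g m : ℕ} (hg : g ≤ 1) (hiug : i + u + g + 2 ≤ k) (hm : m = 6 * k
    + 4) : s3g k i u g ∈ ipwb m := by
  refine mem_ipwb_of_facts_wit rfl (s3g_facts hg hiug) hm (by omega) fun t ht1 ht2 hte hY => ?_
  rcases s3g_cases k i u g t with ⟨h, x, y⟩ | ⟨l, h, x, y⟩ | ⟨l, h, x, y⟩ | ⟨l, h, x, y⟩ | ⟨l, h, x, y⟩ | ⟨l, h, x,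
      y⟩ | ⟨l, x, y⟩
  · refine Or.inl ⟨4 * k - 3, by omega, by omega, ?_⟩
    rcases s3g_cases k i u g (4 * k - 3) with ⟨h', x', y'⟩ | ⟨l', h', x', y'⟩ | ⟨l', h', x', y'⟩ | ⟨l', h', x',
        y'⟩ | ⟨l', h', x', y'⟩ | ⟨l', h', x', y'⟩ | ⟨l', x', y'⟩ <;>
      omega
  · omega
  · omega
  · omega
  · omega
  · omega
  · omega

/-- **`s3g` has `k` visits** (`k − 1` on the initial wall run and the endpoint).
[cite: BeatonBousquetMelouDeGierDuminilCopinGuttmann2014, §3.1 (arXiv v5 p. 8)] [cite: EntingJensen2009, §7.4.2,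
    Fig. 7.10] -/
theorem visits_s3g {k i u g m : ℕ} (hg : g ≤ 1) (hiug : i + u + g + 2 ≤ k) (hm : m = 6 * k
    + 4) : visits m (s3g k i u g) = k := by
  have hY : ∀ t, t ≤ 6 * k + 4 → s3g k i u g t 1 = s3gY k i u g t := fun t ht => (s3g_apply ht).2
  have h1 : visits (0 + (2 * k - 1)) (s3g k i u g) = visits 0 (s3g k i u g) + ((0 + (2 * k - 1)) / 2 - 0 / 2) :=
    visits_add_of_wall fun q _ hq => by
      rw [hY _ (by omega)]
      rcases s3g_cases k i u g (0 + q) with ⟨h', x', y'⟩ | ⟨l', h', x', y'⟩ | ⟨l', h', x', y'⟩ | ⟨l', h', x',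
          y'⟩ | ⟨l', h', x', y'⟩ | ⟨l', h', x', y'⟩ | ⟨l', x', y'⟩ <;> omega
  have h2 : visits (2 * k - 1 + (4 * k + 3)) (s3g k i u g) = visits (2 * k - 1) (s3g k i u g) :=
    visits_add_eq_left fun q hq1 hq2 h => by
      obtain ⟨-, h0⟩ := h
      rw [hY _ (by omega)] at h0
      rcases s3g_cases k i u g (2 * k - 1 + q) with ⟨h', x', y'⟩ | ⟨l', h', x', y'⟩ | ⟨l', h', x', y'⟩ | ⟨l', h', x',
          y'⟩ | ⟨l', h', x', y'⟩ | ⟨l', h', x', y'⟩ | ⟨l', x', y'⟩ <;> omega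
  have h3 : visits (6 * k + 2 + (2)) (s3g k i u g) = visits (6 * k + 2) (s3g k i u g) + ((6 * k + 2
      + (2)) / 2 - (6 * k + 2) / 2) :=
    visits_add_of_wall fun q _ hq => by
      rw [hY _ (by omega)]
      rcases s3g_cases k i u g (6 * k + 2 + q) with ⟨h', x', y'⟩ | ⟨l', h', x', y'⟩ | ⟨l', h', x', y'⟩ | ⟨l', h', x',
          y'⟩ | ⟨l', h', x', y'⟩ | ⟨l', h', x', y'⟩ | ⟨l', x', y'⟩ <;>
        omega
  rw [zero_add, visits_zero, zero_add] at h1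
  rw [show 2 * k - 1 + (4 * k + 3) = 6 * k + 2 by omega, h1] at h2
  rw [show 6 * k + 2 + (2) = 6 * k + 4 by omega, h2] at h3
  subst hm
  rw [h3]
  omega

/-- **`s3g` has three down steps**, at the times `2 * k - 1`, `4 * k - 3`, `4 * k
    + 2 * i - 1`. [cite: EntingJensen2009, §7.4.2, Fig. 7.10] -/
theorem stepsD_s3g {k i u g m : ℕ} (hg : g ≤ 1) (hiug : i + u + g + 2 ≤ k) (hm : m = 6 * k + 4) :
    stepsD m (s3g k i u g) = {2 * k - 1, 4 * k - 3, 4 * k + 2 * i - 1} := by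
  subst hm
  ext t
  simp only [stepsD, mem_filter, mem_range, mem_insert, mem_singleton]
  constructor
  · rintro ⟨ht, hx, hy⟩
    rw [(s3g_apply (t := t + 1) (by omega)).1, (s3g_apply (t := t) (by omega)).1] at hx
    rw [(s3g_apply (t := t + 1) (by omega)).2, (s3g_apply (t := t) (by omega)).2] at hy
    rcases s3g_cases k i u g t with ⟨h, x, y⟩ | ⟨l, h, x, y⟩ | ⟨l, h, x, y⟩ | ⟨l, h, x, y⟩ | ⟨l, h, x, y⟩ | ⟨l, h, x,
        y⟩ | ⟨l, x, y⟩ <;>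
      rcases s3g_cases k i u g (t + 1) with ⟨h', x', y'⟩ | ⟨l', h', x', y'⟩ | ⟨l', h', x', y'⟩ | ⟨l', h', x',
          y'⟩ | ⟨l', h', x', y'⟩ | ⟨l', h', x', y'⟩ | ⟨l', x', y'⟩ <;>
        omega
  · intro ht
    have ht4 : t + 1 ≤ 6 * k + 4 := by omega
    refine ⟨by omega, ?_, ?_⟩
    · rw [(s3g_apply ht4).1, (s3g_apply (t := t) (by omega)).1]
      rcases s3g_cases k i u g t with ⟨h, x, y⟩ | ⟨l, h, x, y⟩ | ⟨l, h, x, y⟩ | ⟨l, h, x, y⟩ | ⟨l, h, x, y⟩ | ⟨l, h,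
          x, y⟩ | ⟨l, x, y⟩ <;>
        rcases s3g_cases k i u g (t + 1) with ⟨h', x', y'⟩ | ⟨l', h', x', y'⟩ | ⟨l', h', x', y'⟩ | ⟨l', h', x',
            y'⟩ | ⟨l', h', x', y'⟩ | ⟨l', h', x', y'⟩ | ⟨l', x', y'⟩ <;>
          omega
    · rw [(s3g_apply ht4).2, (s3g_apply (t := t) (by omega)).2]
      rcases s3g_cases k i u g t with ⟨h, x, y⟩ | ⟨l, h, x, y⟩ | ⟨l, h, x, y⟩ | ⟨l, h, x, y⟩ | ⟨l, h, x, y⟩ | ⟨l, h,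
          x, y⟩ | ⟨l, x, y⟩ <;>
        rcases s3g_cases k i u g (t + 1) with ⟨h', x', y'⟩ | ⟨l', h', x', y'⟩ | ⟨l', h', x', y'⟩ | ⟨l', h', x',
            y'⟩ | ⟨l', h', x', y'⟩ | ⟨l', h', x', y'⟩ | ⟨l', x', y'⟩ <;>
          omega

/-- **`s3g` has three up steps**, at the times `6 * k - 2 * u - 2 * g - 2`, `6 * k - 2 * g`, `6 * k
    + 2`. [cite: EntingJensen2009, §7.4.2, Fig. 7.10] -/
theorem stepsU_s3g {k i u g m : ℕ} (hg : g ≤ 1) (hiug : i + u + g + 2 ≤ k) (hm : m = 6 * k + 4) :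
    stepsU m (s3g k i u g) = {6 * k - 2 * u - 2 * g - 2, 6 * k - 2 * g, 6 * k + 2} := by
  subst hm
  ext t
  simp only [stepsU, mem_filter, mem_range, mem_insert, mem_singleton]
  constructor
  · rintro ⟨ht, hx, hy⟩
    rw [(s3g_apply (t := t + 1) (by omega)).1, (s3g_apply (t := t) (by omega)).1] at hx
    rw [(s3g_apply (t := t + 1) (by omega)).2, (s3g_apply (t := t) (by omega)).2] at hy
    rcases s3g_cases k i u g t with ⟨h, x, y⟩ | ⟨l, h, x, y⟩ | ⟨l, h, x, y⟩ | ⟨l, h, x, y⟩ | ⟨l, h, x, y⟩ | ⟨l, h, x,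
        y⟩ | ⟨l, x, y⟩ <;>
      rcases s3g_cases k i u g (t + 1) with ⟨h', x', y'⟩ | ⟨l', h', x', y'⟩ | ⟨l', h', x', y'⟩ | ⟨l', h', x',
          y'⟩ | ⟨l', h', x', y'⟩ | ⟨l', h', x', y'⟩ | ⟨l', x', y'⟩ <;>
        omega
  · intro ht
    have ht4 : t + 1 ≤ 6 * k + 4 := by omega
    refine ⟨by omega, ?_, ?_⟩
    · rw [(s3g_apply ht4).1, (s3g_apply (t := t) (by omega)).1]
      rcases s3g_cases k i u g t with ⟨h, x, y⟩ | ⟨l, h, x, y⟩ | ⟨l, h, x, y⟩ | ⟨l, h, x, y⟩ | ⟨l, h, x, y⟩ | ⟨l, h,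
          x, y⟩ | ⟨l, x, y⟩ <;>
        rcases s3g_cases k i u g (t + 1) with ⟨h', x', y'⟩ | ⟨l', h', x', y'⟩ | ⟨l', h', x', y'⟩ | ⟨l', h', x',
            y'⟩ | ⟨l', h', x', y'⟩ | ⟨l', h', x', y'⟩ | ⟨l', x', y'⟩ <;>
          omega
    · rw [(s3g_apply ht4).2, (s3g_apply (t := t) (by omega)).2]
      rcases s3g_cases k i u g t with ⟨h, x, y⟩ | ⟨l, h, x, y⟩ | ⟨l, h, x, y⟩ | ⟨l, h, x, y⟩ | ⟨l, h, x, y⟩ | ⟨l, h,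
          x, y⟩ | ⟨l, x, y⟩ <;>
        rcases s3g_cases k i u g (t + 1) with ⟨h', x', y'⟩ | ⟨l', h', x', y'⟩ | ⟨l', h', x', y'⟩ | ⟨l', h', x',
            y'⟩ | ⟨l', h', x', y'⟩ | ⟨l', h', x', y'⟩ | ⟨l', x', y'⟩ <;>
          omega

/-- The column of `s3g` at the end of its piece `2` (time `4 * k + 2 * i - 1`). [cite: EntingJensen2009, §7.4.2,
    Fig. 7.10] -/
theorem s3g_xend2 {k i u g t : ℕ} (_ : g ≤ 1) (_ : i + u + g + 2 ≤ k) (ht : t = 4 * k + 2 * i - 1) : s3gX k i u g t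
    = 2 * (i : ℤ) + 3 := by
  subst ht
  simp only [s3gX]
  split_ifs <;> omega

/-- The column of `s3g` at the end of its piece `4` (time `6 * k - 2 * g`). [cite: EntingJensen2009, §7.4.2,
    Fig. 7.10] -/
theorem s3g_xend4 {k i u g t : ℕ} (_ : g ≤ 1) (_ : i + u + g + 2 ≤ k) (ht : t = 6 * k - 2 * g) : s3gX k i u g t
    = 2 * (k : ℤ) - 2 * g + 2 := by
  subst ht
  simp only [s3gX]
  split_ifs <;> omega

/-- The column of `s3g` at the end of its piece `5` (time `6 * k + 2`). [cite: EntingJensen2009, §7.4.2, Fig. 7.10] -/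
theorem s3g_xend5 {k i u g t : ℕ} (_ : g ≤ 1) (_ : i + u + g + 2 ≤ k) (ht : t = 6 * k + 2) : s3gX k i u g t
    = 2 * (k : ℤ) + 3 := by
  subst ht
  simp only [s3gX]
  split_ifs <;> omega

/-! ### §8  Separation: two blocks of these families with the same walk have the same family and parameters -/

/-- **Injectivity of the A2 parametrisation.** [cite: EntingJensen2009, §7.4.2, Fig. 7.10] -/
theorem s3a_inj {k i u i' u' : ℕ} (hiu : i + u + 2 ≤ k) (hiu' : i' + u' + 2 ≤ k)
    (h : s3a k i u = s3a k i' u') : i = i' ∧ u = u' := by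
  have hD := stepsD_s3a (m := 6 * k + 4) hiu rfl
  rw [h, stepsD_s3a hiu' rfl] at hD
  obtain ⟨e1, e2, e3⟩ := triple_eq_of_lt hD (by omega) (by omega) (by omega) (by omega)
  have hU := stepsU_s3a (m := 6 * k + 4) hiu rfl
  rw [h, stepsU_s3a hiu' rfl] at hU
  obtain ⟨e4, e5, e6⟩ := triple_eq_of_lt hU (by omega) (by omega) (by omega) (by omega)
  refine ⟨?_, ?_⟩ <;> omega

/-- **An A2 block is never an A3 block.** [cite: EntingJensen2009, §7.4.2, Fig. 7.10] -/
theorem s3a_ne_s3b {k i u a' i' u' : ℕ} (hiu : i + u + 2 ≤ k) (hia' : i' + 1 ≤ a') (hau' : a' + u' + 2 ≤ k) :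
    s3a k i u ≠ s3b k a' i' u' := by
  intro h
  have hD := stepsD_s3a (m := 6 * k + 4) hiu rfl
  rw [h, stepsD_s3b hia' hau' rfl] at hD
  obtain ⟨e1, e2, e3⟩ := triple_eq_of_lt hD (by omega) (by omega) (by omega) (by omega)
  omega

/-- **An A2 block is never an A4 block.** [cite: EntingJensen2009, §7.4.2, Fig. 7.10] -/
theorem s3a_ne_s3c {k i u i' u' : ℕ} (hiu : i + u + 2 ≤ k) (hui' : u' ≤ i') (hik' : i' + 2 ≤ k) :
    s3a k i u ≠ s3c k i' u' := by
  intro h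
  have hD := stepsD_s3a (m := 6 * k + 4) hiu rfl
  rw [h, stepsD_s3c hui' hik' rfl] at hD
  obtain ⟨e1, e2, e3⟩ := triple_eq_of_lt hD (by omega) (by omega) (by omega) (by omega)
  omega

/-- **An A2 block is never an A5 block.** [cite: EntingJensen2009, §7.4.2, Fig. 7.10] -/
theorem s3a_ne_s3d {k i u a' i' : ℕ} (hiu : i + u + 2 ≤ k) (hia' : i' + 1 ≤ a') (hak' : a' + 1 ≤ k) (hik' : i' + 2
    ≤ k) :
    s3a k i u ≠ s3d k a' i' := by
  intro h
  have hD := stepsD_s3a (m := 6 * k + 4) hiu rfl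
  rw [h, stepsD_s3d hia' hak' hik' rfl] at hD
  obtain ⟨e1, e2, e3⟩ := triple_eq_of_lt hD (by omega) (by omega) (by omega) (by omega)
  omega

/-- **An A2 block is never an A6 block.** [cite: EntingJensen2009, §7.4.2, Fig. 7.10] -/
theorem s3a_ne_s3e {k i u a' i' u' : ℕ} (hiu : i + u + 2 ≤ k) (ha' : 1 ≤ a') (hak' : a' + 1 ≤ k) (hiu' : i' + u'
    + 2 ≤ k) :
    s3a k i u ≠ s3e k a' i' u' := by
  intro h
  have hD := stepsD_s3a (m := 6 * k + 4) hiu rfl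
  rw [h, stepsD_s3e ha' hak' hiu' rfl] at hD
  obtain ⟨e1, e2, e3⟩ := triple_eq_of_lt hD (by omega) (by omega) (by omega) (by omega)
  omega

/-- **An A2 block is never a B2 block.** [cite: EntingJensen2009, §7.4.2, Fig. 7.10] -/
theorem s3a_ne_s3f {k i u a' i' u' : ℕ} (hiu : i + u + 2 ≤ k) (ha' : 1 ≤ a') (hau' : a' + u' + 2 ≤ k) (hiu' : i'
    + u' + 1 ≤ k) :
    s3a k i u ≠ s3f k a' i' u' := by
  intro h
  have hD := stepsD_s3a (m := 6 * k + 4) hiu rfl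
  rw [h, stepsD_s3f ha' hau' hiu' rfl] at hD
  obtain ⟨e1, e2, e3⟩ := triple_eq_of_lt hD (by omega) (by omega) (by omega) (by omega)
  omega

/-- **An A2 block is never a B3 block.** [cite: EntingJensen2009, §7.4.2, Fig. 7.10] -/
theorem s3a_ne_s3g {k i u i' u' g' : ℕ} (hiu : i + u + 2 ≤ k) (hg' : g' ≤ 1) (hiug' : i' + u' + g' + 2 ≤ k) :
    s3a k i u ≠ s3g k i' u' g' := by
  intro h
  have hD := stepsD_s3a (m := 6 * k + 4) hiu rfl
  rw [h, stepsD_s3g hg' hiug' rfl] at hD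
  obtain ⟨e1, e2, e3⟩ := triple_eq_of_lt hD (by omega) (by omega) (by omega) (by omega)
  omega

/-- **Injectivity of the A3 parametrisation.** [cite: EntingJensen2009, §7.4.2, Fig. 7.10] -/
theorem s3b_inj {k a i u a' i' u' : ℕ} (hia : i + 1 ≤ a) (hau : a + u + 2 ≤ k) (hia' : i' + 1 ≤ a') (hau' : a' + u'
    + 2 ≤ k)
    (h : s3b k a i u = s3b k a' i' u') : a = a' ∧ i = i' ∧ u = u' := by
  have hD := stepsD_s3b (m := 6 * k + 4) hia hau rfl
  rw [h, stepsD_s3b hia' hau' rfl] at hD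
  obtain ⟨e1, e2, e3⟩ := triple_eq_of_lt hD (by omega) (by omega) (by omega) (by omega)
  have hU := stepsU_s3b (m := 6 * k + 4) hia hau rfl
  rw [h, stepsU_s3b hia' hau' rfl] at hU
  obtain ⟨e4, e5, e6⟩ := triple_eq_of_lt hU (by omega) (by omega) (by omega) (by omega)
  refine ⟨?_, ?_, ?_⟩ <;> omega

/-- **An A3 block is never an A4 block.** [cite: EntingJensen2009, §7.4.2, Fig. 7.10] -/
theorem s3b_ne_s3c {k a i u i' u' : ℕ} (hia : i + 1 ≤ a) (hau : a + u + 2 ≤ k) (hui' : u' ≤ i') (hik' : i' + 2 ≤ k) :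
    s3b k a i u ≠ s3c k i' u' := by
  intro h
  have hD := stepsD_s3b (m := 6 * k + 4) hia hau rfl
  rw [h, stepsD_s3c hui' hik' rfl] at hD
  obtain ⟨e1, e2, e3⟩ := triple_eq_of_lt hD (by omega) (by omega) (by omega) (by omega)
  omega

/-- **An A3 block is never an A5 block.** [cite: EntingJensen2009, §7.4.2, Fig. 7.10] -/
theorem s3b_ne_s3d {k a i u a' i' : ℕ} (hia : i + 1 ≤ a) (hau : a + u + 2 ≤ k) (hia' : i' + 1 ≤ a') (hak' : a' + 1
    ≤ k) (hik' : i' + 2 ≤ k) :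
    s3b k a i u ≠ s3d k a' i' := by
  intro h
  have hD := stepsD_s3b (m := 6 * k + 4) hia hau rfl
  rw [h, stepsD_s3d hia' hak' hik' rfl] at hD
  obtain ⟨e1, e2, e3⟩ := triple_eq_of_lt hD (by omega) (by omega) (by omega) (by omega)
  have hU := stepsU_s3b (m := 6 * k + 4) hia hau rfl
  rw [h, stepsU_s3d hia' hak' hik' rfl] at hU
  obtain ⟨e4, e5, e6⟩ := triple_eq_of_lt hU (by omega) (by omega) (by omega) (by omega)
  omega

/-- **An A3 block is never an A6 block.** [cite: EntingJensen2009, §7.4.2, Fig. 7.10] -/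
theorem s3b_ne_s3e {k a i u a' i' u' : ℕ} (hia : i + 1 ≤ a) (hau : a + u + 2 ≤ k) (ha' : 1 ≤ a') (hak' : a' + 1
    ≤ k) (hiu' : i' + u' + 2 ≤ k) :
    s3b k a i u ≠ s3e k a' i' u' := by
  intro h
  have hD := stepsD_s3b (m := 6 * k + 4) hia hau rfl
  rw [h, stepsD_s3e ha' hak' hiu' rfl] at hD
  obtain ⟨e1, e2, e3⟩ := triple_eq_of_lt hD (by omega) (by omega) (by omega) (by omega)
  have hU := stepsU_s3b (m := 6 * k + 4) hia hau rfl
  rw [h, stepsU_s3e ha' hak' hiu' rfl] at hU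
  obtain ⟨e4, e5, e6⟩ := triple_eq_of_lt hU (by omega) (by omega) (by omega) (by omega)
  omega

/-- **An A3 block is never a B2 block.** [cite: EntingJensen2009, §7.4.2, Fig. 7.10] -/
theorem s3b_ne_s3f {k a i u a' i' u' : ℕ} (hia : i + 1 ≤ a) (hau : a + u + 2 ≤ k) (ha' : 1 ≤ a') (hau' : a' + u'
    + 2 ≤ k) (hiu' : i' + u' + 1 ≤ k) :
    s3b k a i u ≠ s3f k a' i' u' := by
  intro h
  have hD := stepsD_s3b (m := 6 * k + 4) hia hau rfl
  rw [h, stepsD_s3f ha' hau' hiu' rfl] at hD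
  obtain ⟨e1, e2, e3⟩ := triple_eq_of_lt hD (by omega) (by omega) (by omega) (by omega)
  have hU := stepsU_s3b (m := 6 * k + 4) hia hau rfl
  rw [h, stepsU_s3f ha' hau' hiu' rfl] at hU
  obtain ⟨e4, e5, e6⟩ := triple_eq_of_lt hU (by omega) (by omega) (by omega) (by omega)
  have hc2 : s3b k a i u (4 * a + 3) 0 = s3f k a' i' u' (4 * a + 3) 0 := by rw [h]
  rw [(s3b_apply (t := 4 * a + 3) (by omega)).1, (s3f_apply (t := 4 * a + 3) (by omega)).1,
    s3b_xend2 hia hau rfl, s3f_xend2 ha' hau' hiu' (by omega)] at hc2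
  omega

/-- **An A3 block is never a B3 block.** [cite: EntingJensen2009, §7.4.2, Fig. 7.10] -/
theorem s3b_ne_s3g {k a i u i' u' g' : ℕ} (hia : i + 1 ≤ a) (hau : a + u + 2 ≤ k) (hg' : g' ≤ 1) (hiug' : i' + u'
    + g' + 2 ≤ k) :
    s3b k a i u ≠ s3g k i' u' g' := by
  intro h
  have hD := stepsD_s3b (m := 6 * k + 4) hia hau rfl
  rw [h, stepsD_s3g hg' hiug' rfl] at hD
  obtain ⟨e1, e2, e3⟩ := triple_eq_of_lt hD (by omega) (by omega) (by omega) (by omega)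
  omega

/-- **Injectivity of the A4 parametrisation.** [cite: EntingJensen2009, §7.4.2, Fig. 7.10] -/
theorem s3c_inj {k i u i' u' : ℕ} (hui : u ≤ i) (hik : i + 2 ≤ k) (hui' : u' ≤ i') (hik' : i' + 2 ≤ k)
    (h : s3c k i u = s3c k i' u') : i = i' ∧ u = u' := by
  have hD := stepsD_s3c (m := 6 * k + 4) hui hik rfl
  rw [h, stepsD_s3c hui' hik' rfl] at hD
  obtain ⟨e1, e2, e3⟩ := triple_eq_of_lt hD (by omega) (by omega) (by omega) (by omega)
  have hU := stepsU_s3c (m := 6 * k + 4) hui hik rfl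
  rw [h, stepsU_s3c hui' hik' rfl] at hU
  obtain ⟨e4, e5, e6⟩ := triple_eq_of_lt hU (by omega) (by omega) (by omega) (by omega)
  refine ⟨?_, ?_⟩ <;> omega

/-- **An A4 block is never an A5 block.** [cite: EntingJensen2009, §7.4.2, Fig. 7.10] -/
theorem s3c_ne_s3d {k i u a' i' : ℕ} (hui : u ≤ i) (hik : i + 2 ≤ k) (hia' : i' + 1 ≤ a') (hak' : a' + 1
    ≤ k) (hik' : i' + 2 ≤ k) :
    s3c k i u ≠ s3d k a' i' := by
  intro h
  have hD := stepsD_s3c (m := 6 * k + 4) hui hik rfl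
  rw [h, stepsD_s3d hia' hak' hik' rfl] at hD
  obtain ⟨e1, e2, e3⟩ := triple_eq_of_lt hD (by omega) (by omega) (by omega) (by omega)
  have hU := stepsU_s3c (m := 6 * k + 4) hui hik rfl
  rw [h, stepsU_s3d hia' hak' hik' rfl] at hU
  obtain ⟨e4, e5, e6⟩ := triple_eq_of_lt hU (by omega) (by omega) (by omega) (by omega)
  have hc2 : s3c k i u (4 * k - 1) 0 = s3d k a' i' (4 * k - 1) 0 := by rw [h]
  rw [(s3c_apply (t := 4 * k - 1) (by omega)).1, (s3d_apply (t := 4 * k - 1) (by omega)).1,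
    s3c_xend2 hui hik rfl, s3d_xend2 hia' hak' hik' (by omega)] at hc2
  omega

/-- **An A4 block is never an A6 block.** [cite: EntingJensen2009, §7.4.2, Fig. 7.10] -/
theorem s3c_ne_s3e {k i u a' i' u' : ℕ} (hui : u ≤ i) (hik : i + 2 ≤ k) (ha' : 1 ≤ a') (hak' : a' + 1
    ≤ k) (hiu' : i' + u' + 2 ≤ k) :
    s3c k i u ≠ s3e k a' i' u' := by
  intro h
  have hD := stepsD_s3c (m := 6 * k + 4) hui hik rfl
  rw [h, stepsD_s3e ha' hak' hiu' rfl] at hD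
  obtain ⟨e1, e2, e3⟩ := triple_eq_of_lt hD (by omega) (by omega) (by omega) (by omega)
  have hU := stepsU_s3c (m := 6 * k + 4) hui hik rfl
  rw [h, stepsU_s3e ha' hak' hiu' rfl] at hU
  obtain ⟨e4, e5, e6⟩ := triple_eq_of_lt hU (by omega) (by omega) (by omega) (by omega)
  have hc2 : s3c k i u (4 * k - 1) 0 = s3e k a' i' u' (4 * k - 1) 0 := by rw [h]
  rw [(s3c_apply (t := 4 * k - 1) (by omega)).1, (s3e_apply (t := 4 * k - 1) (by omega)).1,
    s3c_xend2 hui hik rfl, s3e_xend2 ha' hak' hiu' (by omega)] at hc2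
  omega

/-- **An A4 block is never a B2 block.** [cite: EntingJensen2009, §7.4.2, Fig. 7.10] -/
theorem s3c_ne_s3f {k i u a' i' u' : ℕ} (hui : u ≤ i) (hik : i + 2 ≤ k) (ha' : 1 ≤ a') (hau' : a' + u' + 2
    ≤ k) (hiu' : i' + u' + 1 ≤ k) :
    s3c k i u ≠ s3f k a' i' u' := by
  intro h
  have hD := stepsD_s3c (m := 6 * k + 4) hui hik rfl
  rw [h, stepsD_s3f ha' hau' hiu' rfl] at hD
  obtain ⟨e1, e2, e3⟩ := triple_eq_of_lt hD (by omega) (by omega) (by omega) (by omega)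
  omega

/-- **An A4 block is never a B3 block.** [cite: EntingJensen2009, §7.4.2, Fig. 7.10] -/
theorem s3c_ne_s3g {k i u i' u' g' : ℕ} (hui : u ≤ i) (hik : i + 2 ≤ k) (hg' : g' ≤ 1) (hiug' : i' + u' + g' + 2 ≤ k) :
    s3c k i u ≠ s3g k i' u' g' := by
  intro h
  have hD := stepsD_s3c (m := 6 * k + 4) hui hik rfl
  rw [h, stepsD_s3g hg' hiug' rfl] at hD
  obtain ⟨e1, e2, e3⟩ := triple_eq_of_lt hD (by omega) (by omega) (by omega) (by omega)
  have hU := stepsU_s3c (m := 6 * k + 4) hui hik rfl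
  rw [h, stepsU_s3g hg' hiug' rfl] at hU
  obtain ⟨e4, e5, e6⟩ := triple_eq_of_lt hU (by omega) (by omega) (by omega) (by omega)
  have hc2 : s3c k i u (4 * k - 1) 0 = s3g k i' u' g' (4 * k - 1) 0 := by rw [h]
  rw [(s3c_apply (t := 4 * k - 1) (by omega)).1, (s3g_apply (t := 4 * k - 1) (by omega)).1,
    s3c_xend2 hui hik rfl, s3g_xend2 hg' hiug' (by omega)] at hc2
  omega

/-- **Injectivity of the A5 parametrisation.** [cite: EntingJensen2009, §7.4.2, Fig. 7.10] -/
theorem s3d_inj {k a i a' i' : ℕ} (hia : i + 1 ≤ a) (hak : a + 1 ≤ k) (hik : i + 2 ≤ k) (hia' : i' + 1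
    ≤ a') (hak' : a' + 1 ≤ k) (hik' : i' + 2 ≤ k)
    (h : s3d k a i = s3d k a' i') : a = a' ∧ i = i' := by
  have hD := stepsD_s3d (m := 6 * k + 4) hia hak hik rfl
  rw [h, stepsD_s3d hia' hak' hik' rfl] at hD
  obtain ⟨e1, e2, e3⟩ := triple_eq_of_lt hD (by omega) (by omega) (by omega) (by omega)
  refine ⟨?_, ?_⟩ <;> omega

/-- **An A5 block is never an A6 block.** [cite: EntingJensen2009, §7.4.2, Fig. 7.10] -/
theorem s3d_ne_s3e {k a i a' i' u' : ℕ} (hia : i + 1 ≤ a) (hak : a + 1 ≤ k) (hik : i + 2 ≤ k) (ha' : 1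
    ≤ a') (hak' : a' + 1 ≤ k) (hiu' : i' + u' + 2 ≤ k) :
    s3d k a i ≠ s3e k a' i' u' := by
  intro h
  have hD := stepsD_s3d (m := 6 * k + 4) hia hak hik rfl
  rw [h, stepsD_s3e ha' hak' hiu' rfl] at hD
  obtain ⟨e1, e2, e3⟩ := triple_eq_of_lt hD (by omega) (by omega) (by omega) (by omega)
  have hU := stepsU_s3d (m := 6 * k + 4) hia hak hik rfl
  rw [h, stepsU_s3e ha' hak' hiu' rfl] at hU
  obtain ⟨e4, e5, e6⟩ := triple_eq_of_lt hU (by omega) (by omega) (by omega) (by omega)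
  have hc4 : s3d k a i (4 * k + 2 * a + 2) 0 = s3e k a' i' u' (4 * k + 2 * a + 2) 0 := by rw [h]
  rw [(s3d_apply (t := 4 * k + 2 * a + 2) (by omega)).1, (s3e_apply (t := 4 * k + 2 * a + 2) (by omega)).1,
    s3d_xend4 hia hak hik rfl, s3e_xend4 ha' hak' hiu' (by omega)] at hc4
  omega

/-- **An A5 block is never a B2 block.** [cite: EntingJensen2009, §7.4.2, Fig. 7.10] -/
theorem s3d_ne_s3f {k a i a' i' u' : ℕ} (hia : i + 1 ≤ a) (hak : a + 1 ≤ k) (hik : i + 2 ≤ k) (ha' : 1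
    ≤ a') (hau' : a' + u' + 2 ≤ k) (hiu' : i' + u' + 1 ≤ k) :
    s3d k a i ≠ s3f k a' i' u' := by
  intro h
  have hD := stepsD_s3d (m := 6 * k + 4) hia hak hik rfl
  rw [h, stepsD_s3f ha' hau' hiu' rfl] at hD
  obtain ⟨e1, e2, e3⟩ := triple_eq_of_lt hD (by omega) (by omega) (by omega) (by omega)
  have hU := stepsU_s3d (m := 6 * k + 4) hia hak hik rfl
  rw [h, stepsU_s3f ha' hau' hiu' rfl] at hU
  obtain ⟨e4, e5, e6⟩ := triple_eq_of_lt hU (by omega) (by omega) (by omega) (by omega)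
  omega

/-- **An A5 block is never a B3 block.** [cite: EntingJensen2009, §7.4.2, Fig. 7.10] -/
theorem s3d_ne_s3g {k a i i' u' g' : ℕ} (hia : i + 1 ≤ a) (hak : a + 1 ≤ k) (hik : i + 2 ≤ k) (hg' : g'
    ≤ 1) (hiug' : i' + u' + g' + 2 ≤ k) :
    s3d k a i ≠ s3g k i' u' g' := by
  intro h
  have hD := stepsD_s3d (m := 6 * k + 4) hia hak hik rfl
  rw [h, stepsD_s3g hg' hiug' rfl] at hD
  obtain ⟨e1, e2, e3⟩ := triple_eq_of_lt hD (by omega) (by omega) (by omega) (by omega)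
  have hU := stepsU_s3d (m := 6 * k + 4) hia hak hik rfl
  rw [h, stepsU_s3g hg' hiug' rfl] at hU
  obtain ⟨e4, e5, e6⟩ := triple_eq_of_lt hU (by omega) (by omega) (by omega) (by omega)
  have hc4 : s3d k a i (4 * k + 2 * a + 2) 0 = s3g k i' u' g' (4 * k + 2 * a + 2) 0 := by rw [h]
  rw [(s3d_apply (t := 4 * k + 2 * a + 2) (by omega)).1, (s3g_apply (t := 4 * k + 2 * a + 2) (by omega)).1,
    s3d_xend4 hia hak hik rfl, s3g_xend4 hg' hiug' (by omega)] at hc4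
  omega

/-- **Injectivity of the A6 parametrisation.** [cite: EntingJensen2009, §7.4.2, Fig. 7.10] -/
theorem s3e_inj {k a i u a' i' u' : ℕ} (ha : 1 ≤ a) (hak : a + 1 ≤ k) (hiu : i + u + 2 ≤ k) (ha' : 1
    ≤ a') (hak' : a' + 1 ≤ k) (hiu' : i' + u' + 2 ≤ k)
    (h : s3e k a i u = s3e k a' i' u') : a = a' ∧ i = i' ∧ u = u' := by
  have hD := stepsD_s3e (m := 6 * k + 4) ha hak hiu rfl
  rw [h, stepsD_s3e ha' hak' hiu' rfl] at hD
  obtain ⟨e1, e2, e3⟩ := triple_eq_of_lt hD (by omega) (by omega) (by omega) (by omega)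
  have hU := stepsU_s3e (m := 6 * k + 4) ha hak hiu rfl
  rw [h, stepsU_s3e ha' hak' hiu' rfl] at hU
  obtain ⟨e4, e5, e6⟩ := triple_eq_of_lt hU (by omega) (by omega) (by omega) (by omega)
  refine ⟨?_, ?_, ?_⟩ <;> omega

/-- **An A6 block is never a B2 block.** [cite: EntingJensen2009, §7.4.2, Fig. 7.10] -/
theorem s3e_ne_s3f {k a i u a' i' u' : ℕ} (ha : 1 ≤ a) (hak : a + 1 ≤ k) (hiu : i + u + 2 ≤ k) (ha' : 1
    ≤ a') (hau' : a' + u' + 2 ≤ k) (hiu' : i' + u' + 1 ≤ k) :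
    s3e k a i u ≠ s3f k a' i' u' := by
  intro h
  have hD := stepsD_s3e (m := 6 * k + 4) ha hak hiu rfl
  rw [h, stepsD_s3f ha' hau' hiu' rfl] at hD
  obtain ⟨e1, e2, e3⟩ := triple_eq_of_lt hD (by omega) (by omega) (by omega) (by omega)
  have hU := stepsU_s3e (m := 6 * k + 4) ha hak hiu rfl
  rw [h, stepsU_s3f ha' hau' hiu' rfl] at hU
  obtain ⟨e4, e5, e6⟩ := triple_eq_of_lt hU (by omega) (by omega) (by omega) (by omega)
  omega

/-- **An A6 block is never a B3 block.** [cite: EntingJensen2009, §7.4.2, Fig. 7.10] -/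
theorem s3e_ne_s3g {k a i u i' u' g' : ℕ} (ha : 1 ≤ a) (hak : a + 1 ≤ k) (hiu : i + u + 2 ≤ k) (hg' : g'
    ≤ 1) (hiug' : i' + u' + g' + 2 ≤ k) :
    s3e k a i u ≠ s3g k i' u' g' := by
  intro h
  have hD := stepsD_s3e (m := 6 * k + 4) ha hak hiu rfl
  rw [h, stepsD_s3g hg' hiug' rfl] at hD
  obtain ⟨e1, e2, e3⟩ := triple_eq_of_lt hD (by omega) (by omega) (by omega) (by omega)
  have hU := stepsU_s3e (m := 6 * k + 4) ha hak hiu rfl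
  rw [h, stepsU_s3g hg' hiug' rfl] at hU
  obtain ⟨e4, e5, e6⟩ := triple_eq_of_lt hU (by omega) (by omega) (by omega) (by omega)
  have hc5 : s3e k a i u (4 * k + 2 * a + 4) 0 = s3g k i' u' g' (4 * k + 2 * a + 4) 0 := by rw [h]
  rw [(s3e_apply (t := 4 * k + 2 * a + 4) (by omega)).1, (s3g_apply (t := 4 * k + 2 * a + 4) (by omega)).1,
    s3e_xend5 ha hak hiu rfl, s3g_xend5 hg' hiug' (by omega)] at hc5
  omega

/-- **Injectivity of the B2 parametrisation.** [cite: EntingJensen2009, §7.4.2, Fig. 7.10] -/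
theorem s3f_inj {k a i u a' i' u' : ℕ} (ha : 1 ≤ a) (hau : a + u + 2 ≤ k) (hiu : i + u + 1 ≤ k) (ha' : 1
    ≤ a') (hau' : a' + u' + 2 ≤ k) (hiu' : i' + u' + 1 ≤ k)
    (h : s3f k a i u = s3f k a' i' u') : a = a' ∧ i = i' ∧ u = u' := by
  have hD := stepsD_s3f (m := 6 * k + 4) ha hau hiu rfl
  rw [h, stepsD_s3f ha' hau' hiu' rfl] at hD
  obtain ⟨e1, e2, e3⟩ := triple_eq_of_lt hD (by omega) (by omega) (by omega) (by omega)
  have hU := stepsU_s3f (m := 6 * k + 4) ha hau hiu rfl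
  rw [h, stepsU_s3f ha' hau' hiu' rfl] at hU
  obtain ⟨e4, e5, e6⟩ := triple_eq_of_lt hU (by omega) (by omega) (by omega) (by omega)
  refine ⟨?_, ?_, ?_⟩ <;> omega

/-- **An B2 block is never a B3 block.** [cite: EntingJensen2009, §7.4.2, Fig. 7.10] -/
theorem s3f_ne_s3g {k a i u i' u' g' : ℕ} (ha : 1 ≤ a) (hau : a + u + 2 ≤ k) (hiu : i + u + 1 ≤ k) (hg' : g'
    ≤ 1) (hiug' : i' + u' + g' + 2 ≤ k) :
    s3f k a i u ≠ s3g k i' u' g' := by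
  intro h
  have hD := stepsD_s3f (m := 6 * k + 4) ha hau hiu rfl
  rw [h, stepsD_s3g hg' hiug' rfl] at hD
  obtain ⟨e1, e2, e3⟩ := triple_eq_of_lt hD (by omega) (by omega) (by omega) (by omega)
  omega

/-- **Injectivity of the B3 parametrisation.** [cite: EntingJensen2009, §7.4.2, Fig. 7.10] -/
theorem s3g_inj {k i u g i' u' g' : ℕ} (hg : g ≤ 1) (hiug : i + u + g + 2 ≤ k) (hg' : g' ≤ 1) (hiug' : i' + u' + g'
    + 2 ≤ k)
    (h : s3g k i u g = s3g k i' u' g') : i = i' ∧ u = u' ∧ g = g' := by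
  have hD := stepsD_s3g (m := 6 * k + 4) hg hiug rfl
  rw [h, stepsD_s3g hg' hiug' rfl] at hD
  obtain ⟨e1, e2, e3⟩ := triple_eq_of_lt hD (by omega) (by omega) (by omega) (by omega)
  have hU := stepsU_s3g (m := 6 * k + 4) hg hiug rfl
  rw [h, stepsU_s3g hg' hiug' rfl] at hU
  obtain ⟨e4, e5, e6⟩ := triple_eq_of_lt hU (by omega) (by omega) (by omega) (by omega)
  refine ⟨?_, ?_, ?_⟩ <;> omega

/-! ### §9  Index simplices: the triangle, the tetrahedron and the double triangle, with their cardinalities -/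

/-- The triangle `{(v, u) : v + u < n}` (as pairs below `n`; index set of the block families, counting plumbing).
[cite: EntingJensen2009, §7.4.2, Fig. 7.10] -/
def triIdx (n : ℕ) : Finset (ℕ × ℕ) := ((range n) ×ˢ (range n)).filter fun p => p.1 + p.2 < n

/-- The tetrahedron `{(v, i, u) : v + i + u < n}` (index set of the A3 blocks, counting plumbing).
[cite: EntingJensen2009, §7.4.2, Fig. 7.10] -/
def tetIdx (n : ℕ) : Finset (ℕ × ℕ × ℕ) :=
  ((range n) ×ˢ ((range n) ×ˢ (range n))).filter fun p => p.1 + p.2.1 + p.2.2 < n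

/-- The double triangle `{(v, i, u) : v + u < n, i + u < n}` (index set of the B2 blocks, counting plumbing).
[cite: EntingJensen2009, §7.4.2, Fig. 7.10] -/
def dtrIdx (n : ℕ) : Finset (ℕ × ℕ × ℕ) :=
  ((range n) ×ˢ ((range n) ×ˢ (range n))).filter fun p => p.1 + p.2.2 < n ∧ p.2.1 + p.2.2 < n

/-- Membership in the triangle. [folklore] -/
private theorem mem_triIdx {n : ℕ} {p : ℕ × ℕ} : p ∈ triIdx n ↔ p.1 + p.2 < n := by
  simp only [triIdx, mem_filter, mem_product, mem_range]
  omega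

/-- Membership in the tetrahedron. [folklore] -/
private theorem mem_tetIdx {n : ℕ} {p : ℕ × ℕ × ℕ} : p ∈ tetIdx n ↔ p.1 + p.2.1 + p.2.2 < n := by
  simp only [tetIdx, mem_filter, mem_product, mem_range]
  omega

/-- Membership in the double triangle. [folklore] -/
private theorem mem_dtrIdx {n : ℕ} {p : ℕ × ℕ × ℕ} : p ∈ dtrIdx n ↔ p.1 + p.2.2 < n ∧ p.2.1 + p.2.2 < n := by
  simp only [dtrIdx, mem_filter, mem_product, mem_range]
  omega

/-- The triangle of size `n + 1` is the shifted triangle of size `n` plus its bottom row. [folklore] -/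
private theorem triIdx_succ (n : ℕ) :
    triIdx (n + 1) = (triIdx n).image (fun p => (p.1, p.2 + 1)) ∪ (range (n + 1)).image (fun v => (v, 0)) := by
  ext p
  rw [mem_union, mem_image, mem_image, mem_triIdx]
  constructor
  · intro h
    by_cases hu : p.2 = 0
    · exact Or.inr ⟨p.1, mem_range.2 (by omega), Prod.ext rfl hu.symm⟩
    · refine Or.inl ⟨(p.1, p.2 - 1), mem_triIdx.2 (by simp only; omega), Prod.ext rfl ?_⟩
      simp only
      omega
  · rintro (⟨q, hq, rfl⟩ | ⟨a, ha, rfl⟩)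
    · have := mem_triIdx.1 hq
      simp only
      omega
    · have := mem_range.1 ha
      simp only
      omega

/-- `#triIdx (n + 1) = #triIdx n + (n + 1)`. [folklore] -/
private theorem card_triIdx_succ (n : ℕ) : #(triIdx (n + 1)) = #(triIdx n) + (n + 1) := by
  have hd : Disjoint ((triIdx n).image (fun p => (p.1, p.2 + 1))) ((range (n + 1)).image (fun v => (v, 0))) := by
    refine disjoint_left.2 fun p h1 h2 => ?_
    rw [mem_image] at h1 h2
    obtain ⟨q, -, rfl⟩ := h1
    obtain ⟨a, -, h⟩ := h2
    have := congrArg Prod.snd h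
    simp only at this
    omega
  have h1 : Function.Injective (fun p : ℕ × ℕ => (p.1, p.2 + 1)) := by
    intro p q h
    simp only [Prod.mk.injEq] at h
    exact Prod.ext h.1 (by omega)
  have h2 : Function.Injective (fun v : ℕ => (v, 0)) := by
    intro a b h
    simpa only [Prod.mk.injEq, and_true] using h
  rw [triIdx_succ, card_union_of_disjoint hd, card_image_of_injective _ h1, card_image_of_injective _ h2, card_range]

/-- ★ `2 · #triIdx n = n (n + 1)`: the triangle has `n (n + 1) / 2` points. [folklore] -/
private theorem two_mul_card_triIdx (n : ℕ) : 2 * #(triIdx n) = n * (n + 1) := by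
  induction n with
  | zero => rfl
  | succ n ih => rw [card_triIdx_succ]; nlinarith [ih]

/-- The tetrahedron of size `n + 1` is the shifted tetrahedron of size `n` plus a bottom triangle. [folklore] -/
private theorem tetIdx_succ (n : ℕ) :
    tetIdx (n + 1) = (tetIdx n).image (fun p => (p.1, p.2.1, p.2.2 + 1)) ∪
      (triIdx (n + 1)).image (fun q => (q.1, q.2, 0)) := by
  ext p
  rw [mem_union, mem_image, mem_image, mem_tetIdx]
  constructor
  · intro h
    by_cases hu : p.2.2 = 0
    · exact Or.inr ⟨(p.1, p.2.1), mem_triIdx.2 (by simp only; omega), Prod.ext rfl (Prod.ext rfl hu.symm)⟩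
    · refine Or.inl ⟨(p.1, p.2.1, p.2.2 - 1), mem_tetIdx.2 (by simp only; omega), Prod.ext rfl (Prod.ext rfl ?_)⟩
      simp only
      omega
  · rintro (⟨q, hq, rfl⟩ | ⟨q, hq, rfl⟩)
    · have := mem_tetIdx.1 hq
      simp only
      omega
    · have := mem_triIdx.1 hq
      simp only
      omega

/-- `#tetIdx (n + 1) = #tetIdx n + #triIdx (n + 1)`. [folklore] -/
private theorem card_tetIdx_succ (n : ℕ) : #(tetIdx (n + 1)) = #(tetIdx n) + #(triIdx (n + 1)) := by
  have hd : Disjoint ((tetIdx n).image (fun p => (p.1, p.2.1, p.2.2 + 1)))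
      ((triIdx (n + 1)).image (fun q => (q.1, q.2, 0))) := by
    refine disjoint_left.2 fun p h1 h2 => ?_
    rw [mem_image] at h1 h2
    obtain ⟨q, -, rfl⟩ := h1
    obtain ⟨a, -, h⟩ := h2
    have := congrArg (fun x => x.2.2) h
    simp only at this
    omega
  have h1 : Function.Injective (fun p : ℕ × ℕ × ℕ => (p.1, p.2.1, p.2.2 + 1)) := by
    intro p q h
    simp only [Prod.mk.injEq] at h
    exact Prod.ext h.1 (Prod.ext h.2.1 (by omega))
  have h2 : Function.Injective (fun q : ℕ × ℕ => (q.1, q.2, 0)) := by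
    intro a b h
    simp only [Prod.mk.injEq, and_true] at h
    exact Prod.ext h.1 h.2
  rw [tetIdx_succ, card_union_of_disjoint hd, card_image_of_injective _ h1, card_image_of_injective _ h2]

/-- ★ `6 · #tetIdx n = n (n + 1) (n + 2)`: the tetrahedron has `C(n + 2, 3)` points. [folklore] -/
private theorem six_mul_card_tetIdx (n : ℕ) : 6 * #(tetIdx n) = n * (n + 1) * (n + 2) := by
  induction n with
  | zero => rfl
  | succ n ih => rw [card_tetIdx_succ]; nlinarith [ih, two_mul_card_triIdx (n + 1)]

/-- The double triangle of size `n + 1` is the shifted one of size `n` plus a bottom square. [folklore] -/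
private theorem dtrIdx_succ (n : ℕ) :
    dtrIdx (n + 1) = (dtrIdx n).image (fun p => (p.1, p.2.1, p.2.2 + 1)) ∪
      ((range (n + 1)) ×ˢ (range (n + 1))).image (fun q => (q.1, q.2, 0)) := by
  ext p
  rw [mem_union, mem_image, mem_image, mem_dtrIdx]
  constructor
  · intro h
    by_cases hu : p.2.2 = 0
    · exact Or.inr ⟨(p.1, p.2.1), mem_product.2 ⟨mem_range.2 (by omega), mem_range.2 (by omega)⟩,
        Prod.ext rfl (Prod.ext rfl hu.symm)⟩
    · refine Or.inl ⟨(p.1, p.2.1, p.2.2 - 1), mem_dtrIdx.2 (by simp only; omega), Prod.ext rfl (Prod.ext rfl ?_)⟩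
      simp only
      omega
  · rintro (⟨q, hq, rfl⟩ | ⟨q, hq, rfl⟩)
    · have := mem_dtrIdx.1 hq
      simp only
      omega
    · have := mem_product.1 hq
      rw [mem_range, mem_range] at this
      simp only
      omega

/-- `#dtrIdx (n + 1) = #dtrIdx n + (n + 1)²`. [folklore] -/
private theorem card_dtrIdx_succ (n : ℕ) : #(dtrIdx (n + 1)) = #(dtrIdx n) + (n + 1) * (n + 1) := by
  have hd : Disjoint ((dtrIdx n).image (fun p => (p.1, p.2.1, p.2.2 + 1)))
      (((range (n + 1)) ×ˢ (range (n + 1))).image (fun q => (q.1, q.2, 0))) := by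
    refine disjoint_left.2 fun p h1 h2 => ?_
    rw [mem_image] at h1 h2
    obtain ⟨q, -, rfl⟩ := h1
    obtain ⟨a, -, h⟩ := h2
    have := congrArg (fun x => x.2.2) h
    simp only at this
    omega
  have h1 : Function.Injective (fun p : ℕ × ℕ × ℕ => (p.1, p.2.1, p.2.2 + 1)) := by
    intro p q h
    simp only [Prod.mk.injEq] at h
    exact Prod.ext h.1 (Prod.ext h.2.1 (by omega))
  have h2 : Function.Injective (fun q : ℕ × ℕ => (q.1, q.2, 0)) := by
    intro a b h
    simp only [Prod.mk.injEq, and_true] at h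
    exact Prod.ext h.1 h.2
  rw [dtrIdx_succ, card_union_of_disjoint hd, card_image_of_injective _ h1, card_image_of_injective _ h2,
    card_product, card_range]

/-- ★ `6 · #dtrIdx n = n (n + 1) (2n + 1)`: the double triangle has `1² + 2² + ⋯ + n²` points. [folklore] -/
private theorem six_mul_card_dtrIdx (n : ℕ) : 6 * #(dtrIdx n) = n * (n + 1) * (2 * n + 1) := by
  induction n with
  | zero => rfl
  | succ n ih => rw [card_dtrIdx_succ]; nlinarith [ih]

/-! ### §10  The ten images, their cardinalities, the union and the count -/

open Classical in
/-- The A2 blocks, indexed by the triangle `i + u ≤ k − 2`. [cite: EntingJensen2009, §7.4.2, Fig. 7.10] -/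
noncomputable def a2Img (k : ℕ) : Finset (ℕ → Site 2) := (triIdx (k - 1)).image fun p => s3a k (p.1) (p.2)

open Classical in
/-- The A3 blocks, indexed by the tetrahedron `v + i + u ≤ k − 3` (`a = v + i + 1`). [cite: EntingJensen2009, §7.4.2,
    Fig. 7.10] -/
noncomputable def a3Img (k : ℕ) : Finset (ℕ → Site 2) := (tetIdx (k - 2)).image fun p => s3b k (p.1 + p.2.1
    + 1) (p.2.1) (p.2.2)

open Classical in
/-- The A4 blocks, indexed by the triangle `v + u ≤ k − 2` (`i = v + u`). [cite: EntingJensen2009, §7.4.2, Fig. 7.10] -/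
noncomputable def a4Img (k : ℕ) : Finset (ℕ → Site 2) := (triIdx (k - 1)).image fun p => s3c k (p.1 + p.2) (p.2)

open Classical in
/-- The A5 blocks, indexed by the triangle `v + i ≤ k − 2` (`a = v + i + 1`). [cite: EntingJensen2009, §7.4.2,
    Fig. 7.10] -/
noncomputable def a5Img (k : ℕ) : Finset (ℕ → Site 2) := (triIdx (k - 1)).image fun p => s3d k (p.1 + p.2 + 1) (p.2)

open Classical in
/-- The A6 blocks, indexed by `a − 1 < k − 1` times the triangle `i + u ≤ k − 2`. [cite: EntingJensen2009, §7.4.2,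
    Fig. 7.10] -/
noncomputable def a6Img (k : ℕ) : Finset (ℕ → Site 2)
    := ((range (k - 1)) ×ˢ triIdx (k - 1)).image fun p => s3e k (p.1 + 1) (p.2.1) (p.2.2)

open Classical in
/-- The B2 blocks with `i + u ≤ k − 3`, indexed by the double triangle (`a = v + 1`). [cite: EntingJensen2009,
    §7.4.2, Fig. 7.10] -/
noncomputable def b2ImgLo (k : ℕ) : Finset (ℕ → Site 2) := (dtrIdx (k - 2)).image fun p => s3f k (p.1
    + 1) (p.2.1) (p.2.2)

open Classical in
/-- The B2 blocks with `i + u = k − 2`, indexed by the triangle `v + u ≤ k − 3` (`a = v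
    + 1`). [cite: EntingJensen2009, §7.4.2, Fig. 7.10] -/
noncomputable def b2ImgMid (k : ℕ) : Finset (ℕ → Site 2) := (triIdx (k - 2)).image fun p => s3f k (p.1
    + 1) (k - 2 - p.2) (p.2)

open Classical in
/-- The B2 blocks with `i + u = k − 1`, indexed by the triangle `v + u ≤ k − 3` (`a = v
    + 1`). [cite: EntingJensen2009, §7.4.2, Fig. 7.10] -/
noncomputable def b2ImgHi (k : ℕ) : Finset (ℕ → Site 2) := (triIdx (k - 2)).image fun p => s3f k (p.1
    + 1) (k - 1 - p.2) (p.2)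

open Classical in
/-- The B3 blocks with `g = 0`, indexed by the triangle `i + u ≤ k − 2`. [cite: EntingJensen2009, §7.4.2, Fig. 7.10] -/
noncomputable def b3ImgLo (k : ℕ) : Finset (ℕ → Site 2) := (triIdx (k - 1)).image fun p => s3g k (p.1) (p.2) (0)

open Classical in
/-- The B3 blocks with `g = 1`, indexed by the triangle `i + u ≤ k − 3`. [cite: EntingJensen2009, §7.4.2, Fig. 7.10] -/
noncomputable def b3ImgHi (k : ℕ) : Finset (ℕ → Site 2) := (triIdx (k - 2)).image fun p => s3g k (p.1) (p.2) (1)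

open Classical in
/-- What a member of `a2Img k` is. [cite: EntingJensen2009, §7.4.2, Fig. 7.10] -/
theorem exists_of_mem_a2Img {k : ℕ} {w : ℕ → Site 2} (hk : 2 ≤ k) (h : w ∈ a2Img k) :
    ∃ i u : ℕ, (i + u + 2 ≤ k) ∧ s3a k i u = w := by
  rw [a2Img, mem_image] at h
  obtain ⟨p, hp, rfl⟩ := h
  have hq := mem_triIdx.1 hp
  exact ⟨p.1, p.2, by omega, rfl⟩

open Classical in
/-- What a member of `a3Img k` is. [cite: EntingJensen2009, §7.4.2, Fig. 7.10] -/
theorem exists_of_mem_a3Img {k : ℕ} {w : ℕ → Site 2} (hk : 2 ≤ k) (h : w ∈ a3Img k) :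
    ∃ a i u : ℕ, (i + 1 ≤ a ∧ a + u + 2 ≤ k) ∧ s3b k a i u = w := by
  rw [a3Img, mem_image] at h
  obtain ⟨p, hp, rfl⟩ := h
  have hq := mem_tetIdx.1 hp
  exact ⟨p.1 + p.2.1 + 1, p.2.1, p.2.2, ⟨by omega, by omega⟩, rfl⟩

open Classical in
/-- What a member of `a4Img k` is. [cite: EntingJensen2009, §7.4.2, Fig. 7.10] -/
theorem exists_of_mem_a4Img {k : ℕ} {w : ℕ → Site 2} (hk : 2 ≤ k) (h : w ∈ a4Img k) :
    ∃ i u : ℕ, (u ≤ i ∧ i + 2 ≤ k) ∧ s3c k i u = w := by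
  rw [a4Img, mem_image] at h
  obtain ⟨p, hp, rfl⟩ := h
  have hq := mem_triIdx.1 hp
  exact ⟨p.1 + p.2, p.2, ⟨by omega, by omega⟩, rfl⟩

open Classical in
/-- What a member of `a5Img k` is. [cite: EntingJensen2009, §7.4.2, Fig. 7.10] -/
theorem exists_of_mem_a5Img {k : ℕ} {w : ℕ → Site 2} (hk : 2 ≤ k) (h : w ∈ a5Img k) :
    ∃ a i : ℕ, (i + 1 ≤ a ∧ a + 1 ≤ k ∧ i + 2 ≤ k) ∧ s3d k a i = w := by
  rw [a5Img, mem_image] at h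
  obtain ⟨p, hp, rfl⟩ := h
  have hq := mem_triIdx.1 hp
  exact ⟨p.1 + p.2 + 1, p.2, ⟨by omega, by omega, by omega⟩, rfl⟩

open Classical in
/-- What a member of `a6Img k` is. [cite: EntingJensen2009, §7.4.2, Fig. 7.10] -/
theorem exists_of_mem_a6Img {k : ℕ} {w : ℕ → Site 2} (hk : 2 ≤ k) (h : w ∈ a6Img k) :
    ∃ a i u : ℕ, (1 ≤ a ∧ a + 1 ≤ k ∧ i + u + 2 ≤ k) ∧ s3e k a i u = w := by
  rw [a6Img, mem_image] at h
  obtain ⟨p, hp, rfl⟩ := h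
  have hq := mem_product.1 hp
  rw [mem_range, mem_triIdx] at hq
  exact ⟨p.1 + 1, p.2.1, p.2.2, ⟨by omega, by omega, by omega⟩, rfl⟩

open Classical in
/-- What a member of `b2ImgLo k` is. [cite: EntingJensen2009, §7.4.2, Fig. 7.10] -/
theorem exists_of_mem_b2ImgLo {k : ℕ} {w : ℕ → Site 2} (hk : 2 ≤ k) (h : w ∈ b2ImgLo k) :
    ∃ a i u : ℕ, (1 ≤ a ∧ a + u + 2 ≤ k ∧ i + u + 1 ≤ k ∧ i + u + 3 ≤ k) ∧ s3f k a i u = w := by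
  rw [b2ImgLo, mem_image] at h
  obtain ⟨p, hp, rfl⟩ := h
  have hq := mem_dtrIdx.1 hp
  exact ⟨p.1 + 1, p.2.1, p.2.2, ⟨by omega, by omega, by omega, by omega⟩, rfl⟩

open Classical in
/-- What a member of `b2ImgMid k` is. [cite: EntingJensen2009, §7.4.2, Fig. 7.10] -/
theorem exists_of_mem_b2ImgMid {k : ℕ} {w : ℕ → Site 2} (hk : 2 ≤ k) (h : w ∈ b2ImgMid k) :
    ∃ a i u : ℕ, (1 ≤ a ∧ a + u + 2 ≤ k ∧ i + u + 1 ≤ k ∧ i + u + 2 = k) ∧ s3f k a i u = w := by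
  rw [b2ImgMid, mem_image] at h
  obtain ⟨p, hp, rfl⟩ := h
  have hq := mem_triIdx.1 hp
  exact ⟨p.1 + 1, k - 2 - p.2, p.2, ⟨by omega, by omega, by omega, by omega⟩, rfl⟩

open Classical in
/-- What a member of `b2ImgHi k` is. [cite: EntingJensen2009, §7.4.2, Fig. 7.10] -/
theorem exists_of_mem_b2ImgHi {k : ℕ} {w : ℕ → Site 2} (hk : 2 ≤ k) (h : w ∈ b2ImgHi k) :
    ∃ a i u : ℕ, (1 ≤ a ∧ a + u + 2 ≤ k ∧ i + u + 1 ≤ k ∧ i + u + 1 = k) ∧ s3f k a i u = w := by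
  rw [b2ImgHi, mem_image] at h
  obtain ⟨p, hp, rfl⟩ := h
  have hq := mem_triIdx.1 hp
  exact ⟨p.1 + 1, k - 1 - p.2, p.2, ⟨by omega, by omega, by omega, by omega⟩, rfl⟩

open Classical in
/-- What a member of `b3ImgLo k` is. [cite: EntingJensen2009, §7.4.2, Fig. 7.10] -/
theorem exists_of_mem_b3ImgLo {k : ℕ} {w : ℕ → Site 2} (hk : 2 ≤ k) (h : w ∈ b3ImgLo k) :
    ∃ i u g : ℕ, (g ≤ 1 ∧ i + u + g + 2 ≤ k ∧ g = 0) ∧ s3g k i u g = w := by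
  rw [b3ImgLo, mem_image] at h
  obtain ⟨p, hp, rfl⟩ := h
  have hq := mem_triIdx.1 hp
  exact ⟨p.1, p.2, 0, ⟨by omega, by omega, by omega⟩, rfl⟩

open Classical in
/-- What a member of `b3ImgHi k` is. [cite: EntingJensen2009, §7.4.2, Fig. 7.10] -/
theorem exists_of_mem_b3ImgHi {k : ℕ} {w : ℕ → Site 2} (hk : 2 ≤ k) (h : w ∈ b3ImgHi k) :
    ∃ i u g : ℕ, (g ≤ 1 ∧ i + u + g + 2 ≤ k ∧ g = 1) ∧ s3g k i u g = w := by
  rw [b3ImgHi, mem_image] at h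
  obtain ⟨p, hp, rfl⟩ := h
  have hq := mem_triIdx.1 hp
  exact ⟨p.1, p.2, 1, ⟨by omega, by omega, by omega⟩, rfl⟩

open Classical in
/-- `#a2Img k = #(triIdx (k - 1))` (`k ≥ 2`). [cite: EntingJensen2009, §7.4.2, Fig. 7.10] -/
theorem card_a2Img {k : ℕ} (hk : 2 ≤ k) : #(a2Img k) = #(triIdx (k - 1)) := by
  rw [a2Img, card_image_of_injOn]
  intro p hp p' hp' e
  rw [mem_coe] at hp hp'
  have hq := mem_triIdx.1 hp
  have hq' := mem_triIdx.1 hp'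
  obtain ⟨e1, e2⟩ := s3a_inj (by omega) (by omega) e
  exact Prod.ext (by omega) (by omega)

open Classical in
/-- `#a3Img k = #(tetIdx (k - 2))` (`k ≥ 2`). [cite: EntingJensen2009, §7.4.2, Fig. 7.10] -/
theorem card_a3Img {k : ℕ} (hk : 2 ≤ k) : #(a3Img k) = #(tetIdx (k - 2)) := by
  rw [a3Img, card_image_of_injOn]
  intro p hp p' hp' e
  rw [mem_coe] at hp hp'
  have hq := mem_tetIdx.1 hp
  have hq' := mem_tetIdx.1 hp'
  obtain ⟨e1, e2, e3⟩ := s3b_inj (by omega) (by omega) (by omega) (by omega) e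
  exact Prod.ext (by omega) (Prod.ext (by omega) (by omega))

open Classical in
/-- `#a4Img k = #(triIdx (k - 1))` (`k ≥ 2`). [cite: EntingJensen2009, §7.4.2, Fig. 7.10] -/
theorem card_a4Img {k : ℕ} (hk : 2 ≤ k) : #(a4Img k) = #(triIdx (k - 1)) := by
  rw [a4Img, card_image_of_injOn]
  intro p hp p' hp' e
  rw [mem_coe] at hp hp'
  have hq := mem_triIdx.1 hp
  have hq' := mem_triIdx.1 hp'
  obtain ⟨e1, e2⟩ := s3c_inj (by omega) (by omega) (by omega) (by omega) e
  exact Prod.ext (by omega) (by omega)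

open Classical in
/-- `#a5Img k = #(triIdx (k - 1))` (`k ≥ 2`). [cite: EntingJensen2009, §7.4.2, Fig. 7.10] -/
theorem card_a5Img {k : ℕ} (hk : 2 ≤ k) : #(a5Img k) = #(triIdx (k - 1)) := by
  rw [a5Img, card_image_of_injOn]
  intro p hp p' hp' e
  rw [mem_coe] at hp hp'
  have hq := mem_triIdx.1 hp
  have hq' := mem_triIdx.1 hp'
  obtain ⟨e1, e2⟩ := s3d_inj (by omega) (by omega) (by omega) (by omega) (by omega) (by omega) e
  exact Prod.ext (by omega) (by omega)

open Classical in
/-- `#a6Img k = #((range (k - 1)) ×ˢ triIdx (k - 1))` (`k ≥ 2`). [cite: EntingJensen2009, §7.4.2, Fig. 7.10] -/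
theorem card_a6Img {k : ℕ} (hk : 2 ≤ k) : #(a6Img k) = #((range (k - 1)) ×ˢ triIdx (k - 1)) := by
  rw [a6Img, card_image_of_injOn]
  intro p hp p' hp' e
  rw [mem_coe] at hp hp'
  have hq := mem_product.1 hp
  rw [mem_range, mem_triIdx] at hq
  have hq' := mem_product.1 hp'
  rw [mem_range, mem_triIdx] at hq'
  obtain ⟨e1, e2, e3⟩ := s3e_inj (by omega) (by omega) (by omega) (by omega) (by omega) (by omega) e
  exact Prod.ext (by omega) (Prod.ext (by omega) (by omega))

open Classical in
/-- `#b2ImgLo k = #(dtrIdx (k - 2))` (`k ≥ 2`). [cite: EntingJensen2009, §7.4.2, Fig. 7.10] -/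
theorem card_b2ImgLo {k : ℕ} (hk : 2 ≤ k) : #(b2ImgLo k) = #(dtrIdx (k - 2)) := by
  rw [b2ImgLo, card_image_of_injOn]
  intro p hp p' hp' e
  rw [mem_coe] at hp hp'
  have hq := mem_dtrIdx.1 hp
  have hq' := mem_dtrIdx.1 hp'
  obtain ⟨e1, e2, e3⟩ := s3f_inj (by omega) (by omega) (by omega) (by omega) (by omega) (by omega) e
  exact Prod.ext (by omega) (Prod.ext (by omega) (by omega))

open Classical in
/-- `#b2ImgMid k = #(triIdx (k - 2))` (`k ≥ 2`). [cite: EntingJensen2009, §7.4.2, Fig. 7.10] -/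
theorem card_b2ImgMid {k : ℕ} (hk : 2 ≤ k) : #(b2ImgMid k) = #(triIdx (k - 2)) := by
  rw [b2ImgMid, card_image_of_injOn]
  intro p hp p' hp' e
  rw [mem_coe] at hp hp'
  have hq := mem_triIdx.1 hp
  have hq' := mem_triIdx.1 hp'
  obtain ⟨e1, e2, e3⟩ := s3f_inj (by omega) (by omega) (by omega) (by omega) (by omega) (by omega) e
  exact Prod.ext (by omega) (by omega)

open Classical in
/-- `#b2ImgHi k = #(triIdx (k - 2))` (`k ≥ 2`). [cite: EntingJensen2009, §7.4.2, Fig. 7.10] -/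
theorem card_b2ImgHi {k : ℕ} (hk : 2 ≤ k) : #(b2ImgHi k) = #(triIdx (k - 2)) := by
  rw [b2ImgHi, card_image_of_injOn]
  intro p hp p' hp' e
  rw [mem_coe] at hp hp'
  have hq := mem_triIdx.1 hp
  have hq' := mem_triIdx.1 hp'
  obtain ⟨e1, e2, e3⟩ := s3f_inj (by omega) (by omega) (by omega) (by omega) (by omega) (by omega) e
  exact Prod.ext (by omega) (by omega)

open Classical in
/-- `#b3ImgLo k = #(triIdx (k - 1))` (`k ≥ 2`). [cite: EntingJensen2009, §7.4.2, Fig. 7.10] -/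
theorem card_b3ImgLo {k : ℕ} (hk : 2 ≤ k) : #(b3ImgLo k) = #(triIdx (k - 1)) := by
  rw [b3ImgLo, card_image_of_injOn]
  intro p hp p' hp' e
  rw [mem_coe] at hp hp'
  have hq := mem_triIdx.1 hp
  have hq' := mem_triIdx.1 hp'
  obtain ⟨e1, e2, e3⟩ := s3g_inj (by omega) (by omega) (by omega) (by omega) e
  exact Prod.ext (by omega) (by omega)

open Classical in
/-- `#b3ImgHi k = #(triIdx (k - 2))` (`k ≥ 2`). [cite: EntingJensen2009, §7.4.2, Fig. 7.10] -/
theorem card_b3ImgHi {k : ℕ} (hk : 2 ≤ k) : #(b3ImgHi k) = #(triIdx (k - 2)) := by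
  rw [b3ImgHi, card_image_of_injOn]
  intro p hp p' hp' e
  rw [mem_coe] at hp hp'
  have hq := mem_triIdx.1 hp
  have hq' := mem_triIdx.1 hp'
  obtain ⟨e1, e2, e3⟩ := s3g_inj (by omega) (by omega) (by omega) (by omega) e
  exact Prod.ext (by omega) (by omega)

open Classical in
/-- **The DDDUUU Finset at slack four**: the blocks of the seven families A2–A6, B2, B3 of length `6k + 4`.
[cite: EntingJensen2009, §7.4.2, Fig. 7.10] [cite: MadrasSlade1993, §4.2, Definition 4.2.1 (p. 90)] -/
noncomputable def dddBlocks (k : ℕ) : Finset (ℕ → Site 2) :=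
  a2Img k ∪ a3Img k ∪ a4Img k ∪ a5Img k ∪ a6Img k ∪ b2ImgLo k ∪ b2ImgMid k ∪ b2ImgHi k ∪ b3ImgLo k ∪ b3ImgHi k

open Classical in
/-- The image `a3Img` is disjoint from the previous ones. [cite: EntingJensen2009, §7.4.2, Fig. 7.10] -/
private theorem disj_a3Img {k : ℕ} (hk : 2 ≤ k) :
    Disjoint (a2Img k) (a3Img k) := by
  refine disjoint_left.2 fun w h1 h2 => ?_
  obtain ⟨a', i', u', hb, e'⟩ := exists_of_mem_a3Img hk h2
  obtain ⟨i, u, ha, e⟩ := exists_of_mem_a2Img hk h1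
  exact s3a_ne_s3b (by omega) (by omega) (by omega) (e.trans e'.symm)

open Classical in
/-- The image `a4Img` is disjoint from the previous ones. [cite: EntingJensen2009, §7.4.2, Fig. 7.10] -/
private theorem disj_a4Img {k : ℕ} (hk : 2 ≤ k) :
    Disjoint (a2Img k ∪ a3Img k) (a4Img k) := by
  refine disjoint_left.2 fun w h1 h2 => ?_
  obtain ⟨i', u', hb, e'⟩ := exists_of_mem_a4Img hk h2
  simp only [mem_union] at h1
  rcases h1 with (h1 | h1)
  · obtain ⟨i, u, ha, e⟩ := exists_of_mem_a2Img hk h1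
    exact s3a_ne_s3c (by omega) (by omega) (by omega) (e.trans e'.symm)
  · obtain ⟨a, i, u, ha, e⟩ := exists_of_mem_a3Img hk h1
    exact s3b_ne_s3c (by omega) (by omega) (by omega) (by omega) (e.trans e'.symm)

open Classical in
/-- The image `a5Img` is disjoint from the previous ones. [cite: EntingJensen2009, §7.4.2, Fig. 7.10] -/
private theorem disj_a5Img {k : ℕ} (hk : 2 ≤ k) :
    Disjoint (a2Img k ∪ a3Img k ∪ a4Img k) (a5Img k) := by
  refine disjoint_left.2 fun w h1 h2 => ?_
  obtain ⟨a', i', hb, e'⟩ := exists_of_mem_a5Img hk h2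
  simp only [mem_union] at h1
  rcases h1 with ((h1 | h1) | h1)
  · obtain ⟨i, u, ha, e⟩ := exists_of_mem_a2Img hk h1
    exact s3a_ne_s3d (by omega) (by omega) (by omega) (by omega) (e.trans e'.symm)
  · obtain ⟨a, i, u, ha, e⟩ := exists_of_mem_a3Img hk h1
    exact s3b_ne_s3d (by omega) (by omega) (by omega) (by omega) (by omega) (e.trans e'.symm)
  · obtain ⟨i, u, ha, e⟩ := exists_of_mem_a4Img hk h1
    exact s3c_ne_s3d (by omega) (by omega) (by omega) (by omega) (by omega) (e.trans e'.symm)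

open Classical in
/-- The image `a6Img` is disjoint from the previous ones. [cite: EntingJensen2009, §7.4.2, Fig. 7.10] -/
private theorem disj_a6Img {k : ℕ} (hk : 2 ≤ k) :
    Disjoint (a2Img k ∪ a3Img k ∪ a4Img k ∪ a5Img k) (a6Img k) := by
  refine disjoint_left.2 fun w h1 h2 => ?_
  obtain ⟨a', i', u', hb, e'⟩ := exists_of_mem_a6Img hk h2
  simp only [mem_union] at h1
  rcases h1 with (((h1 | h1) | h1) | h1)
  · obtain ⟨i, u, ha, e⟩ := exists_of_mem_a2Img hk h1
    exact s3a_ne_s3e (by omega) (by omega) (by omega) (by omega) (e.trans e'.symm)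
  · obtain ⟨a, i, u, ha, e⟩ := exists_of_mem_a3Img hk h1
    exact s3b_ne_s3e (by omega) (by omega) (by omega) (by omega) (by omega) (e.trans e'.symm)
  · obtain ⟨i, u, ha, e⟩ := exists_of_mem_a4Img hk h1
    exact s3c_ne_s3e (by omega) (by omega) (by omega) (by omega) (by omega) (e.trans e'.symm)
  · obtain ⟨a, i, ha, e⟩ := exists_of_mem_a5Img hk h1
    exact s3d_ne_s3e (by omega) (by omega) (by omega) (by omega) (by omega) (by omega) (e.trans e'.symm)

open Classical in
/-- The image `b2ImgLo` is disjoint from the previous ones. [cite: EntingJensen2009, §7.4.2, Fig. 7.10] -/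
private theorem disj_b2ImgLo {k : ℕ} (hk : 2 ≤ k) :
    Disjoint (a2Img k ∪ a3Img k ∪ a4Img k ∪ a5Img k ∪ a6Img k) (b2ImgLo k) := by
  refine disjoint_left.2 fun w h1 h2 => ?_
  obtain ⟨a', i', u', hb, e'⟩ := exists_of_mem_b2ImgLo hk h2
  simp only [mem_union] at h1
  rcases h1 with ((((h1 | h1) | h1) | h1) | h1)
  · obtain ⟨i, u, ha, e⟩ := exists_of_mem_a2Img hk h1
    exact s3a_ne_s3f (by omega) (by omega) (by omega) (by omega) (e.trans e'.symm)
  · obtain ⟨a, i, u, ha, e⟩ := exists_of_mem_a3Img hk h1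
    exact s3b_ne_s3f (by omega) (by omega) (by omega) (by omega) (by omega) (e.trans e'.symm)
  · obtain ⟨i, u, ha, e⟩ := exists_of_mem_a4Img hk h1
    exact s3c_ne_s3f (by omega) (by omega) (by omega) (by omega) (by omega) (e.trans e'.symm)
  · obtain ⟨a, i, ha, e⟩ := exists_of_mem_a5Img hk h1
    exact s3d_ne_s3f (by omega) (by omega) (by omega) (by omega) (by omega) (by omega) (e.trans e'.symm)
  · obtain ⟨a, i, u, ha, e⟩ := exists_of_mem_a6Img hk h1
    exact s3e_ne_s3f (by omega) (by omega) (by omega) (by omega) (by omega) (by omega) (e.trans e'.symm)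

open Classical in
/-- The image `b2ImgMid` is disjoint from the previous ones. [cite: EntingJensen2009, §7.4.2, Fig. 7.10] -/
private theorem disj_b2ImgMid {k : ℕ} (hk : 2 ≤ k) :
    Disjoint (a2Img k ∪ a3Img k ∪ a4Img k ∪ a5Img k ∪ a6Img k ∪ b2ImgLo k) (b2ImgMid k) := by
  refine disjoint_left.2 fun w h1 h2 => ?_
  obtain ⟨a', i', u', hb, e'⟩ := exists_of_mem_b2ImgMid hk h2
  simp only [mem_union] at h1
  rcases h1 with (((((h1 | h1) | h1) | h1) | h1) | h1)
  · obtain ⟨i, u, ha, e⟩ := exists_of_mem_a2Img hk h1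
    exact s3a_ne_s3f (by omega) (by omega) (by omega) (by omega) (e.trans e'.symm)
  · obtain ⟨a, i, u, ha, e⟩ := exists_of_mem_a3Img hk h1
    exact s3b_ne_s3f (by omega) (by omega) (by omega) (by omega) (by omega) (e.trans e'.symm)
  · obtain ⟨i, u, ha, e⟩ := exists_of_mem_a4Img hk h1
    exact s3c_ne_s3f (by omega) (by omega) (by omega) (by omega) (by omega) (e.trans e'.symm)
  · obtain ⟨a, i, ha, e⟩ := exists_of_mem_a5Img hk h1
    exact s3d_ne_s3f (by omega) (by omega) (by omega) (by omega) (by omega) (by omega) (e.trans e'.symm)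
  · obtain ⟨a, i, u, ha, e⟩ := exists_of_mem_a6Img hk h1
    exact s3e_ne_s3f (by omega) (by omega) (by omega) (by omega) (by omega) (by omega) (e.trans e'.symm)
  · obtain ⟨a, i, u, ha, e⟩ := exists_of_mem_b2ImgLo hk h1
    obtain ⟨f1, f2, f3⟩ := s3f_inj (by omega) (by omega) (by omega) (by omega) (by omega) (by omega) (e.trans e'.symm)
    omega

open Classical in
/-- The image `b2ImgHi` is disjoint from the previous ones. [cite: EntingJensen2009, §7.4.2, Fig. 7.10] -/
private theorem disj_b2ImgHi {k : ℕ} (hk : 2 ≤ k) :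
    Disjoint (a2Img k ∪ a3Img k ∪ a4Img k ∪ a5Img k ∪ a6Img k ∪ b2ImgLo k ∪ b2ImgMid k) (b2ImgHi k) := by
  refine disjoint_left.2 fun w h1 h2 => ?_
  obtain ⟨a', i', u', hb, e'⟩ := exists_of_mem_b2ImgHi hk h2
  simp only [mem_union] at h1
  rcases h1 with ((((((h1 | h1) | h1) | h1) | h1) | h1) | h1)
  · obtain ⟨i, u, ha, e⟩ := exists_of_mem_a2Img hk h1
    exact s3a_ne_s3f (by omega) (by omega) (by omega) (by omega) (e.trans e'.symm)
  · obtain ⟨a, i, u, ha, e⟩ := exists_of_mem_a3Img hk h1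
    exact s3b_ne_s3f (by omega) (by omega) (by omega) (by omega) (by omega) (e.trans e'.symm)
  · obtain ⟨i, u, ha, e⟩ := exists_of_mem_a4Img hk h1
    exact s3c_ne_s3f (by omega) (by omega) (by omega) (by omega) (by omega) (e.trans e'.symm)
  · obtain ⟨a, i, ha, e⟩ := exists_of_mem_a5Img hk h1
    exact s3d_ne_s3f (by omega) (by omega) (by omega) (by omega) (by omega) (by omega) (e.trans e'.symm)
  · obtain ⟨a, i, u, ha, e⟩ := exists_of_mem_a6Img hk h1
    exact s3e_ne_s3f (by omega) (by omega) (by omega) (by omega) (by omega) (by omega) (e.trans e'.symm)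
  · obtain ⟨a, i, u, ha, e⟩ := exists_of_mem_b2ImgLo hk h1
    obtain ⟨f1, f2, f3⟩ := s3f_inj (by omega) (by omega) (by omega) (by omega) (by omega) (by omega) (e.trans e'.symm)
    omega
  · obtain ⟨a, i, u, ha, e⟩ := exists_of_mem_b2ImgMid hk h1
    obtain ⟨f1, f2, f3⟩ := s3f_inj (by omega) (by omega) (by omega) (by omega) (by omega) (by omega) (e.trans e'.symm)
    omega

open Classical in
/-- The image `b3ImgLo` is disjoint from the previous ones. [cite: EntingJensen2009, §7.4.2, Fig. 7.10] -/
private theorem disj_b3ImgLo {k : ℕ} (hk : 2 ≤ k) :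
    Disjoint (a2Img k ∪ a3Img k ∪ a4Img k ∪ a5Img k ∪ a6Img k ∪ b2ImgLo k ∪ b2ImgMid k ∪ b2ImgHi k) (b3ImgLo k) := by
  refine disjoint_left.2 fun w h1 h2 => ?_
  obtain ⟨i', u', g', hb, e'⟩ := exists_of_mem_b3ImgLo hk h2
  simp only [mem_union] at h1
  rcases h1 with (((((((h1 | h1) | h1) | h1) | h1) | h1) | h1) | h1)
  · obtain ⟨i, u, ha, e⟩ := exists_of_mem_a2Img hk h1
    exact s3a_ne_s3g (by omega) (by omega) (by omega) (e.trans e'.symm)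
  · obtain ⟨a, i, u, ha, e⟩ := exists_of_mem_a3Img hk h1
    exact s3b_ne_s3g (by omega) (by omega) (by omega) (by omega) (e.trans e'.symm)
  · obtain ⟨i, u, ha, e⟩ := exists_of_mem_a4Img hk h1
    exact s3c_ne_s3g (by omega) (by omega) (by omega) (by omega) (e.trans e'.symm)
  · obtain ⟨a, i, ha, e⟩ := exists_of_mem_a5Img hk h1
    exact s3d_ne_s3g (by omega) (by omega) (by omega) (by omega) (by omega) (e.trans e'.symm)
  · obtain ⟨a, i, u, ha, e⟩ := exists_of_mem_a6Img hk h1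
    exact s3e_ne_s3g (by omega) (by omega) (by omega) (by omega) (by omega) (e.trans e'.symm)
  · obtain ⟨a, i, u, ha, e⟩ := exists_of_mem_b2ImgLo hk h1
    exact s3f_ne_s3g (by omega) (by omega) (by omega) (by omega) (by omega) (e.trans e'.symm)
  · obtain ⟨a, i, u, ha, e⟩ := exists_of_mem_b2ImgMid hk h1
    exact s3f_ne_s3g (by omega) (by omega) (by omega) (by omega) (by omega) (e.trans e'.symm)
  · obtain ⟨a, i, u, ha, e⟩ := exists_of_mem_b2ImgHi hk h1
    exact s3f_ne_s3g (by omega) (by omega) (by omega) (by omega) (by omega) (e.trans e'.symm)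

open Classical in
/-- The image `b3ImgHi` is disjoint from the previous ones. [cite: EntingJensen2009, §7.4.2, Fig. 7.10] -/
private theorem disj_b3ImgHi {k : ℕ} (hk : 2 ≤ k) :
    Disjoint (a2Img k ∪ a3Img k ∪ a4Img k ∪ a5Img k ∪ a6Img k ∪ b2ImgLo k ∪ b2ImgMid k ∪ b2ImgHi k
        ∪ b3ImgLo k) (b3ImgHi k) := by
  refine disjoint_left.2 fun w h1 h2 => ?_
  obtain ⟨i', u', g', hb, e'⟩ := exists_of_mem_b3ImgHi hk h2
  simp only [mem_union] at h1
  rcases h1 with ((((((((h1 | h1) | h1) | h1) | h1) | h1) | h1) | h1) | h1)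
  · obtain ⟨i, u, ha, e⟩ := exists_of_mem_a2Img hk h1
    exact s3a_ne_s3g (by omega) (by omega) (by omega) (e.trans e'.symm)
  · obtain ⟨a, i, u, ha, e⟩ := exists_of_mem_a3Img hk h1
    exact s3b_ne_s3g (by omega) (by omega) (by omega) (by omega) (e.trans e'.symm)
  · obtain ⟨i, u, ha, e⟩ := exists_of_mem_a4Img hk h1
    exact s3c_ne_s3g (by omega) (by omega) (by omega) (by omega) (e.trans e'.symm)
  · obtain ⟨a, i, ha, e⟩ := exists_of_mem_a5Img hk h1
    exact s3d_ne_s3g (by omega) (by omega) (by omega) (by omega) (by omega) (e.trans e'.symm)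
  · obtain ⟨a, i, u, ha, e⟩ := exists_of_mem_a6Img hk h1
    exact s3e_ne_s3g (by omega) (by omega) (by omega) (by omega) (by omega) (e.trans e'.symm)
  · obtain ⟨a, i, u, ha, e⟩ := exists_of_mem_b2ImgLo hk h1
    exact s3f_ne_s3g (by omega) (by omega) (by omega) (by omega) (by omega) (e.trans e'.symm)
  · obtain ⟨a, i, u, ha, e⟩ := exists_of_mem_b2ImgMid hk h1
    exact s3f_ne_s3g (by omega) (by omega) (by omega) (by omega) (by omega) (e.trans e'.symm)
  · obtain ⟨a, i, u, ha, e⟩ := exists_of_mem_b2ImgHi hk h1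
    exact s3f_ne_s3g (by omega) (by omega) (by omega) (by omega) (by omega) (e.trans e'.symm)
  · obtain ⟨i, u, g, ha, e⟩ := exists_of_mem_b3ImgLo hk h1
    obtain ⟨f1, f2, f3⟩ := s3g_inj (by omega) (by omega) (by omega) (by omega) (e.trans e'.symm)
    omega

open Classical in
/-- ★★ **The structural count**: `#dddBlocks k` in terms of the index simplices (`k ≥ 2`). [cite: EntingJensen2009,
    §7.4.2, Fig. 7.10] -/
theorem card_dddBlocks_eq {k : ℕ} (hk : 2 ≤ k) :
    #(dddBlocks k) = 4 * #(triIdx (k - 1)) + #(tetIdx (k - 2)) + (k - 1) * #(triIdx (k - 1)) +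
      #(dtrIdx (k - 2)) + 3 * #(triIdx (k - 2)) := by
  rw [dddBlocks, card_union_of_disjoint (disj_b3ImgHi hk), card_union_of_disjoint (disj_b3ImgLo hk),
      card_union_of_disjoint (disj_b2ImgHi hk), card_union_of_disjoint (disj_b2ImgMid hk),
      card_union_of_disjoint (disj_b2ImgLo hk), card_union_of_disjoint (disj_a6Img hk),
      card_union_of_disjoint (disj_a5Img hk), card_union_of_disjoint (disj_a4Img hk),
      card_union_of_disjoint (disj_a3Img hk)]
  rw [card_a2Img hk, card_a3Img hk, card_a4Img hk, card_a5Img hk, card_a6Img hk, card_b2ImgLo hk, card_b2ImgMid hk,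
      card_b2ImgHi hk, card_b3ImgLo hk, card_b3ImgHi hk, card_product, card_range]
  ring

open Classical in
/-- ★★★ **The closed form**: `2 · #dddBlocks k = (k − 1)(2k² + 3k − 4)`, i.e. there are `(k − 1)(2k² + 3k − 4)/2 = 5,
    23, 60, 122, 215, 345, …`
DDDUUU blocks of the seven families at slack four (`k ≥ 2`; A2, A4, A5: `k(k−1)/2` each, A3: `k(k−1)(k−2)/6`,
    A6: `(k−1)·k(k−1)/2`,
B2: `(k−2)(k−1)(2k+3)/6`, B3: `(k−1)²`). [cite: EntingJensen2009, §7.4.2, Fig. 7.10] [cite: MadrasSlade1993, §4.2,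
    Definition 4.2.1 (p. 90)] -/
theorem two_mul_card_dddBlocks {k : ℕ} (hk : 2 ≤ k) :
    2 * #(dddBlocks k) = (k - 1) * (2 * k * k + 3 * k - 4) := by
  obtain ⟨n, rfl⟩ : ∃ n, k = n + 2 := ⟨k - 2, by omega⟩
  have e1 : n + 2 - 1 = n + 1 := by omega
  have e2 : n + 2 - 2 = n := by omega
  have e3 : 2 * (n + 2) * (n + 2) + 3 * (n + 2) - 4 = 2 * n * n + 11 * n + 10 := by ring_nf; omega
  rw [card_dddBlocks_eq hk, e1, e2, e3]
  have h1 := two_mul_card_triIdx (n + 1)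
  have h2 := six_mul_card_tetIdx n
  have h3 := six_mul_card_dtrIdx n
  have h4 := two_mul_card_triIdx n
  have h5 : 2 * ((n + 1) * #(triIdx (n + 1))) = (n + 1) * ((n + 1) * (n + 1 + 1)) := by
    rw [← h1]; ring
  ring_nf at h1 h2 h3 h4 h5 ⊢
  omega

open Classical in
/-- ★★ **Every element of `dddBlocks k` is an irreducible positive wall bridge of length `6k
    + 4` with exactly `k` visits,
three down steps and three up steps** (`k ≥ 2`). [cite: MadrasSlade1993, §4.2,
    Definition 4.2.1 (p. 90)] [cite: Kesten1963SAW, §4]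
[cite: BeatonBousquetMelouDeGierDuminilCopinGuttmann2014, §3.1 (arXiv v5 p. 8)] [cite: EntingJensen2009, §7.4.2,
    Fig. 7.10] -/
theorem dddBlocks_subset {k m : ℕ} (hk : 2 ≤ k) (hm : m = 6 * k + 4) :
    dddBlocks k ⊆ (ipwb m).filter fun ω => visits m ω = k ∧ #(stepsD m ω) = 3 := by
  intro w hw
  rw [mem_filter]
  simp only [dddBlocks, mem_union] at hw
  rcases hw with (((((((((hw | hw) | hw) | hw) | hw) | hw) | hw) | hw) | hw) | hw)
  · obtain ⟨i, u, h, rfl⟩ := exists_of_mem_a2Img hk hw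
    exact ⟨s3a_mem_ipwb (by omega) hm, visits_s3a (by omega) hm,
      by rw [stepsD_s3a (by omega) hm]; exact card_eq_three.2 ⟨_, _, _, by omega, by omega, by omega, rfl⟩⟩
  · obtain ⟨a, i, u, h, rfl⟩ := exists_of_mem_a3Img hk hw
    exact ⟨s3b_mem_ipwb (by omega) (by omega) hm, visits_s3b (by omega) (by omega) hm,
      by rw [stepsD_s3b (by omega) (by omega) hm]; exact card_eq_three.2 ⟨_, _, _, by omega, by omega, by omega, rfl⟩⟩
  · obtain ⟨i, u, h, rfl⟩ := exists_of_mem_a4Img hk hw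
    exact ⟨s3c_mem_ipwb (by omega) (by omega) hm, visits_s3c (by omega) (by omega) hm,
      by rw [stepsD_s3c (by omega) (by omega) hm]; exact card_eq_three.2 ⟨_, _, _, by omega, by omega, by omega, rfl⟩⟩
  · obtain ⟨a, i, h, rfl⟩ := exists_of_mem_a5Img hk hw
    exact ⟨s3d_mem_ipwb (by omega) (by omega) (by omega) hm, visits_s3d (by omega) (by omega) (by omega) hm,
      by rw [stepsD_s3d (by omega) (by omega) (by omega) hm]; exact card_eq_three.2 ⟨_, _, _, by omega, by omega,
          by omega, rfl⟩⟩
  · obtain ⟨a, i, u, h, rfl⟩ := exists_of_mem_a6Img hk hw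
    exact ⟨s3e_mem_ipwb (by omega) (by omega) (by omega) hm, visits_s3e (by omega) (by omega) (by omega) hm,
      by rw [stepsD_s3e (by omega) (by omega) (by omega) hm]; exact card_eq_three.2 ⟨_, _, _, by omega, by omega,
          by omega, rfl⟩⟩
  · obtain ⟨a, i, u, h, rfl⟩ := exists_of_mem_b2ImgLo hk hw
    exact ⟨s3f_mem_ipwb (by omega) (by omega) (by omega) hm, visits_s3f (by omega) (by omega) (by omega) hm,
      by rw [stepsD_s3f (by omega) (by omega) (by omega) hm]; exact card_eq_three.2 ⟨_, _, _, by omega, by omega,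
          by omega, rfl⟩⟩
  · obtain ⟨a, i, u, h, rfl⟩ := exists_of_mem_b2ImgMid hk hw
    exact ⟨s3f_mem_ipwb (by omega) (by omega) (by omega) hm, visits_s3f (by omega) (by omega) (by omega) hm,
      by rw [stepsD_s3f (by omega) (by omega) (by omega) hm]; exact card_eq_three.2 ⟨_, _, _, by omega, by omega,
          by omega, rfl⟩⟩
  · obtain ⟨a, i, u, h, rfl⟩ := exists_of_mem_b2ImgHi hk hw
    exact ⟨s3f_mem_ipwb (by omega) (by omega) (by omega) hm, visits_s3f (by omega) (by omega) (by omega) hm,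
      by rw [stepsD_s3f (by omega) (by omega) (by omega) hm]; exact card_eq_three.2 ⟨_, _, _, by omega, by omega,
          by omega, rfl⟩⟩
  · obtain ⟨i, u, g, h, rfl⟩ := exists_of_mem_b3ImgLo hk hw
    exact ⟨s3g_mem_ipwb (by omega) (by omega) hm, visits_s3g (by omega) (by omega) hm,
      by rw [stepsD_s3g (by omega) (by omega) hm]; exact card_eq_three.2 ⟨_, _, _, by omega, by omega, by omega, rfl⟩⟩
  · obtain ⟨i, u, g, h, rfl⟩ := exists_of_mem_b3ImgHi hk hw
    exact ⟨s3g_mem_ipwb (by omega) (by omega) hm, visits_s3g (by omega) (by omega) hm,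
      by rw [stepsD_s3g (by omega) (by omega) hm]; exact card_eq_three.2 ⟨_, _, _, by omega, by omega, by omega, rfl⟩⟩

/-- ★★★ **Lower bound for the three-down stratum at slack four**: for `k ≥ 2` at least `(k − 1)(2k²
    + 3k − 4)/2` irreducible positive wall
bridges of length `6k
    + 4` with `k` visits have exactly three down steps (the lane's census: the stratum has `(k − 1)(2k² + 3k − 4)/2 + 1`
members, the extra one being the `D U D D U U` block `g3b k` of `…SlackFourThreeDown`). [cite: MadrasSlade1993, §4.2,
    Definition 4.2.1 (p. 90), (4.2.2)]
[cite: EntingJensen2009, §7.4.2, Fig. 7.10] -/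
theorem le_two_mul_card_filter_visits_three_down {k m : ℕ} (hk : 2 ≤ k) (hm : m = 6 * k + 4) :
    (k - 1) * (2 * k * k + 3 * k - 4) ≤ 2 * #((ipwb m).filter fun ω => visits m ω = k ∧ #(stepsD m ω) = 3) := by
  classical
  rw [← two_mul_card_dddBlocks hk]
  exact Nat.mul_le_mul_left 2 (card_le_card (dddBlocks_subset hk hm))

end Literature.Probability.RandomPlanarGeometry.SAW.HexBW.Wall
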